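import Literature.Combinatorics.Optimization.TracialDesigns
import Literature.Combinatorics.Optimization.TracialDesignsLowDegree
import Literature.Barriers.PneNP.TSPExtensionComplexityMatchingsOps
import Literature.Computability.Complexity.KnapsackSosDegree
import HarnessLib

/-!
# Nonpositivity of the design value on low-degree psd strategies — PROOFS (discharge of
`Literature.Combinatorics.Optimization.DesignValueNonposLowDegree`)

Literature-side re-homing (seat `bsd-rank2-lit` GEN 14, idle-time Literature hygiene; `run/shared/lean/pub/bsd-rank2/lit/
HIDDEN-DISCHARGES.md` row PneNP) of the PROVED cone that discharged the named fact
`Literature.Combinatorics.Optimization.DesignValueNonposLowDegree` on the Summits side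
(`Summits/PneNP/PneNP/Theorems/ChebyshevTracialDesignJunta{Count,PatternLaw,MatchingCount,VirtualPositivity,MatchingFiber,
VirtualMoment,MatchingLaw,VirtualForm,LowDegree}.lean` + `ChebyshevTracialDesignLowDegreeHolds.lean`, cell `pnp-psdrank`,
2026-08): the nine modules are concatenated here VERBATIM in dependency order, with the namespace
`Summit.PneNP.PneNP.Theorems.ChebyshevTracialDesignJunta` renamed to
`Literature.Combinatorics.Optimization.ChebyshevTracialDesignJunta`, and the discharge
`Literature.Combinatorics.Optimization.DesignValueNonposLowDegree_holds` is declared at the end in the FACT's namespace, so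
that Literature is closed under its own facts (D-0014/D-0026: net debt −1; no new definition of a notion, no new fact).
Mathematical content and citations are those of the original modules (Grigoriev 2001 knapsack positivity — itself a
discharged Literature fact `Grigoriev2001_knapsackFormNonneg_holds` —, Rothvoß 2017 §2 matching/junta counting,
Lee–Raghavendra–Steurer 2015 §5); each section below keeps its original module docstring.
-/


/-! ## Section from `ChebyshevTracialDesignJuntaCount.lean` -/
/-!
# Junta virtual positivity, part A: counting cuts by their crossing pattern against a perfect matching

Support file for the crux `TracialDecayExp20` (stmt-PneNP-19878) of route `ChebyshevTracialDesign`
(cell pnp-psdrank, local virtual positivity lemma (N1), HOME/pnp-psdrank-p1/N1-LocalVirtualPositivity.md,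
Lemma 1 "pattern law", formalisation steps (i)–(ii)).

For a perfect matching `M` of a vertex set `S` and `U ⊆ S`, every edge of `M` is *crossing*
(`|U ∩ e| = 1`), *internal* (`e ⊆ U`) or *external* (`e ∩ U = ∅`); `|U| = #crossing + 2·#internal`
and Rothvoß's `|δ(U) ∩ M|` [Rothvoß 2017, §2] is `#crossing`. We count the sets `U ⊆ S` with `a` crossing
and `b` internal edges — `C(|M|, a+b)·C(a+b, b)·2^a` (`card_filter_cr_in_eq`) — and, for a sub-matching
`E ⊆ M` with covered vertex set `W` and a prescribed trace `U ∩ W = B`, the fibre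
`#{U : a crossing, b internal, U ∩ W = B} = C(|M|-|E|, a-y+b-z)·C(a-y+b-z, b-z)·2^{a-y}` (`card_fiber_eq`),
where `y, z` are the numbers of edges of `E` crossing resp. inside `B`. These two counting identities give
the pattern law `P_{Q_c}[π] = 2^{-y}[c]_y[(t-c)/2]_z[(n-t-c)/2]_{x-y-z}/[n/2]_x` (part B).

Notation used in the docstrings only (the file introduces no definitions; everything is inline):
`#cr(U,M) := #{e ∈ M | cutCount U e = 1}`, `#in(U,M) := #{e ∈ M | cutCount U e = 2}`,
`N(S,M;a,b) := #{U ⊆ S | #cr(U,M) = a ∧ #in(U,M) = b}`, `T(m;a,b) := C(m,a+b)·C(a+b,b)·2^a`,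
`W(S,E) := {v ∈ S | ∃ e ∈ E, v ∈ e}`.
-/


namespace Literature.Combinatorics.Optimization.ChebyshevTracialDesignJunta

open Finset Literature.Barriers.PneNP Literature.Combinatorics.SimpleGraph.CycleSpace

variable {V : Type*} [DecidableEq V]

/-! ### Crossing / internal edge counts -/

/-- `Crosses U e ↔ |U ∩ e| = 1`. [folklore] -/
private theorem crosses_iff_cutCount_eq_one (U : Finset V) (e : Sym2 V) : Crosses U e ↔ cutCount U e = 1 := by
  induction e using Sym2.ind with
  | h a b =>
    rw [crosses_mk, cutCount_mk]
    by_cases ha : a ∈ U <;> by_cases hb : b ∈ U <;> simp [ha, hb]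

/-- Rothvoß's `cc U M = |δ(U) ∩ M|` is the crossing count `#cr(U,M)`. [cite: Rothvoss2017, §2 (PDF p. 5)] -/
theorem cc_eq_card_filter {n : ℕ} (U : OddSet n) (M : PMatch n) :
    cc U M = (M.1.filter fun e => cutCount U.1 e = 1).card := by
  unfold cc
  congr 1
  exact filter_congr fun e _ => crosses_iff_cutCount_eq_one U.1 e

/-- `|U| = #cr + 2·#in` for a perfect matching of `S ⊇ U`. [cite: Rothvoss2017, §2 (PDF p. 6)] -/
theorem card_eq_cr_add_two_mul_in {S U : Finset V} {M : Finset (Sym2 V)} (h : IsPMOn S M)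
    (hU : U ⊆ S) :
    U.card = (M.filter fun e => cutCount U e = 1).card + 2 * (M.filter fun e => cutCount U e = 2).card := by
  rw [h.card_eq_sum_cutCount hU, sum_cutCount_eq]

/-! ### Locality and additivity -/

/-- `cutCount` of an edge inside `S₁` only sees `U ∩ S₁`. [folklore] -/
private theorem cutCount_inter {U S₁ : Finset V} {e : Sym2 V} (he : e ∈ S₁.sym2) :
    cutCount (U ∩ S₁) e = cutCount U e := by
  induction e using Sym2.ind with
  | h a b =>
    rw [mem_sym2_iff] at he
    have ha : a ∈ S₁ := he a (Sym2.mem_mk_left a b)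
    have hb : b ∈ S₁ := he b (Sym2.mem_mk_right a b)
    simp [cutCount_mk, mem_inter, ha, hb]

/-- The `cutCount = k` count of an edge set inside `S₁` only sees `U ∩ S₁`. [folklore] -/
private theorem card_filter_cutCount_inter {U S₁ : Finset V} {M₁ : Finset (Sym2 V)} (h₁ : M₁ ⊆ S₁.sym2) (k : ℕ) :
    (M₁.filter fun e => cutCount (U ∩ S₁) e = k).card = (M₁.filter fun e => cutCount U e = k).card := by
  congr 1
  exact filter_congr fun e he => by rw [cutCount_inter (h₁ he)]

/-- Additivity of the `cutCount = k` count over a disjoint union of edge sets. [folklore] -/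
private theorem card_filter_cutCount_union {U : Finset V} {M₁ M₂ : Finset (Sym2 V)} (hd : Disjoint M₁ M₂) (k : ℕ) :
    ((M₁ ∪ M₂).filter fun e => cutCount U e = k).card =
      (M₁.filter fun e => cutCount U e = k).card + (M₂.filter fun e => cutCount U e = k).card := by
  rw [filter_union, card_union_of_disjoint (disjoint_filter_filter hd)]

omit [DecidableEq V] in
/-- Edge sets inside disjoint vertex sets are disjoint. [folklore] -/
private theorem disjoint_of_subset_sym2 {S₁ S₂ : Finset V} {M₁ M₂ : Finset (Sym2 V)} (hd : Disjoint S₁ S₂)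
    (h₁ : M₁ ⊆ S₁.sym2) (h₂ : M₂ ⊆ S₂.sym2) : Disjoint M₁ M₂ := by
  rw [disjoint_left]
  intro e he₁ he₂
  induction e using Sym2.ind with
  | h a b =>
    exact disjoint_left.1 hd (mem_sym2_iff.1 (h₁ he₁) a (Sym2.mem_mk_left a b))
      (mem_sym2_iff.1 (h₂ he₂) a (Sym2.mem_mk_left a b))

/-! ### The fibre over a prescribed trace -/

/-- **Fibre count.** For disjoint vertex blocks `S₁, S₂` carrying edge sets `M₁, M₂` and a prescribed
trace `B ⊆ S₁`, the subsets `U ⊆ S₁ ∪ S₂` with `a` crossing and `b` internal edges of `M₁ ∪ M₂` and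
`U ∩ S₁ = B` are in bijection (`U ↦ U ∩ S₂`) with the subsets of `S₂` having `a − y` crossing and `b − z`
internal edges of `M₂`, `y = #cr(B,M₁)`, `z = #in(B,M₁)`. [folklore] -/
private theorem card_fiber {S₁ S₂ : Finset V} {M₁ M₂ : Finset (Sym2 V)} (hd : Disjoint S₁ S₂)
    (h₁ : M₁ ⊆ S₁.sym2) (h₂ : M₂ ⊆ S₂.sym2) {B : Finset V} (hB : B ⊆ S₁) (a b : ℕ) :
    ((S₁ ∪ S₂).powerset.filter fun U =>
        ((M₁ ∪ M₂).filter fun e => cutCount U e = 1).card = a ∧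
        ((M₁ ∪ M₂).filter fun e => cutCount U e = 2).card = b ∧ U ∩ S₁ = B).card =
      if (M₁.filter fun e => cutCount B e = 1).card ≤ a ∧ (M₁.filter fun e => cutCount B e = 2).card ≤ b then
        (S₂.powerset.filter fun U =>
          (M₂.filter fun e => cutCount U e = 1).card = a - (M₁.filter fun e => cutCount B e = 1).card ∧
          (M₂.filter fun e => cutCount U e = 2).card = b - (M₁.filter fun e => cutCount B e = 2).card).card
      else 0 := by
  have hdM : Disjoint M₁ M₂ := disjoint_of_subset_sym2 hd h₁ h₂
  -- the counts of any `U` with `U ∩ S₁ = B` split as `B`-part plus `(U ∩ S₂)`-part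
  have hsplit : ∀ (U : Finset V) (k : ℕ), U ∩ S₁ = B →
      ((M₁ ∪ M₂).filter fun e => cutCount U e = k).card =
        (M₁.filter fun e => cutCount B e = k).card + (M₂.filter fun e => cutCount (U ∩ S₂) e = k).card := by
    intro U k hU
    rw [card_filter_cutCount_union hdM, ← card_filter_cutCount_inter h₁, hU, card_filter_cutCount_inter h₂]
  split_ifs with hle
  · refine card_nbij' (fun U => U ∩ S₂) (fun U₂ => B ∪ U₂) ?_ ?_ ?_ ?_
    · intro U hU
      simp only [mem_coe, mem_filter, mem_powerset] at hU ⊢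
      obtain ⟨-, ha, hb, hUB⟩ := hU
      have h1 := hsplit U 1 hUB
      have h2 := hsplit U 2 hUB
      refine ⟨inter_subset_right, ?_, ?_⟩ <;> omega
    · intro U₂ hU₂
      simp only [mem_coe, mem_filter, mem_powerset] at hU₂ ⊢
      obtain ⟨hU₂S, ha, hb⟩ := hU₂
      have hUB : (B ∪ U₂) ∩ S₁ = B := by
        rw [union_inter_distrib_right, inter_eq_left.2 hB]
        have : U₂ ∩ S₁ = ∅ := disjoint_iff_inter_eq_empty.1 (disjoint_of_subset_left hU₂S hd.symm)
        rw [this, union_empty]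
      have hU2 : (B ∪ U₂) ∩ S₂ = U₂ := by
        rw [union_inter_distrib_right, inter_eq_left.2 hU₂S]
        have : B ∩ S₂ = ∅ := disjoint_iff_inter_eq_empty.1 (disjoint_of_subset_left hB hd)
        rw [this, empty_union]
      have h1 := hsplit (B ∪ U₂) 1 hUB
      have h2 := hsplit (B ∪ U₂) 2 hUB
      rw [hU2] at h1 h2
      refine ⟨union_subset_union hB hU₂S, ?_, ?_, hUB⟩ <;> omega
    · intro U hU
      rw [mem_coe, mem_filter, mem_powerset] at hU
      obtain ⟨hUS, -, -, hUB⟩ := hU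
      show B ∪ U ∩ S₂ = U
      rw [← hUB, ← inter_union_distrib_left, inter_eq_left.2 hUS]
    · intro U₂ hU₂
      rw [mem_coe, mem_filter, mem_powerset] at hU₂
      show (B ∪ U₂) ∩ S₂ = U₂
      rw [union_inter_distrib_right, inter_eq_left.2 hU₂.1]
      have : B ∩ S₂ = ∅ := disjoint_iff_inter_eq_empty.1 (disjoint_of_subset_left hB hd)
      rw [this, empty_union]
  · rw [card_eq_zero, filter_eq_empty_iff]
    intro U _ ⟨ha, hb, hUB⟩
    have h1 := hsplit U 1 hUB
    have h2 := hsplit U 2 hUB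
    omega

/-- **Partition by the trace on `S₁`**: `N(S₁ ∪ S₂, M₁ ∪ M₂; a, b) = Σ_{B ⊆ S₁}` fibre counts. [folklore] -/
private theorem card_filter_union_eq_sum {S₁ S₂ : Finset V} {M₁ M₂ : Finset (Sym2 V)} (hd : Disjoint S₁ S₂)
    (h₁ : M₁ ⊆ S₁.sym2) (h₂ : M₂ ⊆ S₂.sym2) (a b : ℕ) :
    ((S₁ ∪ S₂).powerset.filter fun U =>
        ((M₁ ∪ M₂).filter fun e => cutCount U e = 1).card = a ∧
        ((M₁ ∪ M₂).filter fun e => cutCount U e = 2).card = b).card =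
      ∑ B ∈ S₁.powerset,
        if (M₁.filter fun e => cutCount B e = 1).card ≤ a ∧ (M₁.filter fun e => cutCount B e = 2).card ≤ b then
          (S₂.powerset.filter fun U =>
            (M₂.filter fun e => cutCount U e = 1).card = a - (M₁.filter fun e => cutCount B e = 1).card ∧
            (M₂.filter fun e => cutCount U e = 2).card = b - (M₁.filter fun e => cutCount B e = 2).card).card
        else 0 := by
  rw [card_eq_sum_card_fiberwise (f := fun U => U ∩ S₁) (t := S₁.powerset)
    (fun U _ => mem_powerset.2 inter_subset_right)]
  refine sum_congr rfl fun B hB => ?_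
  rw [filter_filter]
  exact (congrArg Finset.card (filter_congr fun U _ => by tauto)).trans
    (card_fiber hd h₁ h₂ (mem_powerset.1 hB) a b)

/-! ### One edge at a time: the recursion and the closed form -/

/-- Sum over the four subsets of a pair. [folklore] -/
private theorem sum_powerset_pair {β : Type*} [AddCommMonoid β] {u v : V} (huv : u ≠ v) (f : Finset V → β) :
    ∑ B ∈ ({u, v} : Finset V).powerset, f B = f ∅ + f {v} + (f {u} + f {u, v}) := by
  have hu : u ∉ ({v} : Finset V) := by simp [huv]
  have hpow : ({v} : Finset V).powerset = {∅, {v}} := by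
    ext B; simp [Finset.subset_singleton_iff]
  have hne : (∅ : Finset V) ≠ {v} := (Finset.singleton_ne_empty v).symm
  rw [sum_powerset_insert hu, hpow, sum_pair hne, sum_pair hne, Finset.insert_empty]

/-- The traces of the four subsets of an edge `{u, v}` on the one-edge matching: `∅` crosses nothing,
`{u}` and `{v}` cross once, `{u, v}` is internal. [folklore] -/
private theorem traces_pair {u v : V} (huv : u ≠ v) :
    ((({s(u, v)} : Finset (Sym2 V)).filter fun e => cutCount (∅ : Finset V) e = 1).card = 0 ∧
      (({s(u, v)} : Finset (Sym2 V)).filter fun e => cutCount (∅ : Finset V) e = 2).card = 0) ∧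
    ((({s(u, v)} : Finset (Sym2 V)).filter fun e => cutCount ({v} : Finset V) e = 1).card = 1 ∧
      (({s(u, v)} : Finset (Sym2 V)).filter fun e => cutCount ({v} : Finset V) e = 2).card = 0) ∧
    ((({s(u, v)} : Finset (Sym2 V)).filter fun e => cutCount ({u} : Finset V) e = 1).card = 1 ∧
      (({s(u, v)} : Finset (Sym2 V)).filter fun e => cutCount ({u} : Finset V) e = 2).card = 0) ∧
    ((({s(u, v)} : Finset (Sym2 V)).filter fun e => cutCount ({u, v} : Finset V) e = 1).card = 0 ∧
      (({s(u, v)} : Finset (Sym2 V)).filter fun e => cutCount ({u, v} : Finset V) e = 2).card = 1) := by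
  simp [filter_singleton, cutCount_mk, huv, huv.symm]

/-- **Peeling one edge**: the count over `{u,v} ⊔ S₂` with the edge `uv` added satisfies the multinomial
recursion (the new edge is external, crossing with one of two inner endpoints, or internal). [folklore] -/
private theorem card_filter_cons {S₂ : Finset V} {M₂ : Finset (Sym2 V)} {u v : V} (huv : u ≠ v)
    (hu : u ∉ S₂) (hv : v ∉ S₂) (h₂ : M₂ ⊆ S₂.sym2) (a b : ℕ) :
    ((({u, v} : Finset V) ∪ S₂).powerset.filter fun U =>
        ((({s(u, v)} : Finset (Sym2 V)) ∪ M₂).filter fun e => cutCount U e = 1).card = a ∧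
        ((({s(u, v)} : Finset (Sym2 V)) ∪ M₂).filter fun e => cutCount U e = 2).card = b).card =
      (S₂.powerset.filter fun U =>
          (M₂.filter fun e => cutCount U e = 1).card = a ∧ (M₂.filter fun e => cutCount U e = 2).card = b).card +
      (if 1 ≤ a then 2 * (S₂.powerset.filter fun U =>
          (M₂.filter fun e => cutCount U e = 1).card = a - 1 ∧
          (M₂.filter fun e => cutCount U e = 2).card = b).card else 0) +
      (if 1 ≤ b then (S₂.powerset.filter fun U =>
          (M₂.filter fun e => cutCount U e = 1).card = a ∧
          (M₂.filter fun e => cutCount U e = 2).card = b - 1).card else 0) := by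
  have hd : Disjoint ({u, v} : Finset V) S₂ := by simp [hu, hv]
  have h₁ : ({s(u, v)} : Finset (Sym2 V)) ⊆ ({u, v} : Finset V).sym2 := by
    intro e he
    rw [mem_singleton] at he
    subst he
    simp
  obtain ⟨⟨h00, h01⟩, ⟨h10, h11⟩, ⟨h20, h21⟩, ⟨h30, h31⟩⟩ := traces_pair huv
  rw [card_filter_union_eq_sum hd h₁ h₂, sum_powerset_pair huv]
  simp only [h00, h01, h10, h11, h20, h21, h30, h31, zero_le, and_true, true_and, Nat.sub_zero, if_true]
  split_ifs <;> ring

/-- The closed form `T(m;a,b) = C(m,a+b)·C(a+b,b)·2^a` satisfies the same recursion (Pascal twice).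
[folklore] -/
private theorem T_succ (m a b : ℕ) : (m + 1).choose (a + b) * (a + b).choose b * 2 ^ a =
    m.choose (a + b) * (a + b).choose b * 2 ^ a +
      (if 1 ≤ a then 2 * (m.choose (a - 1 + b) * (a - 1 + b).choose b * 2 ^ (a - 1)) else 0) +
      (if 1 ≤ b then m.choose (a + (b - 1)) * (a + (b - 1)).choose (b - 1) * 2 ^ a else 0) := by
  rcases a with _ | a <;> rcases b with _ | b
  · simp
  · rw [if_neg (by omega), if_pos (by omega)]
    simp only [zero_add, Nat.add_sub_cancel, Nat.choose_self, mul_one, add_zero]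
    rw [Nat.choose_succ_succ]
    ring
  · rw [if_pos (by omega), if_neg (by omega)]
    simp only [add_zero, Nat.add_sub_cancel, Nat.choose_zero_right, mul_one]
    rw [Nat.choose_succ_succ, pow_succ]
    ring
  · rw [if_pos (by omega), if_pos (by omega), Nat.add_sub_cancel, Nat.add_sub_cancel]
    have e1 : a + 1 + (b + 1) = a + b + 1 + 1 := by ring
    have e3 : a + (b + 1) = a + b + 1 := by ring
    have e5 : a + 1 + b = a + b + 1 := by ring
    rw [e1, e3, e5, Nat.choose_succ_succ m (a + b + 1), Nat.choose_succ_succ (a + b + 1) b, pow_succ]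
    ring

/-- **Closed form** `N(S,M;a,b) = T(|M|;a,b)` for a perfect matching `M` of `S` with `k` edges.
[folklore] -/
private theorem card_filter_cr_in_eq_T : ∀ (k : ℕ) {S : Finset V} {M : Finset (Sym2 V)}, IsPMOn S M → M.card = k →
    ∀ a b, (S.powerset.filter fun U =>
        (M.filter fun e => cutCount U e = 1).card = a ∧ (M.filter fun e => cutCount U e = 2).card = b).card =
      k.choose (a + b) * (a + b).choose b * 2 ^ a := by
  intro k
  induction k with
  | zero =>
    intro S M h hM a b
    have hM0 : M = ∅ := card_eq_zero.1 hM
    have hS0 : S = ∅ := by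
      rw [eq_empty_iff_forall_notMem]
      intro v hv
      obtain ⟨e, he, -⟩ := h.exists_mem hv
      rw [hM0] at he
      exact notMem_empty e he
    subst hM0
    subst hS0
    by_cases hab : a = 0 ∧ b = 0
    · obtain ⟨rfl, rfl⟩ := hab
      simp
    · have hlt : 0 < a + b := by omega
      simp only [powerset_empty, filter_singleton, Finset.filter_empty, card_empty,
        Nat.choose_eq_zero_of_lt hlt, zero_mul]
      rw [if_neg (by omega)]
      rfl
  | succ k ih =>
    intro S M h hM a b
    obtain ⟨e, he⟩ : M.Nonempty := card_pos.1 (by omega)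
    obtain ⟨u, v, rfl⟩ : ∃ u v, s(u, v) = e := by
      induction e using Sym2.ind with
      | h u v => exact ⟨u, v, rfl⟩
    have huv : u ≠ v := fun h' => h.not_isDiag he (Sym2.mk_isDiag_iff.2 h')
    have hu : u ∈ S := h.mem_of_mem he (Sym2.mem_mk_left u v)
    have hv : v ∈ S := h.mem_of_mem he (Sym2.mem_mk_right u v)
    have hpair : ({u, v} : Finset V) ⊆ S := by
      rw [insert_subset_iff, singleton_subset_iff]; exact ⟨hu, hv⟩
    have hS : S = {u, v} ∪ (S \ {u, v}) := (union_sdiff_of_subset hpair).symm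
    have hMeq : M = {s(u, v)} ∪ M.erase s(u, v) := by rw [← insert_eq, insert_erase he]
    have hd : Disjoint ({u, v} : Finset V) (S \ {u, v}) := disjoint_sdiff
    have h' : IsPMOn ({u, v} ∪ (S \ {u, v})) M := by rwa [← hS]
    have h₂ : IsPMOn (S \ {u, v}) (M.erase s(u, v)) := by
      rw [← sdiff_singleton_eq_erase]
      exact h'.sdiff hd (IsPMOn.pair huv) (singleton_subset_iff.2 he)
    have hcard : (M.erase s(u, v)).card = k := by rw [card_erase_of_mem he, hM]; rfl
    rw [hS, hMeq, card_filter_cons huv (by simp) (by simp) h₂.1 a b]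
    simp only [ih h₂ hcard]
    rw [T_succ]

/-- **Closed form**, card version: `#{U ⊆ S : a crossing, b internal} = C(|M|,a+b)·C(a+b,b)·2^a`.
[folklore] -/
private theorem card_filter_cr_in_eq {S : Finset V} {M : Finset (Sym2 V)} (h : IsPMOn S M) (a b : ℕ) :
    (S.powerset.filter fun U =>
        (M.filter fun e => cutCount U e = 1).card = a ∧ (M.filter fun e => cutCount U e = 2).card = b).card =
      M.card.choose (a + b) * (a + b).choose b * 2 ^ a :=
  card_filter_cr_in_eq_T M.card h rfl a b

/-! ### Sub-matchings and their vertex sets -/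

/-- A sub-edge-set of a perfect matching lives on the vertices `W(S,E)` it covers. [folklore] -/
private theorem subset_sym2_verts {S : Finset V} {M E : Finset (Sym2 V)} (h : IsPMOn S M) (hE : E ⊆ M) :
    E ⊆ (S.filter fun v => ∃ e ∈ E, v ∈ e).sym2 := by
  intro e he
  rw [mem_sym2_iff]
  intro a ha
  exact mem_filter.2 ⟨h.mem_of_mem (hE he) ha, e, he, ha⟩

/-- A sub-edge-set of a perfect matching is a perfect matching of the vertices it covers. [folklore] -/
private theorem isPMOn_verts {S : Finset V} {M E : Finset (Sym2 V)} (h : IsPMOn S M) (hE : E ⊆ M) :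
    IsPMOn (S.filter fun v => ∃ e ∈ E, v ∈ e) E := by
  refine ⟨subset_sym2_verts h hE, fun e he => h.not_isDiag (hE he), fun v hv => ?_⟩
  obtain ⟨-, e₀, he₀, hv₀⟩ := mem_filter.1 hv
  have : E.filter (fun e => v ∈ e) = {e₀} := by
    ext e
    simp only [mem_filter, mem_singleton]
    exact ⟨fun he => h.unique (hE he.1) (hE he₀) he.2 hv₀, fun he => he ▸ ⟨he₀, hv₀⟩⟩
  rw [this, card_singleton]

/-- Removing a sub-matching leaves a perfect matching of the remaining vertices. [folklore] -/
private theorem isPMOn_sdiff_verts {S : Finset V} {M E : Finset (Sym2 V)} (h : IsPMOn S M) (hE : E ⊆ M) :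
    IsPMOn (S \ S.filter fun v => ∃ e ∈ E, v ∈ e) (M \ E) := by
  have h' : IsPMOn ((S.filter fun v => ∃ e ∈ E, v ∈ e) ∪ (S \ S.filter fun v => ∃ e ∈ E, v ∈ e)) M := by
    rwa [union_sdiff_of_subset (filter_subset _ S)]
  exact h'.sdiff disjoint_sdiff (isPMOn_verts h hE) hE

/-- **Fibre count against a perfect matching**: for a perfect matching `M` of `S`, a sub-matching
`E ⊆ M` with covered vertex set `W`, and a prescribed trace `B ⊆ W` with `y` crossing and `z` internal
`E`-edges, the number of `U ⊆ S` with `a` crossing and `b` internal `M`-edges and `U ∩ W = B` is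
`T(|M| − |E|; a − y, b − z)` if `y ≤ a` and `z ≤ b`, and `0` otherwise. [folklore] -/
private theorem card_fiber_eq {S : Finset V} {M E : Finset (Sym2 V)} (h : IsPMOn S M) (hE : E ⊆ M)
    {B : Finset V} (hB : B ⊆ S.filter fun v => ∃ e ∈ E, v ∈ e) (a b : ℕ) :
    (S.powerset.filter fun U =>
        (M.filter fun e => cutCount U e = 1).card = a ∧ (M.filter fun e => cutCount U e = 2).card = b ∧
        U ∩ (S.filter fun v => ∃ e ∈ E, v ∈ e) = B).card =
      if (E.filter fun e => cutCount B e = 1).card ≤ a ∧ (E.filter fun e => cutCount B e = 2).card ≤ b then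
        (M.card - E.card).choose
            (a - (E.filter fun e => cutCount B e = 1).card + (b - (E.filter fun e => cutCount B e = 2).card)) *
          (a - (E.filter fun e => cutCount B e = 1).card + (b - (E.filter fun e => cutCount B e = 2).card)).choose
            (b - (E.filter fun e => cutCount B e = 2).card) *
          2 ^ (a - (E.filter fun e => cutCount B e = 1).card)
      else 0 := by
  have hS : S = (S.filter fun v => ∃ e ∈ E, v ∈ e) ∪ (S \ S.filter fun v => ∃ e ∈ E, v ∈ e) :=
    (union_sdiff_of_subset (filter_subset _ S)).symm
  have hM : M = E ∪ (M \ E) := (union_sdiff_of_subset hE).symm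
  have h₂ := isPMOn_sdiff_verts h hE
  have key := card_fiber (disjoint_sdiff (s := S.filter fun v => ∃ e ∈ E, v ∈ e) (t := S))
    (subset_sym2_verts h hE) h₂.1 hB a b
  rw [← hS, ← hM] at key
  rw [key]
  split_ifs
  · rw [card_filter_cr_in_eq h₂, card_sdiff_of_subset hE]
  · rfl

end Literature.Combinatorics.Optimization.ChebyshevTracialDesignJunta

/-! ## Section from `ChebyshevTracialDesignJuntaPatternLaw.lean` -/
/-!
# Junta virtual positivity, part B: the pattern-law polynomial and the junta sum law

Support file for the crux `TracialDecayExp20` (stmt-PneNP-19878) of route `ChebyshevTracialDesign`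
(cell pnp-psdrank, local virtual positivity lemma (N1), HOME/pnp-psdrank-p1/N1-LocalVirtualPositivity.md,
Lemma 1 "pattern law" (iii) and Lemma 2). Builds on part A (`ChebyshevTracialDesignJuntaCount`).

* `pattern_poly_exists`: for a full local pattern with `x` window edges, `y` crossing and `z` internal,
  the ratio `T(N-x; c-y, i-z)/T(N; c, i)` along the levels `c + 2i = t` is `P(c)` for a real polynomial
  `P = 2^{-y}[X]_y ∏_{j<z}((t-X)/2-j) ∏_{j<x-y-z}(N-(t+X)/2-j)/[N]_x` of degree `≤ x` with `P(0) ≥ 0`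
  (in the range `2x ≤ t+2`, `2x+t ≤ 2N+2`); the `ℕ` identity behind it is `T_ratio_nat`.
* `junta_sum_law`: for a perfect matching `M` of `S`, window edges `E ⊆ M` covering `W`, and `G` a function
  of `U ⊆ S` depending (on `t`-sets) only on `U ∩ W` with nonnegative values, the level sums
  `Σ_{U : c crossing, i internal} G(U)` equal `T(|M|; c, i)·P(c)` for one polynomial `P` of degree `≤ |E|`
  with `P(0) ≥ 0`.

No definitions; notation as in part A's docstring (`T(m;a,b) = C(m,a+b)·C(a+b,b)·2^a`).
-/


namespace Literature.Combinatorics.Optimization.ChebyshevTracialDesignJunta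

open Finset Literature.Barriers.PneNP Literature.Combinatorics.SimpleGraph.CycleSpace

variable {V : Type*} [DecidableEq V]

/-! ### The pattern-law polynomial (part B)

For a full local pattern with `x` window edges of which `y` are crossing and `z` internal, the conditional
probability at crossing level `c` (with `i = (t-c)/2` internal edges in total, `N = n/2` edges) is
`T(N-x; c-y, i-z) / T(N; c, i) = 2^{-y}[c]_y[i]_z[N-c-i]_{x-y-z}/[N]_x`, the value at `c` of a real
polynomial of degree `≤ x` whose value at the virtual level `c = 0` is `≥ 0`
(cell pnp-psdrank (N1) Lemma 1; HOME/pnp-psdrank-p1/N1-LocalVirtualPositivity.md). -/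

section PatternLaw

open Polynomial

/-- `[n]_k = ∏_{j<k} (n - j)` in `ℝ` for `k ≤ n`. [folklore] -/
private theorem cast_descFactorial_eq_prod {n k : ℕ} (h : k ≤ n) :
    ((n.descFactorial k : ℕ) : ℝ) = ∏ j ∈ range k, ((n : ℝ) - j) := by
  rw [Nat.descFactorial_eq_prod_range, Nat.cast_prod]
  refine prod_congr rfl fun j hj => ?_
  have := mem_range.1 hj
  rw [Nat.cast_sub (by omega)]

/-- `T(m;a,b)·a!·b!·(m-a-b)! = m!·2^a` for `a + b ≤ m`. [folklore] -/
private theorem T_mul_factorial {m a b : ℕ} (h : a + b ≤ m) :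
    m.choose (a + b) * (a + b).choose b * 2 ^ a * (a.factorial * b.factorial * (m - (a + b)).factorial) =
      m.factorial * 2 ^ a := by
  have h1 := Nat.choose_mul_factorial_mul_factorial h
  have h2 := Nat.choose_mul_factorial_mul_factorial (Nat.le_add_left b a)
  rw [Nat.add_sub_cancel] at h2
  calc m.choose (a + b) * (a + b).choose b * 2 ^ a * (a.factorial * b.factorial * (m - (a + b)).factorial)
      = m.choose (a + b) * ((a + b).choose b * b.factorial * a.factorial) * (m - (a + b)).factorial * 2 ^ a := by
        ring
    _ = m.choose (a + b) * (a + b).factorial * (m - (a + b)).factorial * 2 ^ a := by rw [h2]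
    _ = m.factorial * 2 ^ a := by rw [h1]

/-- **The ratio identity in `ℕ`**: `T(N-x; c-y, i-z)·2^y·[N]_x = T(N; c, i)·[c]_y·[i]_z·[N-c-i]_{x-y-z}`
in the non-degenerate range. [folklore] -/
private theorem T_ratio_nat {N x y z c i : ℕ} (hx : x ≤ N) (hyz : y + z ≤ x) (hyc : y ≤ c) (hzi : z ≤ i)
    (hci : c + i ≤ N) (he : x - y - z ≤ N - c - i) :
    (N - x).choose (c - y + (i - z)) * (c - y + (i - z)).choose (i - z) * 2 ^ (c - y) *
        (2 ^ y * N.descFactorial x) =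
      N.choose (c + i) * (c + i).choose i * 2 ^ c *
        (c.descFactorial y * i.descFactorial z * (N - c - i).descFactorial (x - y - z)) := by
  -- multiply both sides by `K = (c-y)! (i-z)! (N-c-i-(x-y-z))!`
  have hK : 0 < (c - y).factorial * (i - z).factorial * (N - c - i - (x - y - z)).factorial := by positivity
  refine Nat.eq_of_mul_eq_mul_right hK ?_
  have hL : c - y + (i - z) ≤ N - x := by omega
  have eL : N - x - (c - y + (i - z)) = N - c - i - (x - y - z) := by omega
  have hA := T_mul_factorial hL
  rw [eL] at hA
  have hB := T_mul_factorial hci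
  have eB : N - (c + i) = N - c - i := by omega
  rw [eB] at hB
  have hNx := Nat.factorial_mul_descFactorial hx
  have hcy := Nat.factorial_mul_descFactorial hyc
  have hiz := Nat.factorial_mul_descFactorial hzi
  have hNe := Nat.factorial_mul_descFactorial he
  have hpow : 2 ^ (c - y) * 2 ^ y = 2 ^ c := by rw [← pow_add, Nat.sub_add_cancel hyc]
  calc (N - x).choose (c - y + (i - z)) * (c - y + (i - z)).choose (i - z) * 2 ^ (c - y) *
        (2 ^ y * N.descFactorial x) * ((c - y).factorial * (i - z).factorial * (N - c - i - (x - y - z)).factorial)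
      = ((N - x).choose (c - y + (i - z)) * (c - y + (i - z)).choose (i - z) * 2 ^ (c - y) *
          ((c - y).factorial * (i - z).factorial * (N - c - i - (x - y - z)).factorial)) *
          (2 ^ y * N.descFactorial x) := by ring
    _ = (N - x).factorial * 2 ^ (c - y) * (2 ^ y * N.descFactorial x) := by rw [hA]
    _ = ((N - x).factorial * N.descFactorial x) * (2 ^ (c - y) * 2 ^ y) := by ring
    _ = N.factorial * 2 ^ c := by rw [hNx, hpow]
    _ = N.choose (c + i) * (c + i).choose i * 2 ^ c * (c.factorial * i.factorial * (N - c - i).factorial) := hB.symm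
    _ = N.choose (c + i) * (c + i).choose i * 2 ^ c *
          (((c - y).factorial * c.descFactorial y) * ((i - z).factorial * i.descFactorial z) *
            ((N - c - i - (x - y - z)).factorial * (N - c - i).descFactorial (x - y - z))) := by
        rw [hcy, hiz, hNe]
    _ = N.choose (c + i) * (c + i).choose i * 2 ^ c *
          (c.descFactorial y * i.descFactorial z * (N - c - i).descFactorial (x - y - z)) *
          ((c - y).factorial * (i - z).factorial * (N - c - i - (x - y - z)).factorial) := by ring

/-- **Pattern-law polynomial** (cell (N1) Lemma 1): for `x ≤ N` window edges with `y + z ≤ x`, in the range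
`2x ≤ t + 2`, `2x + t ≤ 2N + 2`, there is a real polynomial `P` of degree `≤ x` with `P(0) ≥ 0` such that
for every level `c` with `c + 2i = t`: `T(N-x; c-y, i-z) = T(N; c, i) · P(c)` (the left side read as `0`
when `y > c` or `z > i`). Explicitly
`P = 2^{-y}[X]_y · ∏_{j<z}((t-X)/2 - j) · ∏_{j<x-y-z}(N - (t+X)/2 - j) / [N]_x`. [folklore] -/
private theorem pattern_poly_exists (N t : ℕ) {x y z : ℕ} (hx : x ≤ N) (hyz : y + z ≤ x)
    (ht : 2 * x ≤ t + 2) (hn : 2 * x + t ≤ 2 * N + 2) :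
    ∃ P : Polynomial ℝ, P.natDegree ≤ x ∧ 0 ≤ P.eval 0 ∧
      ∀ c i : ℕ, c + 2 * i = t →
        (((if y ≤ c ∧ z ≤ i then
            (N - x).choose (c - y + (i - z)) * (c - y + (i - z)).choose (i - z) * 2 ^ (c - y) else 0 : ℕ)) : ℝ) =
          ((N.choose (c + i) * (c + i).choose i * 2 ^ c : ℕ) : ℝ) * P.eval (c : ℝ) := by
  set κ : ℝ := ((2 : ℝ) ^ y * (N.descFactorial x : ℝ))⁻¹ with hκ
  have hNx : 0 < (N.descFactorial x : ℝ) := by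
    have : N.descFactorial x ≠ 0 := fun h0 => by
      rw [Nat.descFactorial_eq_zero_iff_lt] at h0; omega
    positivity
  have hκ0 : 0 ≤ κ := by rw [hκ]; positivity
  refine ⟨C κ * (∏ j ∈ range y, (X - C (j : ℝ))) * (∏ j ∈ range z, (C ((t : ℝ) / 2 - j) - C (1 / 2) * X)) *
      ∏ j ∈ range (x - y - z), (C ((N : ℝ) - (t : ℝ) / 2 - j) - C (1 / 2) * X), ?_, ?_, ?_⟩
  · -- degree
    have h1 : (∏ j ∈ range y, (X - C (j : ℝ))).natDegree ≤ y := by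
      refine (natDegree_prod_le _ _).trans ?_
      refine (sum_le_sum fun (j : ℕ) _ => (natDegree_X_sub_C ((j : ℕ) : ℝ)).le).trans ?_
      simp
    have hlin : ∀ a : ℝ, (C a - C (1 / 2 : ℝ) * X).natDegree ≤ 1 := fun a =>
      (natDegree_sub_le _ _).trans (max_le (by simp) ((natDegree_C_mul_le _ _).trans natDegree_X_le))
    have h2 : (∏ j ∈ range z, (C ((t : ℝ) / 2 - j) - C (1 / 2) * X)).natDegree ≤ z := by
      refine (natDegree_prod_le _ _).trans ?_
      refine (sum_le_sum fun j _ => hlin _).trans ?_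
      simp
    have h3 : (∏ j ∈ range (x - y - z), (C ((N : ℝ) - (t : ℝ) / 2 - j) - C (1 / 2) * X)).natDegree ≤ x - y - z := by
      refine (natDegree_prod_le _ _).trans ?_
      refine (sum_le_sum fun j _ => hlin _).trans ?_
      simp
    refine (natDegree_mul_le.trans (add_le_add (natDegree_mul_le.trans (add_le_add
      ((natDegree_C_mul_le _ _).trans h1) h2)) h3)).trans ?_
    omega
  · -- value at the virtual level
    simp only [eval_mul, eval_C, eval_prod, eval_sub, eval_X, mul_zero, sub_zero]
    rcases Nat.eq_zero_or_pos y with hy0 | hy0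
    · subst hy0
      simp only [range_zero, prod_empty, mul_one, Nat.sub_zero]
      refine mul_nonneg (mul_nonneg hκ0 (prod_nonneg fun j hj => ?_)) (prod_nonneg fun j hj => ?_)
      · have := mem_range.1 hj
        have : (j : ℝ) ≤ (t : ℝ) / 2 := by
          rw [le_div_iff₀ (by norm_num : (0:ℝ) < 2)]
          exact_mod_cast (by omega : j * 2 ≤ t)
        linarith
      · have := mem_range.1 hj
        have : (j : ℝ) + (t : ℝ) / 2 ≤ N := by
          have h' : 2 * j + t ≤ 2 * N := by omega
          have h'' : (2 : ℝ) * j + t ≤ 2 * N := by exact_mod_cast h'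
          linarith
        linarith
    · have : ∏ j ∈ range y, ((0 : ℝ) - (j : ℝ)) = 0 :=
        prod_eq_zero (mem_range.2 hy0) (by simp)
      rw [this]
      simp
  · -- the identity at level c
    intro c i hci
    have evC : ∀ r : ℝ, ((∏ j ∈ range z, (C ((t : ℝ) / 2 - j) - C (1 / 2) * X)).eval r) =
        ∏ j ∈ range z, (((t : ℝ) - r) / 2 - j) := fun r => by
      rw [eval_prod]; exact prod_congr rfl fun j _ => by simp; ring
    have evE : ∀ r : ℝ, ((∏ j ∈ range (x - y - z), (C ((N : ℝ) - (t : ℝ) / 2 - j) - C (1 / 2) * X)).eval r) =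
        ∏ j ∈ range (x - y - z), ((N : ℝ) - ((t : ℝ) + r) / 2 - j) := fun r => by
      rw [eval_prod]; exact prod_congr rfl fun j _ => by simp; ring
    have evY : ∀ r : ℝ, ((∏ j ∈ range y, (X - C (j : ℝ))).eval r) = ∏ j ∈ range y, (r - j) := fun r => by
      rw [eval_prod]; exact prod_congr rfl fun j _ => by simp
    rw [eval_mul, eval_mul, eval_mul, eval_C, evY, evC, evE]
    have hti : ((t : ℝ) - c) / 2 = i := by
      have : (t : ℝ) = c + 2 * i := by exact_mod_cast hci.symm
      rw [this]; ring
    have htc : ((t : ℝ) + c) / 2 = (c : ℝ) + i := by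
      have : (t : ℝ) = c + 2 * i := by exact_mod_cast hci.symm
      rw [this]; ring
    rw [hti, htc]
    by_cases hyc : y ≤ c
    · by_cases hzi : z ≤ i
      · rw [if_pos ⟨hyc, hzi⟩]
        by_cases hciN : c + i ≤ N
        · by_cases he : x - y - z ≤ N - c - i
          · -- the non-degenerate case: the ℕ identity
            have key := T_ratio_nat hx hyz hyc hzi hciN he
            have keyR : (((N - x).choose (c - y + (i - z)) * (c - y + (i - z)).choose (i - z) * 2 ^ (c - y) : ℕ) : ℝ) *
                ((2 : ℝ) ^ y * (N.descFactorial x : ℝ)) =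
                ((N.choose (c + i) * (c + i).choose i * 2 ^ c : ℕ) : ℝ) *
                  ((c.descFactorial y : ℝ) * (i.descFactorial z : ℝ) * ((N - c - i).descFactorial (x - y - z) : ℝ)) := by
              exact_mod_cast key
            have h2y : (0 : ℝ) < (2 : ℝ) ^ y * (N.descFactorial x : ℝ) := by positivity
            have keyR' := (eq_div_iff h2y.ne').2 keyR
            rw [keyR', cast_descFactorial_eq_prod hyc, cast_descFactorial_eq_prod hzi,
              cast_descFactorial_eq_prod he, hκ]
            have : ((N - c - i : ℕ) : ℝ) = (N : ℝ) - ((c : ℝ) + i) := by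
              rw [Nat.sub_sub, Nat.cast_sub hciN, Nat.cast_add]
            rw [this]
            field_simp
          · -- too many external window edges: both sides vanish
            have he' := not_le.1 he
            have hL : N - x < c - y + (i - z) := by omega
            rw [Nat.choose_eq_zero_of_lt hL]
            have hmem : N - c - i ∈ range (x - y - z) := mem_range.2 he'
            have h0 : ∏ j ∈ range (x - y - z), ((N : ℝ) - ((c : ℝ) + i) - j) = 0 := by
              refine prod_eq_zero hmem ?_
              have : ((N - c - i : ℕ) : ℝ) = (N : ℝ) - ((c : ℝ) + i) := by
                rw [Nat.sub_sub, Nat.cast_sub hciN, Nat.cast_add]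
              rw [← this]; ring
            rw [h0]; simp
        · -- `c + i > N`: both sides vanish
          have hciN' := not_le.1 hciN
          have hL : N - x < c - y + (i - z) := by omega
          rw [Nat.choose_eq_zero_of_lt hL, Nat.choose_eq_zero_of_lt hciN']
          simp
      · -- `z > i`
        rw [if_neg (fun h => hzi h.2)]
        have h0 : ∏ j ∈ range z, ((i : ℝ) - j) = 0 := prod_eq_zero (mem_range.2 (not_le.1 hzi)) (by simp)
        rw [h0]; simp
    · -- `y > c`
      rw [if_neg (fun h => hyc h.1)]
      have h0 : ∏ j ∈ range y, ((c : ℝ) - j) = 0 := prod_eq_zero (mem_range.2 (not_le.1 hyc)) (by simp)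
      rw [h0]; simp

end PatternLaw

/-! ### The junta sum law (per perfect matching)

For a perfect matching `M` of `S`, a sub-matching `E ⊆ M` (the window edges, covering `W`), and a function
`G` of `U ⊆ S` that on `t`-sets only depends on the trace `U ∩ W` (with nonnegative values `Λ`), the sums
`Σ_{U : c crossing, i internal} G(U)` along the levels `c + 2i = t` are `T(|M|; c, i) · P(c)` for one real
polynomial `P` of degree `≤ |E|` with `P(0) ≥ 0` (cell (N1) Lemma 2). -/

section SumLaw

open Polynomial

/-- Every edge of a perfect matching of `S` is internal to `S`. [folklore] -/
private theorem cutCount_self_eq_two {S : Finset V} {M : Finset (Sym2 V)} (h : IsPMOn S M) {e : Sym2 V} (he : e ∈ M) :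
    cutCount S e = 2 := by
  have hS := h.subset_sym2 he
  induction e using Sym2.ind with
  | h a b =>
    rw [mem_sym2_iff] at hS
    rw [cutCount_mk, if_pos (hS a (Sym2.mem_mk_left a b)), if_pos (hS b (Sym2.mem_mk_right a b))]

/-- A perfect matching of `S` has `|S|/2` edges: `2|M| = |S|`. [folklore] -/
private theorem two_mul_card_eq {S : Finset V} {M : Finset (Sym2 V)} (h : IsPMOn S M) : 2 * M.card = S.card := by
  have h0 : (M.filter fun e => cutCount S e = 1).card = 0 := by
    rw [card_eq_zero, filter_eq_empty_iff]
    intro e he h1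
    rw [cutCount_self_eq_two h he] at h1
    exact absurd h1 (by decide)
  have h2 : (M.filter fun e => cutCount S e = 2) = M := filter_true_of_mem fun e he => cutCount_self_eq_two h he
  rw [card_eq_cr_add_two_mul_in h Subset.rfl, h0, h2, zero_add]

/-- **Junta sum law** (cell (N1) Lemma 2): see the section docstring. [folklore] -/
private theorem junta_sum_law {S : Finset V} {M E : Finset (Sym2 V)} (hM : IsPMOn S M) (hE : E ⊆ M) {t : ℕ}
    (ht : 2 * E.card ≤ t + 2) (hn : 2 * E.card + t ≤ 2 * M.card + 2) (G Λ : Finset V → ℝ)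
    (hG : ∀ U, U ⊆ S → U.card = t → G U = Λ (U ∩ S.filter fun v => ∃ e ∈ E, v ∈ e))
    (hΛ : ∀ B, 0 ≤ Λ B) :
    ∃ P : Polynomial ℝ, P.natDegree ≤ E.card ∧ 0 ≤ P.eval 0 ∧ ∀ c i : ℕ, c + 2 * i = t →
      ∑ U ∈ S.powerset.filter (fun U => (M.filter fun e => cutCount U e = 1).card = c ∧
          (M.filter fun e => cutCount U e = 2).card = i), G U =
        ((M.card.choose (c + i) * (c + i).choose i * 2 ^ c : ℕ) : ℝ) * P.eval (c : ℝ) := by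
  classical
  have hxN : E.card ≤ M.card := card_le_card hE
  have hyz : ∀ B : Finset V, (E.filter fun e => cutCount B e = 1).card +
      (E.filter fun e => cutCount B e = 2).card ≤ E.card := by
    intro B
    rw [← card_union_of_disjoint (disjoint_filter.2 fun e _ h1 h2 => by omega)]
    exact card_le_card (union_subset (filter_subset _ _) (filter_subset _ _))
  have hP : ∀ B : Finset V, ∃ P : Polynomial ℝ, P.natDegree ≤ E.card ∧ 0 ≤ P.eval 0 ∧
      ∀ c i : ℕ, c + 2 * i = t →
        (((if (E.filter fun e => cutCount B e = 1).card ≤ c ∧ (E.filter fun e => cutCount B e = 2).card ≤ i then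
            (M.card - E.card).choose (c - (E.filter fun e => cutCount B e = 1).card +
                (i - (E.filter fun e => cutCount B e = 2).card)) *
              (c - (E.filter fun e => cutCount B e = 1).card +
                (i - (E.filter fun e => cutCount B e = 2).card)).choose
                  (i - (E.filter fun e => cutCount B e = 2).card) *
              2 ^ (c - (E.filter fun e => cutCount B e = 1).card) else 0 : ℕ)) : ℝ) =
          ((M.card.choose (c + i) * (c + i).choose i * 2 ^ c : ℕ) : ℝ) * P.eval (c : ℝ) :=
    fun B => pattern_poly_exists M.card t hxN (hyz B) ht hn
  choose P hPdeg hP0 hPval using hP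
  set W := S.filter fun v => ∃ e ∈ E, v ∈ e with hW
  refine ⟨∑ B ∈ W.powerset, C (Λ B) * P B, ?_, ?_, ?_⟩
  · exact natDegree_sum_le_of_forall_le _ _ fun B _ => (natDegree_C_mul_le _ _).trans (hPdeg B)
  · rw [eval_finsetSum]
    exact sum_nonneg fun B _ => by rw [eval_mul, eval_C]; exact mul_nonneg (hΛ B) (hP0 B)
  · intro c i hci
    rw [← sum_fiberwise_of_maps_to (g := fun U => U ∩ W) (t := W.powerset)
      (fun U _ => mem_powerset.2 inter_subset_right), eval_finsetSum, mul_sum]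
    refine sum_congr rfl fun B hB => ?_
    have hconst : ∀ U ∈ (S.powerset.filter fun U => (M.filter fun e => cutCount U e = 1).card = c ∧
        (M.filter fun e => cutCount U e = 2).card = i).filter (fun U => U ∩ W = B), G U = Λ B := by
      intro U hU
      simp only [mem_filter, mem_powerset] at hU
      obtain ⟨⟨hUS, hc, hi⟩, hUW⟩ := hU
      rw [hG U hUS (by rw [card_eq_cr_add_two_mul_in hM hUS, hc, hi, hci]), hUW]
    rw [sum_congr rfl hconst, sum_const, nsmul_eq_mul, filter_filter]
    have hfib := card_fiber_eq hM hE (mem_powerset.1 hB) c i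
    rw [← hW] at hfib
    have hset : (S.powerset.filter fun U => ((M.filter fun e => cutCount U e = 1).card = c ∧
          (M.filter fun e => cutCount U e = 2).card = i) ∧ U ∩ W = B) =
        S.powerset.filter fun U => (M.filter fun e => cutCount U e = 1).card = c ∧
          (M.filter fun e => cutCount U e = 2).card = i ∧ U ∩ W = B :=
      filter_congr fun U _ => and_assoc
    rw [hset, hfib, hPval B c i hci, eval_mul, eval_C]
    ring

end SumLaw

end Literature.Combinatorics.Optimization.ChebyshevTracialDesignJunta

/-! ## Section from `ChebyshevTracialDesignJuntaMatchingCount.lean` -/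
/-!
# Junta virtual positivity, part D: perfect matchings with a prescribed number of crossing edges

Support file for the crux `TracialDecayExp20` (stmt-PneNP-19878) of route `ChebyshevTracialDesign`
(cell pnp-psdrank, local virtual positivity (N1), MATCHING-SIDE twin: the design value of a psd pair whose
MATCHING-side factor `Y_M` depends only on the edges of `M` at a small window is `≤ 0`). This part counts,
for a fixed cut `U ⊆ S` with `|U| = a + 2i`, `|S \ U| = a + 2i'`, the perfect matchings `M` of `S` with
exactly `a` edges crossing `U`:
`#{M} · (a! · 2^i i! · 2^{i'} i'!) = (a + 2i)! · (a + 2i')!` (`card_pm_filter_cr_mul`),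
by the partner recursion (remove `v ∈ U` with its partner); the count vanishes outside this range
(`pm_filter_cr_eq_empty`). Notation as in part A (`#cr(U,M) = #{e ∈ M | cutCount U e = 1}`); no definitions.
-/


namespace Literature.Combinatorics.Optimization.ChebyshevTracialDesignJunta

open Finset Literature.Barriers.PneNP Literature.Combinatorics.SimpleGraph.CycleSpace

variable {V : Type*} [DecidableEq V]

/-! ### Complement symmetry and the range of the crossing count -/

/-- `cutCount (S \ U) e = 2 - cutCount U e` for an edge inside `S`. [folklore] -/
private theorem cutCount_sdiff {S U : Finset V} {e : Sym2 V} (he : e ∈ S.sym2) :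
    cutCount (S \ U) e = 2 - cutCount U e := by
  induction e using Sym2.ind with
  | h a b =>
    rw [mem_sym2_iff] at he
    have ha : a ∈ S := he a (Sym2.mem_mk_left a b)
    have hb : b ∈ S := he b (Sym2.mem_mk_right a b)
    simp only [cutCount_mk, mem_sdiff, ha, hb, true_and]
    by_cases hau : a ∈ U <;> by_cases hbu : b ∈ U <;> simp [hau, hbu]

/-- The crossing count is symmetric in `U ↔ S \ U`. [folklore] -/
private theorem card_filter_cr_sdiff {S U : Finset V} {M : Finset (Sym2 V)} (hM : M ⊆ S.sym2) :
    (M.filter fun e => cutCount (S \ U) e = 1).card = (M.filter fun e => cutCount U e = 1).card := by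
  congr 1
  refine filter_congr fun e he => ?_
  rw [cutCount_sdiff (hM he)]
  have := cutCount_le_two U e
  omega

/-- **Range of the crossing count**: a perfect matching of `S` with `a` edges crossing `U` forces
`a ≤ |U|`, `a ≤ |S \ U|` and both differences even; otherwise there is no such matching. [folklore] -/
private theorem pm_filter_cr_eq_empty {S U : Finset V} (hU : U ⊆ S) {a : ℕ}
    (h : ¬ (a ≤ U.card ∧ a ≤ (S \ U).card ∧ Even (U.card - a) ∧ Even ((S \ U).card - a))) :
    ((perfectMatchings S).filter fun M => (M.filter fun e => cutCount U e = 1).card = a) = ∅ := by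
  rw [filter_eq_empty_iff]
  intro M hM ha
  rw [mem_perfectMatchings] at hM
  apply h
  have h1 := card_eq_cr_add_two_mul_in hM hU
  have h2 := card_eq_cr_add_two_mul_in hM (sdiff_subset (s := S) (t := U))
  rw [card_filter_cr_sdiff hM.1, ha] at h2
  rw [ha] at h1
  refine ⟨by omega, by omega, ⟨(M.filter fun e => cutCount U e = 2).card, by omega⟩,
    ⟨(M.filter fun e => cutCount (S \ U) e = 2).card, by omega⟩⟩

/-! ### Partition by the partner of a vertex -/

/-- **Partition of the perfect matchings of `S` by the partner of a fixed vertex `v ∈ S`.** [folklore] -/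
private theorem card_pm_filter_eq_sum_partner {S : Finset V} {v : V} (hv : v ∈ S) (P : Finset (Sym2 V) → Prop)
    [DecidablePred P] :
    ((perfectMatchings S).filter P).card =
      ∑ u ∈ S.erase v, ((perfectMatchings S).filter fun M => s(v, u) ∈ M ∧ P M).card := by
  rw [← card_biUnion]
  · congr 1
    ext M
    simp only [mem_filter, mem_biUnion, mem_erase, mem_perfectMatchings]
    constructor
    · rintro ⟨hM, hP⟩
      obtain ⟨e, he, hve⟩ := hM.exists_mem hv
      have heq : s(v, Sym2.Mem.other hve) = e := Sym2.other_spec hve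
      refine ⟨Sym2.Mem.other hve, ⟨?_, ?_⟩, hM, (by rw [heq]; exact he), hP⟩
      · intro huv
        apply hM.not_isDiag he
        rw [← heq, huv]
        exact Sym2.mk_isDiag_iff.2 rfl
      · exact hM.mem_of_mem he (Sym2.other_mem hve)
    · rintro ⟨u, -, hM, -, hP⟩; exact ⟨hM, hP⟩
  · intro u hu u' hu' huu'
    simp only [Function.onFun]
    rw [Finset.disjoint_left]
    intro M hM hM'
    rw [mem_filter, mem_perfectMatchings] at hM hM'
    have := hM.1.unique hM.2.1 hM'.2.1 (Sym2.mem_mk_left v u) (Sym2.mem_mk_left v u')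
    exact huu' (Sym2.congr_right.1 this)

/-- **Removing the edge at `v`**: perfect matchings of `S` through the edge `vu` with `a` crossing edges
correspond (`M ↦ M.erase vu`) to perfect matchings of `S \ {v,u}` whose crossing count, plus that of the edge
`vu`, is `a`. [folklore] -/
private theorem card_pm_filter_edge {S : Finset V} {v u : V} (hv : v ∈ S) (hu : u ∈ S) (hvu : v ≠ u)
    (U : Finset V) (a : ℕ) :
    ((perfectMatchings S).filter fun M => s(v, u) ∈ M ∧ (M.filter fun e => cutCount U e = 1).card = a).card =
      ((perfectMatchings (S \ {v, u})).filter fun M' =>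
        (({s(v, u)} : Finset (Sym2 V)).filter fun e => cutCount U e = 1).card +
          (M'.filter fun e => cutCount (U ∩ (S \ {v, u})) e = 1).card = a).card := by
  have hpair : ({v, u} : Finset V) ⊆ S := by
    rw [insert_subset_iff, singleton_subset_iff]; exact ⟨hv, hu⟩
  have hS : S = {v, u} ∪ (S \ {v, u}) := (union_sdiff_of_subset hpair).symm
  have hd : Disjoint ({v, u} : Finset V) (S \ {v, u}) := disjoint_sdiff
  have he1 : ({s(v, u)} : Finset (Sym2 V)) ⊆ ({v, u} : Finset V).sym2 := by
    intro e he; rw [mem_singleton] at he; subst he; simp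
  -- crossing count of a matching through `vu`
  have hsplit : ∀ M' : Finset (Sym2 V), IsPMOn (S \ {v, u}) M' →
      ((insert s(v, u) M').filter fun e => cutCount U e = 1).card =
        (({s(v, u)} : Finset (Sym2 V)).filter fun e => cutCount U e = 1).card +
          (M'.filter fun e => cutCount (U ∩ (S \ {v, u})) e = 1).card := by
    intro M' hM'
    rw [insert_eq, card_filter_cutCount_union (disjoint_of_subset_sym2 hd he1 hM'.1),
      card_filter_cutCount_inter hM'.1]
  refine card_nbij' (fun M => M.erase s(v, u)) (fun M' => insert s(v, u) M') ?_ ?_ ?_ ?_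
  · intro M hM
    simp only [mem_coe, mem_filter, mem_perfectMatchings] at hM ⊢
    obtain ⟨hM, he, ha⟩ := hM
    have h' : IsPMOn ({v, u} ∪ (S \ {v, u})) M := by rwa [← hS]
    have hM' : IsPMOn (S \ {v, u}) (M.erase s(v, u)) := by
      rw [← sdiff_singleton_eq_erase]
      exact h'.sdiff hd (IsPMOn.pair hvu) (singleton_subset_iff.2 he)
    refine ⟨hM', ?_⟩
    rw [← hsplit _ hM', insert_erase he, ha]
  · intro M' hM'
    simp only [mem_coe, mem_filter, mem_perfectMatchings] at hM' ⊢
    obtain ⟨hM', ha⟩ := hM'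
    have hM : IsPMOn S (insert s(v, u) M') := by
      rw [hS, insert_eq]
      exact (IsPMOn.pair hvu).union hM' hd
    exact ⟨hM, mem_insert_self _ _, by rw [hsplit _ hM', ha]⟩
  · intro M hM
    simp only [mem_coe, mem_filter] at hM
    exact insert_erase hM.2.1
  · intro M' hM'
    simp only [mem_coe, mem_filter, mem_perfectMatchings] at hM'
    have hne : s(v, u) ∉ M' := fun h => by
      have := mem_sym2_iff.1 (hM'.1.1 h) v (Sym2.mem_mk_left v u)
      simp at this
    exact erase_insert hne

/-! ### The closed form -/

/-- Single-edge crossing counts: an edge inside `U` is not crossing, an edge from `U` to its complement is.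
[folklore] -/
private theorem card_filter_singleton_cutCount {U : Finset V} {v u : V} (hv : v ∈ U) :
    ((u ∈ U → (({s(v, u)} : Finset (Sym2 V)).filter fun e => cutCount U e = 1).card = 0)) ∧
    (u ∉ U → (({s(v, u)} : Finset (Sym2 V)).filter fun e => cutCount U e = 1).card = 1) := by
  constructor <;> intro hu <;> simp [filter_singleton, cutCount_mk, hv, hu]

/-- **The step of the partner recursion** (`v ∈ U`), with the induction hypothesis for smaller vertex sets as
an explicit hypothesis. [folklore] -/
private theorem card_pm_filter_cr_step {S U : Finset V} (hU : U ⊆ S) {v : V} (hv : v ∈ U) {a i i' : ℕ}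
    (hUc : U.card = a + 2 * i) (hSc : (S \ U).card = a + 2 * i')
    (IH : ∀ S' : Finset V, S'.card < S.card → ∀ U' : Finset V, U' ⊆ S' → ∀ a i i' : ℕ,
      U'.card = a + 2 * i → (S' \ U').card = a + 2 * i' →
      ((perfectMatchings S').filter fun M => (M.filter fun e => cutCount U' e = 1).card = a).card *
        (a.factorial * (2 ^ i * i.factorial) * (2 ^ i' * i'.factorial)) =
          (a + 2 * i).factorial * (a + 2 * i').factorial) :
    ((perfectMatchings S).filter fun M => (M.filter fun e => cutCount U e = 1).card = a).card *
        (a.factorial * (2 ^ i * i.factorial) * (2 ^ i' * i'.factorial)) =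
      (a + 2 * i).factorial * (a + 2 * i').factorial := by
  have hvS : v ∈ S := hU hv
  rw [card_pm_filter_eq_sum_partner hvS]
  -- split the partners into `U.erase v` and `S \ U`
  have hsplit : S.erase v = U.erase v ∪ (S \ U) := by
    ext u
    simp only [mem_erase, mem_union, mem_sdiff]
    constructor
    · rintro ⟨huv, huS⟩
      by_cases huU : u ∈ U
      · exact Or.inl ⟨huv, huU⟩
      · exact Or.inr ⟨huS, huU⟩
    · rintro (⟨huv, huU⟩ | ⟨huS, huU⟩)
      · exact ⟨huv, hU huU⟩
      · exact ⟨fun h => huU (h ▸ hv), huS⟩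
  have hdisj : Disjoint (U.erase v) (S \ U) := disjoint_left.2 fun u hu hu' => (mem_sdiff.1 hu').2 (mem_of_mem_erase hu)
  rw [hsplit, sum_union hdisj]
  -- the sub-configuration after removing `v` and a partner `u`
  have hcardS : ∀ u ∈ S, u ≠ v → (S \ {v, u}).card = S.card - 2 := by
    intro u hu huv
    have hp : ({v, u} : Finset V) ⊆ S := by
      rw [insert_subset_iff, singleton_subset_iff]; exact ⟨hvS, hu⟩
    rw [card_sdiff_of_subset hp, card_pair huv.symm]
  have hlt : ∀ u ∈ S, u ≠ v → (S \ {v, u}).card < S.card := by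
    intro u hu huv
    rw [hcardS u hu huv]; have : 0 < S.card := card_pos.2 ⟨v, hvS⟩; omega
  -- internal partners
  have hint : ∀ u ∈ U.erase v,
      ((perfectMatchings S).filter fun M =>
          s(v, u) ∈ M ∧ (M.filter fun e => cutCount U e = 1).card = a).card *
        (a.factorial * (2 ^ i * i.factorial) * (2 ^ i' * i'.factorial)) =
      (if 1 ≤ i then 2 * i * ((a + 2 * (i - 1)).factorial * (a + 2 * i').factorial) else 0) := by
    intro u hu
    obtain ⟨huv, huU⟩ := mem_erase.1 hu
    rw [card_pm_filter_edge hvS (hU huU) (Ne.symm huv) U a, (card_filter_singleton_cutCount hv).1 huU]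
    simp only [zero_add]
    have hU' : U ∩ (S \ {v, u}) = U \ {v, u} := by
      ext w; simp only [mem_inter, mem_sdiff, mem_insert, mem_singleton]
      constructor
      · rintro ⟨hwU, -, hw⟩; exact ⟨hwU, hw⟩
      · rintro ⟨hwU, hw⟩; exact ⟨hwU, hU hwU, hw⟩
    have hsub : U \ {v, u} ⊆ S \ {v, u} := sdiff_subset_sdiff hU Subset.rfl
    have hp : ({v, u} : Finset V) ⊆ U := by
      rw [insert_subset_iff, singleton_subset_iff]; exact ⟨hv, huU⟩
    have hcU : (U \ {v, u}).card = U.card - 2 := by rw [card_sdiff_of_subset hp, card_pair (Ne.symm huv)]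
    have hcS : ((S \ {v, u}) \ (U \ {v, u})).card = a + 2 * i' := by
      have : (S \ {v, u}) \ (U \ {v, u}) = S \ U := by
        ext w; simp only [mem_sdiff, mem_insert, mem_singleton]
        constructor
        · rintro ⟨⟨hwS, hw⟩, hw'⟩
          exact ⟨hwS, fun hwU => hw' ⟨hwU, hw⟩⟩
        · rintro ⟨hwS, hwU⟩
          refine ⟨⟨hwS, ?_⟩, fun h => hwU h.1⟩
          rintro (rfl | rfl)
          · exact hwU hv
          · exact hwU huU
      rw [this, hSc]
    rw [hU']
    split_ifs with hi
    · have hcU' : (U \ {v, u}).card = a + 2 * (i - 1) := by rw [hcU, hUc]; omega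
      have key := IH (S \ {v, u}) (hlt u (hU huU) huv) (U \ {v, u}) hsub a (i - 1) i' hcU' hcS
      -- K(a,i,i') = K(a,i-1,i') · 2i
      obtain ⟨j, rfl⟩ : ∃ j, i = j + 1 := ⟨i - 1, by omega⟩
      simp only [Nat.add_sub_cancel] at key ⊢
      rw [show a.factorial * (2 ^ (j + 1) * (j + 1).factorial) * (2 ^ i' * i'.factorial) =
          (a.factorial * (2 ^ j * j.factorial) * (2 ^ i' * i'.factorial)) * (2 * (j + 1)) by
        rw [pow_succ, Nat.factorial_succ]; ring]
      rw [← mul_assoc, key]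
      ring
    · -- `i = 0`: the cut `U \ {v,u}` has `a - 2 < a` elements, no matching has `a` crossing edges
      have hi0 : i = 0 := by omega
      subst hi0
      have hUpos : 0 < U.card := card_pos.2 ⟨v, hv⟩
      rw [pm_filter_cr_eq_empty (S := S \ {v, u}) hsub (a := a) (fun h => by
        have h1 := h.1; rw [hcU, hUc] at h1; omega), card_empty, zero_mul]
  -- crossing partners
  have hext : ∀ u ∈ S \ U,
      ((perfectMatchings S).filter fun M =>
          s(v, u) ∈ M ∧ (M.filter fun e => cutCount U e = 1).card = a).card *
        (a.factorial * (2 ^ i * i.factorial) * (2 ^ i' * i'.factorial)) =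
      (if 1 ≤ a then a * ((a - 1 + 2 * i).factorial * (a - 1 + 2 * i').factorial) else 0) := by
    intro u hu
    obtain ⟨huS, huU⟩ := mem_sdiff.1 hu
    have huv : u ≠ v := fun h => huU (h ▸ hv)
    rw [card_pm_filter_edge hvS huS (Ne.symm huv) U a, (card_filter_singleton_cutCount hv).2 huU]
    have hU' : U ∩ (S \ {v, u}) = U.erase v := by
      ext w; simp only [mem_inter, mem_sdiff, mem_insert, mem_singleton, mem_erase]
      constructor
      · rintro ⟨hwU, -, hw⟩; exact ⟨fun h => hw (Or.inl h), hwU⟩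
      · rintro ⟨hwv, hwU⟩; exact ⟨hwU, hU hwU, fun h => h.elim hwv fun h' => huU (h' ▸ hwU)⟩
    have hsub : U.erase v ⊆ S \ {v, u} := by
      intro w hw
      obtain ⟨hwv, hwU⟩ := mem_erase.1 hw
      simp only [mem_sdiff, mem_insert, mem_singleton]
      exact ⟨hU hwU, fun h => h.elim hwv fun h' => huU (h' ▸ hwU)⟩
    have hcS : ((S \ {v, u}) \ U.erase v).card = (S \ U).card - 1 := by
      have : (S \ {v, u}) \ U.erase v = (S \ U).erase u := by
        ext w; simp only [mem_sdiff, mem_insert, mem_singleton, mem_erase]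
        constructor
        · rintro ⟨⟨hwS, hw⟩, hw'⟩
          refine ⟨fun h => hw (Or.inr h), hwS, fun hwU => hw' ⟨fun h => hw (Or.inl h), hwU⟩⟩
        · rintro ⟨hwu, hwS, hwU⟩
          exact ⟨⟨hwS, fun h => h.elim (fun h' => hwU (h' ▸ hv)) hwu⟩, fun h => hwU h.2⟩
      rw [this, card_erase_of_mem hu]
    rw [hU']
    split_ifs with ha
    · have hfilt : ((perfectMatchings (S \ {v, u})).filter fun M' =>
            1 + (M'.filter fun e => cutCount (U.erase v) e = 1).card = a) =
          (perfectMatchings (S \ {v, u})).filter fun M' =>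
            (M'.filter fun e => cutCount (U.erase v) e = 1).card = a - 1 :=
        filter_congr fun M' _ => by omega
      rw [hfilt]
      have hcU' : (U.erase v).card = (a - 1) + 2 * i := by rw [card_erase_of_mem hv, hUc]; omega
      have hcS' : ((S \ {v, u}) \ U.erase v).card = (a - 1) + 2 * i' := by rw [hcS, hSc]; omega
      have key := IH (S \ {v, u}) (hlt u huS huv) (U.erase v) hsub (a - 1) i i' hcU' hcS'
      obtain ⟨b, rfl⟩ : ∃ b, a = b + 1 := ⟨a - 1, by omega⟩
      simp only [Nat.add_sub_cancel] at key ⊢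
      rw [show (b + 1).factorial * (2 ^ i * i.factorial) * (2 ^ i' * i'.factorial) =
          (b.factorial * (2 ^ i * i.factorial) * (2 ^ i' * i'.factorial)) * (b + 1) by
        rw [Nat.factorial_succ]; ring]
      rw [← mul_assoc, key]
      ring
    · have ha0 : a = 0 := by omega
      subst ha0
      have : ((perfectMatchings (S \ {v, u})).filter fun M' =>
          1 + (M'.filter fun e => cutCount (U.erase v) e = 1).card = 0) = ∅ :=
        filter_eq_empty_iff.2 fun M' _ h => by omega
      rw [this, card_empty, zero_mul]
  rw [add_mul, sum_mul, sum_mul, sum_congr rfl hint, sum_congr rfl hext, sum_const, sum_const,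
    smul_eq_mul, smul_eq_mul, hSc]
  have hpe : (U.erase v).card + 1 = a + 2 * i := by
    rw [card_erase_of_mem hv, hUc]; have := card_pos.2 ⟨v, hv⟩; omega
  -- the arithmetic `(p-1)·2i·(p-2)!q! + q·a·(p-1)!(q-1)! = p!q!`
  rcases Nat.eq_zero_or_pos i with hi0 | hipos
  · subst hi0
    rcases Nat.eq_zero_or_pos a with ha0 | hapos
    · subst ha0; simp at hUc; exact absurd hv (by rw [hUc]; exact notMem_empty v)
    · obtain ⟨b, rfl⟩ : ∃ b, a = b + 1 := ⟨a - 1, by omega⟩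
      rw [if_neg (by omega), if_pos (by omega)]
      simp only [Nat.add_sub_cancel, mul_zero, add_zero, zero_add]
      have e1 : (b + 1 + 2 * i').factorial = (b + 1 + 2 * i') * (b + 2 * i').factorial := by
        rw [show b + 1 + 2 * i' = (b + 2 * i') + 1 by ring, Nat.factorial_succ]
      rw [e1, Nat.factorial_succ b]
      ring
  · obtain ⟨j, rfl⟩ : ∃ j, i = j + 1 := ⟨i - 1, by omega⟩
    rw [if_pos (by omega)]
    rcases Nat.eq_zero_or_pos a with ha0 | hapos
    · subst ha0
      rw [if_neg (by omega)]
      have hc : (U.erase v).card = 2 * j + 1 := by omega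
      rw [hc]
      simp only [zero_add, Nat.add_sub_cancel, mul_zero, add_zero]
      have e1 : (2 * (j + 1)).factorial = (2 * j + 2) * ((2 * j + 1) * (2 * j).factorial) := by
        rw [show 2 * (j + 1) = (2 * j + 1) + 1 by ring, Nat.factorial_succ, Nat.factorial_succ]
      rw [e1]
      ring
    · obtain ⟨b, rfl⟩ : ∃ b, a = b + 1 := ⟨a - 1, by omega⟩
      rw [if_pos (by omega)]
      have hc : (U.erase v).card = b + 2 * j + 2 := by omega
      rw [hc]
      simp only [Nat.add_sub_cancel]
      have e1 : (b + 1 + 2 * j).factorial = (b + 2 * j + 1).factorial := by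
        rw [show b + 1 + 2 * j = b + 2 * j + 1 by ring]
      have e2 : (b + 2 * (j + 1)).factorial = (b + 2 * j + 2) * (b + 2 * j + 1).factorial := by
        rw [show b + 2 * (j + 1) = (b + 2 * j + 1) + 1 by ring, Nat.factorial_succ]
      have e3 : (b + 1 + 2 * (j + 1)).factorial = (b + 2 * j + 3) * ((b + 2 * j + 2) * (b + 2 * j + 1).factorial) := by
        rw [show b + 1 + 2 * (j + 1) = (b + 2 * j + 1) + 1 + 1 by ring, Nat.factorial_succ, Nat.factorial_succ]
      have e4 : (b + 1 + 2 * i').factorial = (b + 2 * i' + 1) * (b + 2 * i').factorial := by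
        rw [show b + 1 + 2 * i' = (b + 2 * i') + 1 by ring, Nat.factorial_succ]
      rw [e1, e2, e3, e4]
      ring


/-- **Closed form for the number of perfect matchings with `a` crossing edges**: for `U ⊆ S` with
`|U| = a + 2i`, `|S \ U| = a + 2i'`, `#{M ∈ PM(S) : #cr(U,M) = a} · (a!·2^i i!·2^{i'} i'!) = (a+2i)!·(a+2i')!`
(i.e. the count is `C(a+2i,a) C(a+2i',a) a! (2i-1)!! (2i'-1)!!`). [folklore] -/
private theorem card_pm_filter_cr_mul_aux : ∀ (m : ℕ) (S : Finset V), S.card = m → ∀ U : Finset V, U ⊆ S →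
    ∀ a i i' : ℕ, U.card = a + 2 * i → (S \ U).card = a + 2 * i' →
      ((perfectMatchings S).filter fun M => (M.filter fun e => cutCount U e = 1).card = a).card *
        (a.factorial * (2 ^ i * i.factorial) * (2 ^ i' * i'.factorial)) =
          (a + 2 * i).factorial * (a + 2 * i').factorial := by
  intro m
  induction m using Nat.strong_induction_on with
  | _ m IHm =>
    intro S hSm U hU a i i' hUc hSc
    have IH : ∀ S' : Finset V, S'.card < S.card → ∀ U' : Finset V, U' ⊆ S' → ∀ a i i' : ℕ,
        U'.card = a + 2 * i → (S' \ U').card = a + 2 * i' →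
        ((perfectMatchings S').filter fun M => (M.filter fun e => cutCount U' e = 1).card = a).card *
          (a.factorial * (2 ^ i * i.factorial) * (2 ^ i' * i'.factorial)) =
            (a + 2 * i).factorial * (a + 2 * i').factorial :=
      fun S' hS' U' hU' a i i' h1 h2 => IHm S'.card (hSm ▸ hS') S' rfl U' hU' a i i' h1 h2
    rcases U.eq_empty_or_nonempty with hU0 | ⟨v, hv⟩
    · -- `U = ∅`: then `a = i = 0`; pass to the complement cut `S`
      subst hU0
      rw [card_empty] at hUc
      have ha : a = 0 := by omega
      have hi : i = 0 := by omega
      subst ha; subst hi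
      rw [sdiff_empty] at hSc
      rcases S.eq_empty_or_nonempty with hS0 | ⟨v, hvS⟩
      · subst hS0
        rw [card_empty] at hSc
        have hi' : i' = 0 := by omega
        subst hi'
        have h1 : perfectMatchings (∅ : Finset V) = {∅} := by
          ext M
          rw [mem_perfectMatchings, mem_singleton]
          exact ⟨IsPMOn.eq_empty, fun h => h ▸ IsPMOn.empty⟩
        rw [h1, filter_singleton, if_pos (by simp)]
        simp
      · have hsym : ((perfectMatchings S).filter fun M =>
              (M.filter fun e => cutCount (∅ : Finset V) e = 1).card = 0).card =
            ((perfectMatchings S).filter fun M => (M.filter fun e => cutCount S e = 1).card = 0).card := by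
          congr 1
          refine filter_congr fun M hM => ?_
          rw [mem_perfectMatchings] at hM
          have := card_filter_cr_sdiff (U := S) hM.1
          rw [sdiff_self, bot_eq_empty] at this
          rw [this]
        rw [hsym]
        have key := card_pm_filter_cr_step (S := S) (U := S) Subset.rfl hvS (a := 0) (i := i') (i' := 0)
          (by rw [hSc]) (by rw [sdiff_self, bot_eq_empty, card_empty]) IH
        rw [show Nat.factorial 0 * (2 ^ 0 * Nat.factorial 0) * (2 ^ i' * i'.factorial) =
            Nat.factorial 0 * (2 ^ i' * i'.factorial) * (2 ^ 0 * Nat.factorial 0) by ring, key]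
        ring
    · exact card_pm_filter_cr_step hU hv hUc hSc IH

/-- **Closed form** (see `card_pm_filter_cr_mul_aux`). [folklore] -/
private theorem card_pm_filter_cr_mul {S U : Finset V} (hU : U ⊆ S) {a i i' : ℕ} (hUc : U.card = a + 2 * i)
    (hSc : (S \ U).card = a + 2 * i') :
    ((perfectMatchings S).filter fun M => (M.filter fun e => cutCount U e = 1).card = a).card *
        (a.factorial * (2 ^ i * i.factorial) * (2 ^ i' * i'.factorial)) =
      (a + 2 * i).factorial * (a + 2 * i').factorial :=
  card_pm_filter_cr_mul_aux S.card S rfl U hU a i i' hUc hSc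

end Literature.Combinatorics.Optimization.ChebyshevTracialDesignJunta

/-! ## Section from `ChebyshevTracialDesignJuntaVirtualPositivity.lean` -/
/-!
# Junta virtual positivity, part C: the design value of a junta psd pair is `≤ 0`

Support file for the crux `TracialDecayExp20` (stmt-PneNP-19878; also the aside `TracialDecay20`,
stmt-PneNP-19646) of route `ChebyshevTracialDesign` — the cell's LOCAL VIRTUAL POSITIVITY LEMMA (N1)
(HOME/pnp-psdrank-p1/N1-LocalVirtualPositivity.md, Theorem; the planner's BC5 rung `stub_rung_juntaVirtual`
of the crux skeleton HOME/pnp-psdrank-p1/route/births_scratch.lean), kernel-checked: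

for an exact extrapolation design `(C, w)` of degree `D` on the `t`-cuts of `K_n`
(`Literature.Combinatorics.Optimization.IsExactDesign n t T D B C w`) and psd matrix families
`X : OddSet n → Sym_r⁺`, `Y : PMatch n → Sym_r⁺` such that `X_U` depends only on `U ∩ A` for a window `A`
with `|A| ≤ D` (`2|A| ≤ t+2`, `2|A|+t ≤ n+2`; NO condition on `Y`, no tightness, any dimension `r`), the
design value `Σ_U Σ_M levelWeight(U,M)·tr(X_U Y_M)` is `≤ 0` (`sum_levelWeight_trace_nonpos_of_junta`);
in particular for balanced designs of degree `dq n` on levels `≤ Tq n` and `|A| ≤ dq n`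
(`juntaVirtualPositivity_bal`). Mechanism: per matching `M` the level sums are `T(n/2; c, i)·P_M(c)` with
`deg P_M ≤ |A| ≤ D`, `P_M(0) ≥ 0` (junta sum law, part B); `|Q_c| = #PM·T(n/2; c, i)`; exactness gives
value `= -(#PM)⁻¹ Σ_M P_M(0) ≤ 0`.
-/


namespace Literature.Combinatorics.Optimization.ChebyshevTracialDesignJunta

open Finset Literature.Barriers.PneNP Literature.Combinatorics.SimpleGraph.CycleSpace

/-! ### Part C: junta virtual positivity for exact designs (cell (N1) Theorem)

For an exact extrapolation design `(C, w)` of degree `D` on the `t`-cuts of `K_n`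
(`Literature.Combinatorics.Optimization.IsExactDesign`) and a pair `X : OddSet n → psd`,
`Y : PMatch n → psd` where `X_U` depends only on `U ∩ A` for a window `A` with `|A| ≤ D`
(`2|A| ≤ t + 2`, `2|A| + t ≤ n + 2`; `Y` arbitrary), the design value
`Σ_U Σ_M levelWeight(U,M)·tr(X_U Y_M)` is `≤ 0`: per matching `M` the level sums are `T(n/2;c,i)·P_M(c)`
(junta sum law), `|Q_c| = #PM · T(n/2; c, i)`, so the value is `(#PM)⁻¹ Σ_M Σ_c w_c P_M(c) =
-(#PM)⁻¹ Σ_M P_M(0) ≤ 0` by exactness. -/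

section Design

open Polynomial Matrix Literature.Combinatorics.Optimization

variable {n : ℕ}

/-- Every vertex of the window lies on a window edge: `A ⊆ W`. [folklore] -/
private theorem subset_verts_window (M : PMatch n) (A : Finset (Fin n)) :
    A ⊆ (univ : Finset (Fin n)).filter fun v => ∃ e ∈ M.1.filter (fun e => ∃ a ∈ A, a ∈ e), v ∈ e := by
  intro a ha
  obtain ⟨e, he, hae⟩ := M.2.exists_mem (mem_univ a)
  exact mem_filter.2 ⟨mem_univ a, e, mem_filter.2 ⟨he, a, ha, hae⟩, hae⟩

/-- There are at most `|A|` window edges (each contains a point of `A`, and the edges of a matching are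
disjoint). [folklore] -/
private theorem card_window_edges_le (M : PMatch n) (A : Finset (Fin n)) :
    (M.1.filter fun e => ∃ a ∈ A, a ∈ e).card ≤ A.card := by
  classical
  let f : Fin n → Sym2 (Fin n) := fun a => if h : ∃ e ∈ M.1, a ∈ e then h.choose else s(a, a)
  refine card_le_card_of_surjOn f fun e he => ?_
  rw [mem_coe, mem_filter] at he
  obtain ⟨heM, a, haA, hae⟩ := he
  refine ⟨a, mem_coe.2 haA, ?_⟩
  have h : ∃ e ∈ M.1, a ∈ e := ⟨e, heM, hae⟩
  show (if h : ∃ e ∈ M.1, a ∈ e then h.choose else s(a, a)) = e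
  rw [dif_pos h]
  exact M.2.unique h.choose_spec.1 heM h.choose_spec.2 hae

/-- A perfect matching of `K_n` has `n/2` edges (`2|M| = n`). [folklore] -/
private theorem two_mul_card_pmatch (M : PMatch n) : 2 * M.1.card = n := by
  rw [two_mul_card_eq M.2, card_univ, Fintype.card_fin]

/-- **Per-matching level sums through the Finset-level count**: for `c + 2i = t`,
`Σ_{U : OddSet, |U| = t, cc(U,M) = c} tr(X_U Y_M) = Σ_{U' : #cr = c, #in = i} g_M(U')` with
`g_M(U') = tr(X_{U'} Y_M)` (read through the odd-cardinality proof). [folklore] -/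
private theorem sum_oddSet_level_eq (M : PMatch n) {t c i : ℕ} (hci : c + 2 * i = t) {r : ℕ}
    (X : OddSet n → Matrix (Fin r) (Fin r) ℝ) (Y : PMatch n → Matrix (Fin r) (Fin r) ℝ) :
    ∑ U : OddSet n, (if U.1.card = t ∧ cc U M = c then (X U * Y M).trace else 0) =
      ∑ U' ∈ (univ : Finset (Fin n)).powerset.filter (fun U' =>
          (M.1.filter fun e => cutCount U' e = 1).card = c ∧ (M.1.filter fun e => cutCount U' e = 2).card = i),
        (if h : Odd U'.card then (X ⟨U', h⟩ * Y M).trace else 0) := by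
  classical
  -- Finset-level integrand
  set φ : Finset (Fin n) → ℝ := fun U' =>
    if U'.card = t ∧ (M.1.filter fun e => cutCount U' e = 1).card = c then
      (if h : Odd U'.card then (X ⟨U', h⟩ * Y M).trace else 0) else 0 with hφ
  have h1 : ∑ U : OddSet n, (if U.1.card = t ∧ cc U M = c then (X U * Y M).trace else 0) =
      ∑ U : OddSet n, φ U.1 := by
    refine Fintype.sum_congr _ _ fun U => ?_
    rw [hφ]
    simp only [cc_eq_card_filter, dif_pos U.2]
  have h2 : ∑ U : OddSet n, φ U.1 = ∑ U' ∈ (univ : Finset (Finset (Fin n))).filter (fun U' => Odd U'.card), φ U' :=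
    (sum_subtype _ (fun U' => by simp) φ).symm
  have h3 : ∑ U' ∈ (univ : Finset (Finset (Fin n))).filter (fun U' => Odd U'.card), φ U' = ∑ U', φ U' := by
    refine sum_subset (filter_subset _ _) fun U' _ hU' => ?_
    rw [mem_filter, not_and] at hU'
    rw [hφ]
    dsimp only
    rw [dif_neg (hU' (mem_univ _))]
    split_ifs <;> rfl
  rw [h1, h2, h3, hφ, ← sum_filter, powerset_univ]
  refine sum_congr ?_ fun _ _ => rfl
  ext U'
  simp only [mem_filter, mem_univ, true_and]
  have := card_eq_cr_add_two_mul_in M.2 (subset_univ U')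
  constructor
  · rintro ⟨ht, hc⟩; exact ⟨hc, by omega⟩
  · rintro ⟨hc, hi⟩; exact ⟨by omega, hc⟩

/-- **Junta virtual positivity** (cell pnp-psdrank, local virtual positivity lemma (N1)): for an exact
design of degree `D` on the `t`-cuts and a psd pair `(X, Y)` with `X_U` depending only on `U ∩ A`,
`|A| ≤ D` (`2|A| ≤ t + 2`, `2|A| + t ≤ n + 2`), the design value `Σ_U Σ_M W(U,M)·tr(X_U Y_M)` is `≤ 0`.
No tightness, no dimension restriction, no bound on the weights, and no condition on `Y` is needed.
[folklore] -/
private theorem sum_levelWeight_trace_nonpos_of_junta {t T D : ℕ} {Bv : ℝ} {C : Finset ℕ} {w : ℕ → ℝ}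
    (hdes : IsExactDesign n t T D Bv C w) {r : ℕ} (A : Finset (Fin n)) (hAD : A.card ≤ D)
    (hAt : 2 * A.card ≤ t + 2) (hAn : 2 * A.card + t ≤ n + 2)
    (X : OddSet n → Matrix (Fin r) (Fin r) ℝ) (Y : PMatch n → Matrix (Fin r) (Fin r) ℝ)
    (hX : ∀ U U' : OddSet n, U.1 ∩ A = U'.1 ∩ A → X U = X U')
    (hXpsd : ∀ U, (X U).PosSemidef) (hYpsd : ∀ M, (Y M).PosSemidef) :
    ∑ U, ∑ M, levelWeight n t C w U M * (X U * Y M).trace ≤ 0 := by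
  classical
  obtain ⟨htodd, -, hTt, hC, -, hexact, -⟩ := hdes
  have htr : ∀ (U : OddSet n) (M : PMatch n), 0 ≤ (X U * Y M).trace := fun U M =>
    (show HasPsdFactorization (fun U M => (X U * Y M).trace) r from ⟨X, Y, hXpsd, hYpsd, fun _ _ => rfl⟩).nonneg U M
  -- Step 1: the value as level sums
  have hval : ∑ U, ∑ M, levelWeight n t C w U M * (X U * Y M).trace =
      ∑ c ∈ C, w c / ((Qset n t c).card : ℝ) *
        ∑ M : PMatch n, ∑ U : OddSet n, (if U.1.card = t ∧ cc U M = c then (X U * Y M).trace else 0) := by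
    calc ∑ U, ∑ M, levelWeight n t C w U M * (X U * Y M).trace
        = ∑ U, ∑ M, ∑ c ∈ C, (if (U, M) ∈ Qset n t c then w c / ((Qset n t c).card : ℝ) * (X U * Y M).trace
            else 0) := by
          refine sum_congr rfl fun U _ => sum_congr rfl fun M _ => ?_
          rw [levelWeight, sum_mul]
          exact sum_congr rfl fun c _ => by split_ifs <;> simp
      _ = ∑ U, ∑ c ∈ C, ∑ M, (if (U, M) ∈ Qset n t c then w c / ((Qset n t c).card : ℝ) * (X U * Y M).trace
            else 0) := sum_congr rfl fun U _ => sum_comm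
      _ = ∑ c ∈ C, ∑ U, ∑ M, (if (U, M) ∈ Qset n t c then w c / ((Qset n t c).card : ℝ) * (X U * Y M).trace
            else 0) := sum_comm
      _ = ∑ c ∈ C, w c / ((Qset n t c).card : ℝ) *
            ∑ M : PMatch n, ∑ U : OddSet n, (if U.1.card = t ∧ cc U M = c then (X U * Y M).trace else 0) := by
          refine sum_congr rfl fun c _ => ?_
          rw [mul_sum, sum_comm]
          refine sum_congr rfl fun M _ => ?_
          rw [mul_sum]
          refine sum_congr rfl fun U _ => ?_
          simp only [mem_Qset_iff]
          split_ifs <;> simp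
  -- Step 2: per matching, the polynomial from the junta sum law
  have hN : ∀ M : PMatch n, M.1.card = n / 2 := fun M => by have := two_mul_card_pmatch M; omega
  have hP : ∀ M : PMatch n, ∃ P : Polynomial ℝ, P.natDegree ≤ D ∧ 0 ≤ P.eval 0 ∧ ∀ c i : ℕ, c + 2 * i = t →
      ∑ U : OddSet n, (if U.1.card = t ∧ cc U M = c then (X U * Y M).trace else 0) =
        (((n / 2).choose (c + i) * (c + i).choose i * 2 ^ c : ℕ) : ℝ) * P.eval (c : ℝ) := by
    intro M
    set E := M.1.filter (fun e => ∃ a ∈ A, a ∈ e) with hE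
    set W := (univ : Finset (Fin n)).filter (fun v => ∃ e ∈ E, v ∈ e) with hW
    have hEM : E ⊆ M.1 := filter_subset _ _
    have hEA : E.card ≤ A.card := card_window_edges_le M A
    have hAW : A ⊆ W := subset_verts_window M A
    obtain ⟨P, hPdeg, hP0, hPval⟩ := junta_sum_law M.2 hEM (t := t) (by omega)
      (by have := two_mul_card_pmatch M; omega)
      (fun U' => if h : Odd U'.card then (X ⟨U', h⟩ * Y M).trace else 0)
      (fun B => if h : ∃ U : OddSet n, U.1.card = t ∧ U.1 ∩ W = B then (X h.choose * Y M).trace else 0)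
      (fun U' _ hU't => by
        have hodd : Odd U'.card := hU't ▸ htodd
        have hex : ∃ U : OddSet n, U.1.card = t ∧ U.1 ∩ W = U' ∩ W := ⟨⟨U', hodd⟩, hU't, rfl⟩
        simp only [dif_pos hodd]
        rw [← hW, dif_pos hex]
        have hXeq : X ⟨U', hodd⟩ = X hex.choose := by
          refine hX _ _ ?_
          have h2 := hex.choose_spec.2
          calc U' ∩ A = (U' ∩ W) ∩ A := by rw [inter_assoc, inter_eq_right.2 hAW]
            _ = (hex.choose.1 ∩ W) ∩ A := by rw [h2]
            _ = hex.choose.1 ∩ A := by rw [inter_assoc, inter_eq_right.2 hAW]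
        rw [hXeq])
      (fun B => by
        split_ifs with h
        · exact htr _ _
        · exact le_refl _)
    refine ⟨P, hPdeg.trans (hEA.trans hAD), hP0, fun c i hci => ?_⟩
    rw [sum_oddSet_level_eq M hci X Y, hPval c i hci, hN M]
  choose P hPdeg hP0 hPval using hP
  -- Step 3: |Q_c| = #PM · T(n/2; c, i)
  have hQ : ∀ c i : ℕ, c + 2 * i = t → ((Qset n t c).card : ℝ) =
      (Fintype.card (PMatch n) : ℝ) * (((n / 2).choose (c + i) * (c + i).choose i * 2 ^ c : ℕ) : ℝ) := by
    intro c i hci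
    have e1 : ((Qset n t c).card : ℝ) =
        ∑ M : PMatch n, ∑ U : OddSet n, (if U.1.card = t ∧ cc U M = c then (1 : ℝ) else 0) := by
      rw [Qset, Finset.card_filter, Nat.cast_sum, Fintype.sum_prod_type, sum_comm]
      refine sum_congr rfl fun M _ => sum_congr rfl fun U _ => ?_
      split_ifs <;> simp
    have e2 : ∀ M : PMatch n, ∑ U : OddSet n, (if U.1.card = t ∧ cc U M = c then (1 : ℝ) else 0) =
        (((n / 2).choose (c + i) * (c + i).choose i * 2 ^ c : ℕ) : ℝ) := by
      intro M
      have key := sum_oddSet_level_eq M hci (r := 1) (fun _ => 1) (fun _ => 1)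
      simp only [Matrix.mul_one, trace_one, Fintype.card_fin, Nat.cast_one, dite_eq_ite] at key
      rw [key]
      have hodd : ∀ U' ∈ (univ : Finset (Fin n)).powerset.filter (fun U' =>
          (M.1.filter fun e => cutCount U' e = 1).card = c ∧ (M.1.filter fun e => cutCount U' e = 2).card = i),
          (if Odd U'.card then (1 : ℝ) else 0) = 1 := by
        intro U' hU'
        rw [mem_filter] at hU'
        have hc := card_eq_cr_add_two_mul_in M.2 (subset_univ U')
        rw [hU'.2.1, hU'.2.2, hci] at hc
        rw [if_pos (hc ▸ htodd)]
      rw [sum_congr rfl hodd, sum_const, nsmul_eq_mul, mul_one, card_filter_cr_in_eq M.2, hN M]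
    rw [e1, Fintype.sum_congr _ _ e2, sum_const, card_univ, nsmul_eq_mul]
  -- Step 4: assemble
  rw [hval]
  have hPM : ∀ c ∈ C, (Fintype.card (PMatch n) : ℝ) ≠ 0 := by
    intro c hc h0
    obtain ⟨p, hp⟩ := (hC c hc).2.2.2
    have : 0 < Fintype.card (PMatch n) := Fintype.card_pos_iff.2 ⟨p.2⟩
    exact absurd h0 (by exact_mod_cast this.ne')
  have hterm : ∀ c ∈ C, w c / ((Qset n t c).card : ℝ) *
      ∑ M : PMatch n, ∑ U : OddSet n, (if U.1.card = t ∧ cc U M = c then (X U * Y M).trace else 0) =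
      (Fintype.card (PMatch n) : ℝ)⁻¹ * ∑ M : PMatch n, w c * (P M).eval (c : ℝ) := by
    intro c hc
    obtain ⟨hcodd, -, hcT, hne⟩ := hC c hc
    have hct : c ≤ t := hcT.trans hTt
    obtain ⟨i, hi⟩ : ∃ i, c + 2 * i = t := by
      obtain ⟨a, ha⟩ := hcodd; obtain ⟨b, hb⟩ := htodd; exact ⟨b - a, by omega⟩
    have hQc := hQ c i hi
    have hQ0 : ((Qset n t c).card : ℝ) ≠ 0 := by exact_mod_cast (card_pos.2 hne).ne'
    have hT0 : (((n / 2).choose (c + i) * (c + i).choose i * 2 ^ c : ℕ) : ℝ) ≠ 0 := by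
      intro h0; rw [h0, mul_zero] at hQc; exact hQ0 hQc
    rw [sum_congr rfl fun M _ => hPval M c i hi, ← mul_sum, hQc, mul_sum, mul_sum, mul_sum]
    refine sum_congr rfl fun M _ => ?_
    field_simp
  rw [sum_congr rfl hterm, ← mul_sum, sum_comm]
  have hinner : ∀ M : PMatch n, ∑ c ∈ C, w c * (P M).eval (c : ℝ) = -(P M).eval 0 :=
    fun M => hexact (P M) (hPdeg M)
  rw [Fintype.sum_congr _ _ hinner]
  exact mul_nonpos_of_nonneg_of_nonpos (inv_nonneg.2 (Nat.cast_nonneg _))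
    (by rw [sum_neg_distrib, neg_nonpos]; exact sum_nonneg fun M _ => hP0 M)

end Design

section Rung

open Matrix Literature.Combinatorics.Optimization

/-- **BC5 rung of the crux `TracialDecayExp20` — junta virtual positivity** (the planner's
`stub_rung_juntaVirtual`, HOME/pnp-psdrank-p1/route/births_scratch.lean, with the junta hypothesis needed
on the cut side only): for every balanced exact design of degree `dq n` on levels `≤ Tq n` (any variation
bound) and every psd pair `(X, Y)` of any dimension `r` with `X_U` depending only on `U ∩ A`, `|A| ≤ dq n`,
the design value `(Σ_U Σ_M W(U,M)·tr(X_U Y_M))/r` is `≤ 0` — tight or not. [folklore] -/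
private theorem juntaVirtualPositivity_bal {n t : ℕ} {Bv : ℝ} {C : Finset ℕ} {w : ℕ → ℝ}
    (hdes : IsBalancedDesign n t (Tq n) (dq n) Bv C w) {r : ℕ} (A : Finset (Fin n)) (hA : A.card ≤ dq n)
    (X : OddSet n → Matrix (Fin r) (Fin r) ℝ) (Y : PMatch n → Matrix (Fin r) (Fin r) ℝ)
    (hX : ∀ U U' : OddSet n, U.1 ∩ A = U'.1 ∩ A → X U = X U')
    (hXpsd : ∀ U, (X U).PosSemidef) (hYpsd : ∀ M, (Y M).PosSemidef) :
    (∑ U, ∑ M, levelWeight n t C w U M * (X U * Y M).trace) / r ≤ 0 := by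
  have hsq : dq n ≤ Nat.sqrt n := by unfold dq; exact Nat.sqrt_le_self _
  have hT : Tq n ≤ t := hdes.1.2.2.1
  have htn : 2 * t + 2 ≤ n := hdes.1.2.1
  unfold Tq at hT
  have h1 : 2 * A.card ≤ t + 2 := by omega
  have h2 : 2 * A.card + t ≤ n + 2 := by omega
  exact div_nonpos_iff.2 (Or.inr ⟨sum_levelWeight_trace_nonpos_of_junta hdes.1 A (hA) h1 h2 X Y hX hXpsd hYpsd,
    Nat.cast_nonneg r⟩)

end Rung

end Literature.Combinatorics.Optimization.ChebyshevTracialDesignJunta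

/-! ## Section from `ChebyshevTracialDesignJuntaMatchingFiber.lean` -/
/-!
# Junta virtual positivity, part E₁: matching-side fibres over a prescribed sub-matching

Support file for the crux `TracialDecayExp20` (stmt-PneNP-19878) of route `ChebyshevTracialDesign`
(cell pnp-psdrank, local virtual positivity (N1), MATCHING-SIDE twin; builds on parts A, D).
For a cut `U ⊆ S` (`|U| = t = a + 2i`, `|S \ U| = s = a + 2i'`) and a sub-matching `E` on `W ⊆ S` with
`y` edges crossing `U`, `z` inside `U`, `e` outside: `card_pm_filter_superset` (the matchings `M ⊇ E`
with `a` crossing edges ↔ matchings of `S \ W`) and the ratio identity `card_pm_fiber_ratio_nat`: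
`#{M ⊇ E : #cr = a} · [t]_{y+2z}[s]_{y+2e} = #{M : #cr = a} · [a]_y · 2^z[i]_z · 2^e[i']_e`.
No definitions; notation as in parts A/D.
-/


namespace Literature.Combinatorics.Optimization.ChebyshevTracialDesignJunta

open Finset Literature.Barriers.PneNP Literature.Combinatorics.SimpleGraph.CycleSpace

variable {V : Type*} [DecidableEq V]

/-! ### Part E: fibres over a prescribed sub-matching and the matching-side pattern law

For a cut `U ⊆ S` (`|U| = t = a + 2i`, `|S \ U| = s = a + 2i'`) and a sub-matching `E` on `W ⊆ S` with `y`
crossing, `z` inside `U`, `e` inside `S \ U` (`x = y + z + e` edges), the perfect matchings `M ⊇ E` of `S`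
with `a` crossing edges number `fiber`, and
`fiber · [t]_{y+2z} · [s]_{y+2e} = total · [a]_y · 2^z [i]_z · 2^e [i']_e`
(`card_pm_fiber_ratio_nat`), i.e. `P_{M | U, cc = a}[E ⊆ M]` is the value at `a` of the polynomial
`[X]_y · ∏_{j<z}(t - X - 2j) · ∏_{j<e}(s - X - 2j) / ([t]_{y+2z}[s]_{y+2e})` of degree `x` with nonnegative value
at the virtual level `X = 0` (`pattern_poly_exists_pm`). -/

section MatchingFiber

/-- `|U ∩ W| = #cr(U,E) + 2·#in(U,E)` for a perfect matching `E` of `W`. [folklore] -/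
private theorem card_inter_verts_eq {U W : Finset V} {E : Finset (Sym2 V)} (hE : IsPMOn W E) :
    (U ∩ W).card = (E.filter fun e => cutCount U e = 1).card + 2 * (E.filter fun e => cutCount U e = 2).card := by
  rw [card_eq_cr_add_two_mul_in hE inter_subset_right, card_filter_cutCount_inter hE.1,
    card_filter_cutCount_inter hE.1]

/-- `|W \ U| + |U ∩ W| = 2|E|` in the form `|W \ U| + #cr + 2·#in = 2|E|`. [folklore] -/
private theorem card_verts_sdiff_eq {U W : Finset V} {E : Finset (Sym2 V)} (hE : IsPMOn W E) :
    (W \ U).card + (E.filter fun e => cutCount U e = 1).card + 2 * (E.filter fun e => cutCount U e = 2).card =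
      2 * E.card := by
  have h1 := card_inter_verts_eq (U := U) hE
  -- 2|E| = |W|: every edge of `E` is internal to `W`
  have h0 : (E.filter fun e => cutCount W e = 1).card = 0 := by
    rw [card_eq_zero, filter_eq_empty_iff]
    intro e he h1'
    induction e using Sym2.ind with
    | h a b =>
      have hab := mem_sym2_iff.1 (hE.1 he)
      rw [cutCount_mk, if_pos (hab a (Sym2.mem_mk_left a b)), if_pos (hab b (Sym2.mem_mk_right a b))] at h1'
      exact absurd h1' (by decide)
  have hin : (E.filter fun e => cutCount W e = 2) = E := by
    refine filter_true_of_mem fun e he => ?_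
    induction e using Sym2.ind with
    | h a b =>
      have hab := mem_sym2_iff.1 (hE.1 he)
      rw [cutCount_mk, if_pos (hab a (Sym2.mem_mk_left a b)), if_pos (hab b (Sym2.mem_mk_right a b))]
  have h2 : W.card = 2 * E.card := by
    rw [card_eq_cr_add_two_mul_in hE Subset.rfl, h0, hin, zero_add]
  have h3 : (W \ U).card + (U ∩ W).card = W.card := by
    rw [inter_comm, card_sdiff_add_card_inter]
  omega

/-- **Fibre over a prescribed sub-matching**: perfect matchings `M ⊇ E` of `S` with `a` crossing edges
correspond (`M ↦ M \ E`) to perfect matchings of `S \ W` whose crossing count plus `#cr(U,E)` is `a`.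
[folklore] -/
private theorem card_pm_filter_superset {S W U : Finset V} {E : Finset (Sym2 V)} (hW : W ⊆ S) (hE : IsPMOn W E)
    (a : ℕ) :
    ((perfectMatchings S).filter fun M => E ⊆ M ∧ (M.filter fun e => cutCount U e = 1).card = a).card =
      ((perfectMatchings (S \ W)).filter fun M' =>
        (E.filter fun e => cutCount U e = 1).card +
          (M'.filter fun e => cutCount (U ∩ (S \ W)) e = 1).card = a).card := by
  have hS : S = W ∪ (S \ W) := (union_sdiff_of_subset hW).symm
  have hd : Disjoint W (S \ W) := disjoint_sdiff
  have hsplit : ∀ M' : Finset (Sym2 V), IsPMOn (S \ W) M' →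
      ((E ∪ M').filter fun e => cutCount U e = 1).card =
        (E.filter fun e => cutCount U e = 1).card + (M'.filter fun e => cutCount (U ∩ (S \ W)) e = 1).card := by
    intro M' hM'
    rw [card_filter_cutCount_union (disjoint_of_subset_sym2 hd hE.1 hM'.1), card_filter_cutCount_inter hM'.1]
  refine card_nbij' (fun M => M \ E) (fun M' => E ∪ M') ?_ ?_ ?_ ?_
  · intro M hM
    simp only [mem_coe, mem_filter, mem_perfectMatchings] at hM ⊢
    obtain ⟨hM, hEM, ha⟩ := hM
    have h' : IsPMOn (W ∪ (S \ W)) M := by rwa [← hS]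
    have hM' : IsPMOn (S \ W) (M \ E) := h'.sdiff hd hE hEM
    refine ⟨hM', ?_⟩
    rw [← hsplit _ hM', union_sdiff_of_subset hEM, ha]
  · intro M' hM'
    simp only [mem_coe, mem_filter, mem_perfectMatchings] at hM' ⊢
    obtain ⟨hM', ha⟩ := hM'
    have hM : IsPMOn S (E ∪ M') := by rw [hS]; exact hE.union hM' hd
    exact ⟨hM, subset_union_left, by rw [hsplit _ hM', ha]⟩
  · intro M hM
    simp only [mem_coe, mem_filter] at hM
    exact union_sdiff_of_subset hM.2.1
  · intro M' hM'
    simp only [mem_coe, mem_filter, mem_perfectMatchings] at hM'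
    have hdis : Disjoint E M' := disjoint_of_subset_sym2 hd hE.1 hM'.1.1
    show (E ∪ M') \ E = M'
    rw [union_sdiff_left, Finset.sdiff_eq_self_iff_disjoint]
    exact hdis.symm

/-- **The matching-side ratio identity in `ℕ`**: with `fiber`, `total` as in the section docstring,
`fiber · [t]_{y+2z} · [s]_{y+2e} = total · [a]_y · (2^z [i]_z) · (2^e [i']_e)`. [folklore] -/
private theorem card_pm_fiber_ratio_nat {S W U : Finset V} {E : Finset (Sym2 V)} (hU : U ⊆ S) (hW : W ⊆ S)
    (hE : IsPMOn W E) {a i i' : ℕ} (hUc : U.card = a + 2 * i) (hSc : (S \ U).card = a + 2 * i') :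
    ((perfectMatchings S).filter fun M => E ⊆ M ∧ (M.filter fun e => cutCount U e = 1).card = a).card *
        ((a + 2 * i).descFactorial
            ((E.filter fun e => cutCount U e = 1).card + 2 * (E.filter fun e => cutCount U e = 2).card) *
          (a + 2 * i').descFactorial
            ((E.filter fun e => cutCount U e = 1).card +
              2 * (E.card - (E.filter fun e => cutCount U e = 1).card - (E.filter fun e => cutCount U e = 2).card))) =
      ((perfectMatchings S).filter fun M => (M.filter fun e => cutCount U e = 1).card = a).card *
        (a.descFactorial (E.filter fun e => cutCount U e = 1).card *
          (2 ^ (E.filter fun e => cutCount U e = 2).card * i.descFactorial (E.filter fun e => cutCount U e = 2).card) *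
          (2 ^ (E.card - (E.filter fun e => cutCount U e = 1).card - (E.filter fun e => cutCount U e = 2).card) *
            i'.descFactorial
              (E.card - (E.filter fun e => cutCount U e = 1).card - (E.filter fun e => cutCount U e = 2).card))) := by
  -- abbreviations
  set y := (E.filter fun e => cutCount U e = 1).card with hy
  set z := (E.filter fun e => cutCount U e = 2).card with hz
  set ee := E.card - y - z with hee
  have hyz : y + z ≤ E.card := by
    rw [hy, hz, ← card_union_of_disjoint (disjoint_filter.2 fun e _ h1 h2 => by omega)]
    exact card_le_card (union_subset (filter_subset _ _) (filter_subset _ _))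
  have hUW : (U ∩ W).card = y + 2 * z := card_inter_verts_eq hE
  have hWU : (W \ U).card = y + 2 * ee := by have := card_verts_sdiff_eq (U := U) hE; omega
  have hle1 : y + 2 * z ≤ U.card := by rw [← hUW]; exact card_le_card inter_subset_left
  have hle2 : y + 2 * ee ≤ (S \ U).card := by rw [← hWU]; exact card_le_card (sdiff_subset_sdiff hW Subset.rfl)
  -- sizes of the sub-configuration
  have hU' : (U ∩ (S \ W)).card = U.card - (y + 2 * z) := by
    have : U ∩ (S \ W) = U \ (U ∩ W) := by
      ext w; simp only [mem_inter, mem_sdiff]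
      constructor
      · rintro ⟨hwU, -, hwW⟩; exact ⟨hwU, fun h => hwW h.2⟩
      · rintro ⟨hwU, h⟩; exact ⟨hwU, hU hwU, fun hwW => h ⟨hwU, hwW⟩⟩
    rw [this, card_sdiff_of_subset inter_subset_left, hUW]
  have hS' : ((S \ W) \ (U ∩ (S \ W))).card = (S \ U).card - (y + 2 * ee) := by
    have h1 : (S \ W) \ (U ∩ (S \ W)) = (S \ U) \ (W \ U) := by
      ext w; simp only [mem_sdiff, mem_inter]
      constructor
      · rintro ⟨⟨hwS, hwW⟩, h⟩
        exact ⟨⟨hwS, fun hwU => h ⟨hwU, hwS, hwW⟩⟩, fun h' => hwW h'.1⟩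
      · rintro ⟨⟨hwS, hwU⟩, h⟩
        exact ⟨⟨hwS, fun hwW => h ⟨hwW, hwU⟩⟩, fun h' => hwU h'.1⟩
    have h2 : W \ U ⊆ S \ U := sdiff_subset_sdiff hW Subset.rfl
    rw [h1, card_sdiff_of_subset h2, hWU]
  have htot := card_pm_filter_cr_mul hU hUc hSc
  rw [card_pm_filter_superset hW hE a]
  by_cases hya : y ≤ a
  · by_cases hzi : z ≤ i
    · by_cases hei : ee ≤ i'
      · -- non-degenerate: the sub-configuration has parameters (a - y, i - z, i' - ee)
        have hfilt : ((perfectMatchings (S \ W)).filter fun M' =>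
              y + (M'.filter fun e => cutCount (U ∩ (S \ W)) e = 1).card = a) =
            (perfectMatchings (S \ W)).filter fun M' =>
              (M'.filter fun e => cutCount (U ∩ (S \ W)) e = 1).card = a - y :=
          filter_congr fun M' _ => by omega
        rw [hfilt]
        have hU'c : (U ∩ (S \ W)).card = (a - y) + 2 * (i - z) := by rw [hU', hUc]; omega
        have hS'c : ((S \ W) \ (U ∩ (S \ W))).card = (a - y) + 2 * (i' - ee) := by rw [hS', hSc]; omega
        have hfib := card_pm_filter_cr_mul (inter_subset_right (s₁ := U) (s₂ := S \ W)) hU'c hS'c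
        -- K(a,i,i') = K(a-y,i-z,i'-ee) · ([a]_y · 2^z [i]_z · 2^ee [i']_ee)
        have hKa := Nat.factorial_mul_descFactorial hya
        have hKi := Nat.factorial_mul_descFactorial hzi
        have hKi' := Nat.factorial_mul_descFactorial hei
        have hpi : 2 ^ i = 2 ^ (i - z) * 2 ^ z := by rw [← pow_add, Nat.sub_add_cancel hzi]
        have hpi' : 2 ^ i' = 2 ^ (i' - ee) * 2 ^ ee := by rw [← pow_add, Nat.sub_add_cancel hei]
        -- t! = (t - (y+2z))! [t]_{y+2z}
        have ht1 : y + 2 * z ≤ a + 2 * i := by omega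
        have ht2 : y + 2 * ee ≤ a + 2 * i' := by omega
        have hT := Nat.factorial_mul_descFactorial ht1
        have hT' := Nat.factorial_mul_descFactorial ht2
        have e1 : a + 2 * i - (y + 2 * z) = (a - y) + 2 * (i - z) := by omega
        have e2 : a + 2 * i' - (y + 2 * ee) = (a - y) + 2 * (i' - ee) := by omega
        rw [e1] at hT
        rw [e2] at hT'
        -- cancel the positive factor K' = (a-y)! 2^{i-z} (i-z)! 2^{i'-ee} (i'-ee)!
        have hK'pos : 0 < (a - y).factorial * (2 ^ (i - z) * (i - z).factorial) * (2 ^ (i' - ee) * (i' - ee).factorial) := by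
          positivity
        refine Nat.eq_of_mul_eq_mul_right hK'pos ?_
        calc ((perfectMatchings (S \ W)).filter fun M' =>
                (M'.filter fun e => cutCount (U ∩ (S \ W)) e = 1).card = a - y).card *
              ((a + 2 * i).descFactorial (y + 2 * z) * (a + 2 * i').descFactorial (y + 2 * ee)) *
              ((a - y).factorial * (2 ^ (i - z) * (i - z).factorial) * (2 ^ (i' - ee) * (i' - ee).factorial))
            = (((perfectMatchings (S \ W)).filter fun M' =>
                (M'.filter fun e => cutCount (U ∩ (S \ W)) e = 1).card = a - y).card *
                ((a - y).factorial * (2 ^ (i - z) * (i - z).factorial) * (2 ^ (i' - ee) * (i' - ee).factorial))) *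
              ((a + 2 * i).descFactorial (y + 2 * z) * (a + 2 * i').descFactorial (y + 2 * ee)) := by ring
          _ = ((a - y + 2 * (i - z)).factorial * (a + 2 * i).descFactorial (y + 2 * z)) *
              ((a - y + 2 * (i' - ee)).factorial * (a + 2 * i').descFactorial (y + 2 * ee)) := by rw [hfib]; ring
          _ = (a + 2 * i).factorial * (a + 2 * i').factorial := by rw [hT, hT']
          _ = ((perfectMatchings S).filter fun M => (M.filter fun e => cutCount U e = 1).card = a).card *
              (a.factorial * (2 ^ i * i.factorial) * (2 ^ i' * i'.factorial)) := htot.symm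
          _ = ((perfectMatchings S).filter fun M => (M.filter fun e => cutCount U e = 1).card = a).card *
              (((a - y).factorial * a.descFactorial y) * (2 ^ (i - z) * 2 ^ z * ((i - z).factorial * i.descFactorial z)) *
                (2 ^ (i' - ee) * 2 ^ ee * ((i' - ee).factorial * i'.descFactorial ee))) := by
              rw [hKa, hKi, hKi', ← hpi, ← hpi']
          _ = ((perfectMatchings S).filter fun M => (M.filter fun e => cutCount U e = 1).card = a).card *
              (a.descFactorial y * (2 ^ z * i.descFactorial z) * (2 ^ ee * i'.descFactorial ee)) *
              ((a - y).factorial * (2 ^ (i - z) * (i - z).factorial) * (2 ^ (i' - ee) * (i' - ee).factorial)) := by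
              ring
      · -- `ee > i'`: the complement side of the sub-configuration is too small; `[i']_ee = 0`
        have hlt : i' < ee := not_le.1 hei
        rw [Nat.descFactorial_eq_zero_iff_lt.2 hlt]
        simp only [mul_zero]
        rw [Nat.mul_eq_zero]; left
        rw [card_eq_zero]
        have hfilt : ((perfectMatchings (S \ W)).filter fun M' =>
              y + (M'.filter fun e => cutCount (U ∩ (S \ W)) e = 1).card = a) =
            (perfectMatchings (S \ W)).filter fun M' =>
              (M'.filter fun e => cutCount (U ∩ (S \ W)) e = 1).card = a - y :=
          filter_congr fun M' _ => by omega
        rw [hfilt]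
        exact pm_filter_cr_eq_empty inter_subset_right (fun h => by
          have h2 := h.2.1; rw [hS', hSc] at h2; omega)
    · -- `z > i`
      have hlt : i < z := not_le.1 hzi
      rw [Nat.descFactorial_eq_zero_iff_lt.2 hlt]
      simp only [mul_zero, zero_mul]
      rw [Nat.mul_eq_zero]; left
      rw [card_eq_zero]
      have hfilt : ((perfectMatchings (S \ W)).filter fun M' =>
            y + (M'.filter fun e => cutCount (U ∩ (S \ W)) e = 1).card = a) =
          (perfectMatchings (S \ W)).filter fun M' =>
            (M'.filter fun e => cutCount (U ∩ (S \ W)) e = 1).card = a - y :=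
        filter_congr fun M' _ => by omega
      rw [hfilt]
      exact pm_filter_cr_eq_empty inter_subset_right (fun h => by
        have h1 := h.1; rw [hU', hUc] at h1; omega)
  · -- `y > a`
    have hlt : a < y := not_le.1 hya
    rw [Nat.descFactorial_eq_zero_iff_lt.2 hlt]
    simp only [zero_mul, mul_zero]
    rw [Nat.mul_eq_zero]; left
    rw [card_eq_zero, filter_eq_empty_iff]
    intro M' _ h
    omega

end MatchingFiber


end Literature.Combinatorics.Optimization.ChebyshevTracialDesignJunta

/-! ## Section from `ChebyshevTracialDesignJuntaVirtualMoment.lean` -/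
/-!
# Junta virtual positivity, part G: the virtual value of a containment event is a knapsack moment

Support file for the crux `TracialDecayExp20` (stmt-PneNP-19878) of route `ChebyshevTracialDesign`
(cell pnp-psdrank; step towards the LOW-DEGREE sector of the virtual-positivity step, p1 ROUND-3 §2.14–2.15:
"the virtual level is Grigoriev's knapsack functional"). For a perfect matching `M` of `S` (`N` edges), a
vertex set `A₀ ⊆ S` meeting `x` edges of `M`, and cut sizes `t = c + 2i`: the number of cuts `U ⊆ S` with
`c` crossing and `i` internal edges and `A₀ ⊆ U` is `T(N; c, i) · P(c)` for an explicit real polynomial `P`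
of degree `≤ x` whose value at the virtual level `c = 0` is EXACTLY Grigoriev's knapsack pseudo-moment
`knapsackMoment N (t/2) x = ∏_{j<x} (t/2 - j)/(N - j)` (`subset_event_poly`). Ingredients: the explicit
pattern polynomial of part B with its value at `0` (`pattern_poly_explicit`), and the observation that among
the traces `B ⊇ A₀` on the window only the full window has no crossing window edge. No definitions.
-/


namespace Literature.Combinatorics.Optimization.ChebyshevTracialDesignJunta

open Finset Literature.Barriers.PneNP Literature.Combinatorics.SimpleGraph.CycleSpace
open Polynomial Literature.Computability.Complexity

variable {V : Type*} [DecidableEq V]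

/-- **Explicit pattern polynomial** `P = 2^{-y}[X]_y ∏_{j<z}((t-X)/2-j) ∏_{j<x-y-z}(N-(t+X)/2-j)/[N]_x`:
degree `≤ x`, value at `0` equal to `[y = 0]·∏_{j<z}(t/2-j)∏_{j<x-z}(N-t/2-j)/[N]_x`, and the level identity
`T(N-x; c-y, i-z) = T(N; c, i)·P(c)` for `c + 2i = t` (read as `0` when `y > c` or `z > i`). [folklore] -/
private theorem pattern_poly_explicit (N t : ℕ) {x y z : ℕ} (hx : x ≤ N) (hyz : y + z ≤ x) :
    (C (((2 : ℝ) ^ y * (N.descFactorial x : ℝ))⁻¹) * (∏ j ∈ range y, (X - C (j : ℝ))) *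
        (∏ j ∈ range z, (C ((t : ℝ) / 2 - j) - C (1 / 2) * X)) *
        ∏ j ∈ range (x - y - z), (C ((N : ℝ) - (t : ℝ) / 2 - j) - C (1 / 2) * X)).natDegree ≤ x ∧
    (C (((2 : ℝ) ^ y * (N.descFactorial x : ℝ))⁻¹) * (∏ j ∈ range y, (X - C (j : ℝ))) *
        (∏ j ∈ range z, (C ((t : ℝ) / 2 - j) - C (1 / 2) * X)) *
        ∏ j ∈ range (x - y - z), (C ((N : ℝ) - (t : ℝ) / 2 - j) - C (1 / 2) * X)).eval 0 =
      (if y = 0 then ((N.descFactorial x : ℝ))⁻¹ * (∏ j ∈ range z, ((t : ℝ) / 2 - j)) *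
        ∏ j ∈ range (x - z), ((N : ℝ) - (t : ℝ) / 2 - j) else 0) ∧
    ∀ c i : ℕ, c + 2 * i = t →
      (((if y ≤ c ∧ z ≤ i then
          (N - x).choose (c - y + (i - z)) * (c - y + (i - z)).choose (i - z) * 2 ^ (c - y) else 0 : ℕ)) : ℝ) =
        ((N.choose (c + i) * (c + i).choose i * 2 ^ c : ℕ) : ℝ) *
          (C (((2 : ℝ) ^ y * (N.descFactorial x : ℝ))⁻¹) * (∏ j ∈ range y, (X - C (j : ℝ))) *
            (∏ j ∈ range z, (C ((t : ℝ) / 2 - j) - C (1 / 2) * X)) *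
            ∏ j ∈ range (x - y - z), (C ((N : ℝ) - (t : ℝ) / 2 - j) - C (1 / 2) * X)).eval (c : ℝ) := by
  set κ : ℝ := ((2 : ℝ) ^ y * (N.descFactorial x : ℝ))⁻¹ with hκ
  have hNx : 0 < (N.descFactorial x : ℝ) := by
    have : N.descFactorial x ≠ 0 := fun h0 => by
      rw [Nat.descFactorial_eq_zero_iff_lt] at h0; omega
    positivity
  refine ⟨?_, ?_, ?_⟩
  · have h1 : (∏ j ∈ range y, (X - C (j : ℝ))).natDegree ≤ y := by
      refine (natDegree_prod_le _ _).trans ?_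
      refine (sum_le_sum fun (j : ℕ) _ => (natDegree_X_sub_C ((j : ℕ) : ℝ)).le).trans ?_
      simp
    have hlin : ∀ a : ℝ, (C a - C (1 / 2 : ℝ) * X).natDegree ≤ 1 := fun a =>
      (natDegree_sub_le _ _).trans (max_le (by simp) ((natDegree_C_mul_le _ _).trans natDegree_X_le))
    have h2 : (∏ j ∈ range z, (C ((t : ℝ) / 2 - j) - C (1 / 2) * X)).natDegree ≤ z := by
      refine (natDegree_prod_le _ _).trans ((sum_le_sum fun j _ => hlin _).trans ?_); simp
    have h3 : (∏ j ∈ range (x - y - z), (C ((N : ℝ) - (t : ℝ) / 2 - j) - C (1 / 2) * X)).natDegree ≤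
        x - y - z := by
      refine (natDegree_prod_le _ _).trans ((sum_le_sum fun j _ => hlin _).trans ?_); simp
    refine (natDegree_mul_le.trans (add_le_add (natDegree_mul_le.trans (add_le_add
      ((natDegree_C_mul_le _ _).trans h1) h2)) h3)).trans ?_
    omega
  · simp only [eval_mul, eval_C, eval_prod, eval_sub, eval_X, mul_zero, sub_zero]
    rcases Nat.eq_zero_or_pos y with hy0 | hy0
    · subst hy0
      simp only [range_zero, prod_empty, mul_one, Nat.sub_zero, if_true]
      rw [hκ, pow_zero, one_mul]
    · have : ∏ j ∈ range y, ((0 : ℝ) - (j : ℝ)) = 0 := prod_eq_zero (mem_range.2 hy0) (by simp)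
      rw [this, if_neg (by omega)]
      simp
  · intro c i hci
    have evC : ∀ r : ℝ, ((∏ j ∈ range z, (C ((t : ℝ) / 2 - j) - C (1 / 2) * X)).eval r) =
        ∏ j ∈ range z, (((t : ℝ) - r) / 2 - j) := fun r => by
      rw [eval_prod]; exact prod_congr rfl fun j _ => by simp; ring
    have evE : ∀ r : ℝ, ((∏ j ∈ range (x - y - z), (C ((N : ℝ) - (t : ℝ) / 2 - j) - C (1 / 2) * X)).eval r) =
        ∏ j ∈ range (x - y - z), ((N : ℝ) - ((t : ℝ) + r) / 2 - j) := fun r => by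
      rw [eval_prod]; exact prod_congr rfl fun j _ => by simp; ring
    have evY : ∀ r : ℝ, ((∏ j ∈ range y, (X - C (j : ℝ))).eval r) = ∏ j ∈ range y, (r - j) := fun r => by
      rw [eval_prod]; exact prod_congr rfl fun j _ => by simp
    rw [eval_mul, eval_mul, eval_mul, eval_C, evY, evC, evE]
    have hti : ((t : ℝ) - c) / 2 = i := by
      have : (t : ℝ) = c + 2 * i := by exact_mod_cast hci.symm
      rw [this]; ring
    have htc : ((t : ℝ) + c) / 2 = (c : ℝ) + i := by
      have : (t : ℝ) = c + 2 * i := by exact_mod_cast hci.symm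
      rw [this]; ring
    rw [hti, htc]
    by_cases hyc : y ≤ c
    · by_cases hzi : z ≤ i
      · rw [if_pos ⟨hyc, hzi⟩]
        by_cases hciN : c + i ≤ N
        · by_cases he : x - y - z ≤ N - c - i
          · have key := T_ratio_nat hx hyz hyc hzi hciN he
            have keyR : (((N - x).choose (c - y + (i - z)) * (c - y + (i - z)).choose (i - z) * 2 ^ (c - y) : ℕ) : ℝ) *
                ((2 : ℝ) ^ y * (N.descFactorial x : ℝ)) =
                ((N.choose (c + i) * (c + i).choose i * 2 ^ c : ℕ) : ℝ) *
                  ((c.descFactorial y : ℝ) * (i.descFactorial z : ℝ) * ((N - c - i).descFactorial (x - y - z) : ℝ)) := by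
              exact_mod_cast key
            have h2y : (0 : ℝ) < (2 : ℝ) ^ y * (N.descFactorial x : ℝ) := by positivity
            have keyR' := (eq_div_iff h2y.ne').2 keyR
            rw [keyR', cast_descFactorial_eq_prod hyc, cast_descFactorial_eq_prod hzi,
              cast_descFactorial_eq_prod he, hκ]
            have : ((N - c - i : ℕ) : ℝ) = (N : ℝ) - ((c : ℝ) + i) := by
              rw [Nat.sub_sub, Nat.cast_sub hciN, Nat.cast_add]
            rw [this]
            field_simp
          · have he' := not_le.1 he
            have hL : N - x < c - y + (i - z) := by omega
            rw [Nat.choose_eq_zero_of_lt hL]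
            have hmem : N - c - i ∈ range (x - y - z) := mem_range.2 he'
            have h0 : ∏ j ∈ range (x - y - z), ((N : ℝ) - ((c : ℝ) + i) - j) = 0 := by
              refine prod_eq_zero hmem ?_
              have : ((N - c - i : ℕ) : ℝ) = (N : ℝ) - ((c : ℝ) + i) := by
                rw [Nat.sub_sub, Nat.cast_sub hciN, Nat.cast_add]
              rw [← this]; ring
            rw [h0]; simp
        · have hciN' := not_le.1 hciN
          have hL : N - x < c - y + (i - z) := by omega
          rw [Nat.choose_eq_zero_of_lt hL, Nat.choose_eq_zero_of_lt hciN']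
          simp
      · rw [if_neg (fun h => hzi h.2)]
        have h0 : ∏ j ∈ range z, ((i : ℝ) - j) = 0 := prod_eq_zero (mem_range.2 (not_le.1 hzi)) (by simp)
        rw [h0]; simp
    · rw [if_neg (fun h => hyc h.1)]
      have h0 : ∏ j ∈ range y, ((c : ℝ) - j) = 0 := prod_eq_zero (mem_range.2 (not_le.1 hyc)) (by simp)
      rw [h0]; simp


/-- In a non-loop pair containing `a ∈ B` and `v ∉ B`, exactly one endpoint lies in `B`. [folklore] -/
private theorem cutCount_eq_one_of_mem_of_not_mem {B : Finset V} {e : Sym2 V} {a v : V} (ha : a ∈ e) (hv : v ∈ e)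
    (haB : a ∈ B) (hvB : v ∉ B) : cutCount B e = 1 := by
  have hav : a ≠ v := fun h => hvB (h ▸ haB)
  induction e using Sym2.ind with
  | h p q =>
    rw [cutCount_mk]
    rcases Sym2.mem_iff.1 ha with rfl | rfl <;> rcases Sym2.mem_iff.1 hv with rfl | rfl
    · exact absurd rfl hav
    · simp [haB, hvB]
    · simp [haB, hvB]
    · exact absurd rfl hav

/-- **Containment events have knapsack-moment virtual value** (cell pnp-psdrank, ROUND-3 §2.14: "the virtual
level is Grigoriev's knapsack functional"): for a perfect matching `M` of `S` with `N` edges, `A₀ ⊆ S`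
meeting `x` edges of `M`, and `t`, there is a real polynomial `P` of degree `≤ x` with
`P(0) = knapsackMoment N (t/2) x = ∏_{j<x}(t/2-j)/(N-j)` such that for all levels `c + 2i = t`,
`#{U ⊆ S : c crossing, i internal, A₀ ⊆ U} = T(N; c, i)·P(c)`. [cite: Grigoriev2001, §1 (PDF p. 8)] -/
theorem subset_event_poly {S : Finset V} {M : Finset (Sym2 V)} (hM : IsPMOn S M) {A₀ : Finset V}
    (hA₀ : A₀ ⊆ S) (t : ℕ) :
    ∃ P : Polynomial ℝ, P.natDegree ≤ (M.filter fun e => ∃ a ∈ A₀, a ∈ e).card ∧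
      P.eval 0 = knapsackMoment M.card ((t : ℝ) / 2) (M.filter fun e => ∃ a ∈ A₀, a ∈ e).card ∧
      ∀ c i : ℕ, c + 2 * i = t →
        (((S.powerset.filter fun U => (M.filter fun e => cutCount U e = 1).card = c ∧
            (M.filter fun e => cutCount U e = 2).card = i ∧ A₀ ⊆ U).card : ℕ) : ℝ) =
          ((M.card.choose (c + i) * (c + i).choose i * 2 ^ c : ℕ) : ℝ) * P.eval (c : ℝ) := by
  classical
  set E := M.filter (fun e => ∃ a ∈ A₀, a ∈ e) with hE
  set W := S.filter (fun v => ∃ e ∈ E, v ∈ e) with hW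
  have hEM : E ⊆ M := filter_subset _ _
  have hxN : E.card ≤ M.card := card_le_card hEM
  have hWE : IsPMOn W E := isPMOn_verts hM hEM
  have hA₀W : A₀ ⊆ W := by
    intro a ha
    obtain ⟨e, he, hae⟩ := hM.exists_mem (hA₀ ha)
    exact mem_filter.2 ⟨hA₀ ha, e, mem_filter.2 ⟨he, a, ha, hae⟩, hae⟩
  -- abbreviations for the traces
  have hyz : ∀ B : Finset V, (E.filter fun e => cutCount B e = 1).card +
      (E.filter fun e => cutCount B e = 2).card ≤ E.card := by
    intro B
    rw [← card_union_of_disjoint (disjoint_filter.2 fun e _ h1 h2 => by omega)]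
    exact card_le_card (union_subset (filter_subset _ _) (filter_subset _ _))
  -- the polynomial: sum of the explicit pattern polynomials over the traces containing `A₀`
  refine ⟨∑ B ∈ W.powerset.filter (fun B => A₀ ⊆ B),
      C (((2 : ℝ) ^ (E.filter fun e => cutCount B e = 1).card * (M.card.descFactorial E.card : ℝ))⁻¹) *
        (∏ j ∈ range (E.filter fun e => cutCount B e = 1).card, (X - C (j : ℝ))) *
        (∏ j ∈ range (E.filter fun e => cutCount B e = 2).card, (C ((t : ℝ) / 2 - j) - C (1 / 2) * X)) *
        ∏ j ∈ range (E.card - (E.filter fun e => cutCount B e = 1).card - (E.filter fun e => cutCount B e = 2).card),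
          (C ((M.card : ℝ) - (t : ℝ) / 2 - j) - C (1 / 2) * X), ?_, ?_, ?_⟩
  · exact natDegree_sum_le_of_forall_le _ _ fun B _ => (pattern_poly_explicit M.card t hxN (hyz B)).1
  · -- value at the virtual level: only the full window `B = W` contributes
    rw [eval_finsetSum]
    have hWmem : W ∈ W.powerset.filter (fun B => A₀ ⊆ B) := mem_filter.2 ⟨mem_powerset.2 Subset.rfl, hA₀W⟩
    rw [sum_eq_single_of_mem W hWmem]
    · -- the term `B = W`: no crossing window edge, all `x` window edges internal
      have hin : ∀ e ∈ E, cutCount W e = 2 := fun e he => by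
        induction e using Sym2.ind with
        | h p q =>
          have hpq := mem_sym2_iff.1 (hWE.1 he)
          rw [cutCount_mk, if_pos (hpq p (Sym2.mem_mk_left p q)), if_pos (hpq q (Sym2.mem_mk_right p q))]
      have hy0 : (E.filter fun e => cutCount W e = 1).card = 0 := by
        rw [card_eq_zero, filter_eq_empty_iff]
        intro e he h1; rw [hin e he] at h1; exact absurd h1 (by decide)
      have hz : (E.filter fun e => cutCount W e = 2).card = E.card := by
        rw [filter_true_of_mem hin]
      rw [(pattern_poly_explicit M.card t hxN (hyz W)).2.1, if_pos hy0, hz, Nat.sub_self, range_zero,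
        prod_empty, mul_one, knapsackMoment, prod_div_distrib, ← cast_descFactorial_eq_prod hxN]
      exact (div_eq_inv_mul _ _).symm
    · intro B hB hBW
      obtain ⟨hBW', hA₀B⟩ := mem_filter.1 hB
      rw [mem_powerset] at hBW'
      rw [(pattern_poly_explicit M.card t hxN (hyz B)).2.1, if_neg]
      -- a vertex of `W` outside `B` lies on a window edge crossing `B`
      obtain ⟨v, hvW, hvB⟩ := exists_of_ssubset (lt_of_le_of_ne hBW' hBW)
      obtain ⟨-, e, he, hve⟩ := mem_filter.1 hvW
      obtain ⟨-, a, haA, hae⟩ := mem_filter.1 he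
      have h1 : cutCount B e = 1 := cutCount_eq_one_of_mem_of_not_mem hae hve (hA₀B haA) hvB
      have : e ∈ E.filter fun e => cutCount B e = 1 := mem_filter.2 ⟨he, h1⟩
      exact fun h0 => notMem_empty e (card_eq_zero.1 h0 ▸ this)
  · intro c i hci
    -- fibrewise over the trace on `W`
    have hfib : ((S.powerset.filter fun U => (M.filter fun e => cutCount U e = 1).card = c ∧
          (M.filter fun e => cutCount U e = 2).card = i ∧ A₀ ⊆ U).card : ℕ) =
        ∑ B ∈ W.powerset.filter (fun B => A₀ ⊆ B), (S.powerset.filter fun U =>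
          (M.filter fun e => cutCount U e = 1).card = c ∧ (M.filter fun e => cutCount U e = 2).card = i ∧
            U ∩ W = B).card := by
      rw [card_eq_sum_card_fiberwise (f := fun U => U ∩ W) (t := W.powerset.filter fun B => A₀ ⊆ B)]
      · refine sum_congr rfl fun B hB => ?_
        obtain ⟨-, hA₀B⟩ := mem_filter.1 hB
        rw [filter_filter]
        congr 1
        refine filter_congr fun U _ => ?_
        constructor
        · rintro ⟨⟨hc, hi, -⟩, hUW⟩; exact ⟨hc, hi, hUW⟩
        · rintro ⟨hc, hi, hUW⟩; exact ⟨⟨hc, hi, fun a ha => (mem_inter.1 (hUW.symm ▸ hA₀B ha)).1⟩, hUW⟩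
      · intro U hU
        obtain ⟨-, -, -, hA₀U⟩ := mem_filter.1 hU
        exact mem_filter.2 ⟨mem_powerset.2 inter_subset_right, fun a ha => mem_inter.2 ⟨hA₀U ha, hA₀W ha⟩⟩
    rw [hfib, Nat.cast_sum, eval_finsetSum, mul_sum]
    refine sum_congr rfl fun B hB => ?_
    obtain ⟨hBW, -⟩ := mem_filter.1 hB
    rw [card_fiber_eq hM hEM (mem_powerset.1 hBW) c i]
    exact (pattern_poly_explicit M.card t hxN (hyz B)).2.2 c i hci

end Literature.Combinatorics.Optimization.ChebyshevTracialDesignJunta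

/-! ## Section from `ChebyshevTracialDesignJuntaMatchingLaw.lean` -/
/-!
# Junta virtual positivity, part E₂: matching-side pattern polynomial and junta sum law

Support file for the crux `TracialDecayExp20` (stmt-PneNP-19878) of route `ChebyshevTracialDesign`
(cell pnp-psdrank, local virtual positivity (N1), MATCHING-SIDE twin; builds on parts A, B, D, E₁).

* `pattern_poly_exists_pm`: `[a]_y · 2^z[i]_z · 2^e[i']_e / ([t]_{y+2z}[s]_{y+2e}) = P(a)` along
  `a + 2i = t`, `a + 2i' = s`, for the real polynomial `P = [X]_y ∏_{j<z}(t-2j-X) ∏_{j<e}(s-2j-X)/([t]_{y+2z}[s]_{y+2e})`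
  of degree `≤ x = y+z+e` with `P(0) ≥ 0`.
* `junta_sum_law_pm`: for a function `G` of perfect matchings of `S` depending only on the window edges
  `M[A]` (nonnegative values), the level sums `Σ_{M : #cr(U,M) = a} G(M)` equal `#{M : #cr = a} · P(a)`
  for one polynomial `P` of degree `≤ |A|` with `P(0) ≥ 0`.

No definitions; notation as in parts A/D.
-/


namespace Literature.Combinatorics.Optimization.ChebyshevTracialDesignJunta

open Finset Literature.Barriers.PneNP Literature.Combinatorics.SimpleGraph.CycleSpace

variable {V : Type*} [DecidableEq V]

section MatchingLaw

open Polynomial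

/-- **Matching-side pattern polynomial**: for `x = y + z + e` window edges (`y` crossing, `z` inside the cut of
size `t`, `e` inside the complement of size `s`; `y + 2z ≤ t`, `y + 2e ≤ s`) there
is a real polynomial `P` of degree `≤ x` with `P(0) ≥ 0` and
`P(a)·[t]_{y+2z}·[s]_{y+2e} = [a]_y · 2^z[i]_z · 2^e[i']_e` whenever `a + 2i = t`, `a + 2i' = s`. Explicitly
`P = [X]_y ∏_{j<z}(t - 2j - X) ∏_{j<e}(s - 2j - X) / ([t]_{y+2z}[s]_{y+2e})`. [folklore] -/
private theorem pattern_poly_exists_pm (t s : ℕ) {x y z ee : ℕ} (hx : y + z + ee = x) (h1 : y + 2 * z ≤ t)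
    (h2 : y + 2 * ee ≤ s) :
    ∃ P : Polynomial ℝ, P.natDegree ≤ x ∧ 0 ≤ P.eval 0 ∧
      ∀ a i i' : ℕ, a + 2 * i = t → a + 2 * i' = s →
        P.eval (a : ℝ) * (((t.descFactorial (y + 2 * z) : ℕ) : ℝ) * ((s.descFactorial (y + 2 * ee) : ℕ) : ℝ)) =
          ((a.descFactorial y * (2 ^ z * i.descFactorial z) * (2 ^ ee * i'.descFactorial ee) : ℕ) : ℝ) := by
  have hD1 : 0 < (t.descFactorial (y + 2 * z) : ℝ) := by
    have : t.descFactorial (y + 2 * z) ≠ 0 := fun h0 => by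
      rw [Nat.descFactorial_eq_zero_iff_lt] at h0; omega
    positivity
  have hD2 : 0 < (s.descFactorial (y + 2 * ee) : ℝ) := by
    have : s.descFactorial (y + 2 * ee) ≠ 0 := fun h0 => by
      rw [Nat.descFactorial_eq_zero_iff_lt] at h0; omega
    positivity
  set κ : ℝ := ((t.descFactorial (y + 2 * z) : ℝ) * (s.descFactorial (y + 2 * ee) : ℝ))⁻¹ with hκ
  have hκ0 : 0 ≤ κ := by rw [hκ]; positivity
  have hlin : ∀ c : ℝ, (C c - X : Polynomial ℝ).natDegree ≤ 1 := fun c =>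
    (natDegree_sub_le _ _).trans (max_le (by simp) natDegree_X_le)
  refine ⟨C κ * (∏ j ∈ range y, (X - C (j : ℝ))) * (∏ j ∈ range z, (C ((t : ℝ) - 2 * j) - X)) *
      ∏ j ∈ range ee, (C ((s : ℝ) - 2 * j) - X), ?_, ?_, ?_⟩
  · have hy : (∏ j ∈ range y, (X - C (j : ℝ))).natDegree ≤ y := by
      refine (natDegree_prod_le _ _).trans ?_
      refine (sum_le_sum fun (j : ℕ) _ => (natDegree_X_sub_C ((j : ℕ) : ℝ)).le).trans ?_
      simp
    have hz : (∏ j ∈ range z, (C ((t : ℝ) - 2 * j) - X)).natDegree ≤ z := by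
      refine (natDegree_prod_le _ _).trans ((sum_le_sum fun j _ => hlin _).trans ?_); simp
    have he : (∏ j ∈ range ee, (C ((s : ℝ) - 2 * j) - X)).natDegree ≤ ee := by
      refine (natDegree_prod_le _ _).trans ((sum_le_sum fun j _ => hlin _).trans ?_); simp
    refine (natDegree_mul_le.trans (add_le_add (natDegree_mul_le.trans (add_le_add
      ((natDegree_C_mul_le _ _).trans hy) hz)) he)).trans ?_
    omega
  · simp only [eval_mul, eval_C, eval_prod, eval_sub, eval_X, sub_zero]
    rcases Nat.eq_zero_or_pos y with hy0 | hy0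
    · subst hy0
      simp only [range_zero, prod_empty, mul_one]
      refine mul_nonneg (mul_nonneg hκ0 (prod_nonneg fun j hj => ?_)) (prod_nonneg fun j hj => ?_)
      · have := mem_range.1 hj
        have : (2 : ℝ) * j ≤ t := by exact_mod_cast (by omega : 2 * j ≤ t)
        linarith
      · have := mem_range.1 hj
        have : (2 : ℝ) * j ≤ s := by exact_mod_cast (by omega : 2 * j ≤ s)
        linarith
    · have : ∏ j ∈ range y, ((0 : ℝ) - (j : ℝ)) = 0 := prod_eq_zero (mem_range.2 hy0) (by simp)
      rw [this]; simp
  · intro a i i' hai hai'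
    have evY : ((∏ j ∈ range y, (X - C (j : ℝ))).eval (a : ℝ)) = ∏ j ∈ range y, ((a : ℝ) - j) := by
      rw [eval_prod]; exact prod_congr rfl fun j _ => by simp
    have evZ : ((∏ j ∈ range z, (C ((t : ℝ) - 2 * j) - X)).eval (a : ℝ)) = 2 ^ z * ∏ j ∈ range z, ((i : ℝ) - j) := by
      rw [eval_prod]
      have ht' : (t : ℝ) = a + 2 * i := by exact_mod_cast hai.symm
      rw [show (2 : ℝ) ^ z = ∏ _j ∈ range z, (2 : ℝ) by simp, ← prod_mul_distrib]
      exact prod_congr rfl fun j _ => by simp [ht']; ring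
    have evE : ((∏ j ∈ range ee, (C ((s : ℝ) - 2 * j) - X)).eval (a : ℝ)) =
        2 ^ ee * ∏ j ∈ range ee, ((i' : ℝ) - j) := by
      rw [eval_prod]
      have hs' : (s : ℝ) = a + 2 * i' := by exact_mod_cast hai'.symm
      rw [show (2 : ℝ) ^ ee = ∏ _j ∈ range ee, (2 : ℝ) by simp, ← prod_mul_distrib]
      exact prod_congr rfl fun j _ => by simp [hs']; ring
    rw [eval_mul, eval_mul, eval_mul, eval_C, evY, evZ, evE, hκ]
    -- the three descending factorials on the right, as real products (or zero)
    have hA : ((a.descFactorial y : ℕ) : ℝ) = ∏ j ∈ range y, ((a : ℝ) - j) := by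
      by_cases hya : y ≤ a
      · exact cast_descFactorial_eq_prod hya
      · rw [Nat.descFactorial_eq_zero_iff_lt.2 (not_le.1 hya), Nat.cast_zero]
        exact (prod_eq_zero (mem_range.2 (not_le.1 hya)) (by simp)).symm
    have hB : ((i.descFactorial z : ℕ) : ℝ) = ∏ j ∈ range z, ((i : ℝ) - j) := by
      by_cases hzi : z ≤ i
      · exact cast_descFactorial_eq_prod hzi
      · rw [Nat.descFactorial_eq_zero_iff_lt.2 (not_le.1 hzi), Nat.cast_zero]
        exact (prod_eq_zero (mem_range.2 (not_le.1 hzi)) (by simp)).symm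
    have hC : ((i'.descFactorial ee : ℕ) : ℝ) = ∏ j ∈ range ee, ((i' : ℝ) - j) := by
      by_cases hei : ee ≤ i'
      · exact cast_descFactorial_eq_prod hei
      · rw [Nat.descFactorial_eq_zero_iff_lt.2 (not_le.1 hei), Nat.cast_zero]
        exact (prod_eq_zero (mem_range.2 (not_le.1 hei)) (by simp)).symm
    push_cast
    rw [hA, hB, hC]
    field_simp

/-- There are at most `|A|` window edges in a matching: each contains a point of `A`, and two edges of a
matching sharing a point coincide. [folklore] -/
private theorem card_filter_meets_le {S : Finset V} {M : Finset (Sym2 V)} (hM : IsPMOn S M) (A : Finset V) :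
    (M.filter fun e => ∃ a ∈ A, a ∈ e).card ≤ A.card := by
  classical
  let f : V → Sym2 V := fun a => if h : ∃ e ∈ M, a ∈ e then h.choose else s(a, a)
  refine card_le_card_of_surjOn f fun e he => ?_
  rw [mem_coe, mem_filter] at he
  obtain ⟨heM, a, haA, hae⟩ := he
  refine ⟨a, mem_coe.2 haA, ?_⟩
  have h : ∃ e ∈ M, a ∈ e := ⟨e, heM, hae⟩
  show (if h : ∃ e ∈ M, a ∈ e then h.choose else s(a, a)) = e
  rw [dif_pos h]
  exact hM.unique h.choose_spec.1 heM h.choose_spec.2 hae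

/-- **Junta sum law, matching side** (cell (N1) Lemma 2, twin): for a cut `U ⊆ S` (`|U| = t`, `|S \ U| = s`),
a window `A ⊆ S` and a function `G` of perfect matchings of `S` depending only on
the window edges `M[A] = {e ∈ M : e meets A}` with nonnegative values `Λ`, the level sums
`Σ_{M : #cr(U,M) = a} G(M)` equal `#{M : #cr(U,M) = a} · P(a)` along `a + 2i = t`, `a + 2i' = s`, for one real
polynomial `P` of degree `≤ |A|` with `P(0) ≥ 0`. [folklore] -/
private theorem junta_sum_law_pm {S U : Finset V} (hU : U ⊆ S) {t s : ℕ} (hUc : U.card = t) (hSc : (S \ U).card = s)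
    (A : Finset V) (hA : A ⊆ S) (G Λ : Finset (Sym2 V) → ℝ)
    (hG : ∀ M ∈ perfectMatchings S, G M = Λ (M.filter fun e => ∃ a ∈ A, a ∈ e)) (hΛ : ∀ E, 0 ≤ Λ E) :
    ∃ P : Polynomial ℝ, P.natDegree ≤ A.card ∧ 0 ≤ P.eval 0 ∧ ∀ a i i' : ℕ, a + 2 * i = t → a + 2 * i' = s →
      ∑ M ∈ (perfectMatchings S).filter (fun M => (M.filter fun e => cutCount U e = 1).card = a), G M =
        ((((perfectMatchings S).filter fun M => (M.filter fun e => cutCount U e = 1).card = a).card : ℕ) : ℝ) *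
          P.eval (a : ℝ) := by
  classical
  set T := (perfectMatchings S).image (fun M => M.filter fun e => ∃ a ∈ A, a ∈ e) with hT
  -- the pattern polynomial of each window edge set in the image
  have hP : ∀ E : Finset (Sym2 V), ∃ P : Polynomial ℝ, P.natDegree ≤ A.card ∧ 0 ≤ P.eval 0 ∧
      (E ∈ T → ∀ a i i' : ℕ, a + 2 * i = t → a + 2 * i' = s →
        ((((perfectMatchings S).filter fun M =>
            E ⊆ M ∧ (M.filter fun e => cutCount U e = 1).card = a).card : ℕ) : ℝ) =
          ((((perfectMatchings S).filter fun M => (M.filter fun e => cutCount U e = 1).card = a).card : ℕ) : ℝ) *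
            P.eval (a : ℝ)) := by
    intro E
    by_cases hET : E ∈ T
    · obtain ⟨M₀, hM₀, rfl⟩ := mem_image.1 hET
      rw [mem_perfectMatchings] at hM₀
      set E := M₀.filter (fun e => ∃ a ∈ A, a ∈ e) with hE
      have hEM : E ⊆ M₀ := filter_subset _ _
      have hWE : IsPMOn (S.filter fun v => ∃ e ∈ E, v ∈ e) E := isPMOn_verts hM₀ hEM
      set W := S.filter (fun v => ∃ e ∈ E, v ∈ e) with hW
      have hWS : W ⊆ S := filter_subset _ _
      have hxA : E.card ≤ A.card := card_filter_meets_le hM₀ A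
      set y := (E.filter fun e => cutCount U e = 1).card with hy
      set z := (E.filter fun e => cutCount U e = 2).card with hz
      have hyz : y + z ≤ E.card := by
        rw [hy, hz, ← card_union_of_disjoint (disjoint_filter.2 fun e _ h1 h2 => by omega)]
        exact card_le_card (union_subset (filter_subset _ _) (filter_subset _ _))
      have hUW : (U ∩ W).card = y + 2 * z := card_inter_verts_eq hWE
      have hWU := card_verts_sdiff_eq (U := U) hWE
      have hle1 : y + 2 * z ≤ t := by rw [← hUW, ← hUc]; exact card_le_card inter_subset_left
      have hle2 : y + 2 * (E.card - y - z) ≤ s := by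
        have : (W \ U).card ≤ (S \ U).card := card_le_card (sdiff_subset_sdiff hWS Subset.rfl)
        rw [hSc] at this; omega
      obtain ⟨P, hPdeg, hP0, hPval⟩ := pattern_poly_exists_pm t s (x := E.card) (y := y) (z := z)
        (ee := E.card - y - z) (by omega) hle1 hle2
      refine ⟨P, hPdeg.trans hxA, hP0, fun _ a i i' hai hai' => ?_⟩
      have hUc' : U.card = a + 2 * i := by rw [hUc, hai]
      have hSc' : (S \ U).card = a + 2 * i' := by rw [hSc, hai']
      have hnat := card_pm_fiber_ratio_nat hU hWS hWE hUc' hSc'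
      have hreal := hPval a i i' hai hai'
      have hD : (0 : ℝ) < ((t.descFactorial (y + 2 * z) : ℕ) : ℝ) * ((s.descFactorial (y + 2 * (E.card - y - z)) : ℕ) : ℝ) := by
        have h1 : t.descFactorial (y + 2 * z) ≠ 0 := fun h0 => by
          rw [Nat.descFactorial_eq_zero_iff_lt] at h0; omega
        have h2 : s.descFactorial (y + 2 * (E.card - y - z)) ≠ 0 := fun h0 => by
          rw [Nat.descFactorial_eq_zero_iff_lt] at h0; omega
        positivity
      have hnatR := congrArg (fun m : ℕ => (m : ℝ)) hnat
      simp only [Nat.cast_mul] at hnatR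
      rw [hai, hai'] at hnatR
      rw [hy, hz] at hreal hD
      -- fiber · D = total · Nnum and P(a) · D = Nnum
      refine mul_right_cancel₀ hD.ne' ?_
      rw [hnatR]
      push_cast at hreal ⊢
      rw [← hreal]
      ring
    · exact ⟨0, by simp, by simp, fun h => absurd h hET⟩
  choose P hPdeg hP0 hPval using hP
  refine ⟨∑ E ∈ T, C (Λ E) * P E, ?_, ?_, ?_⟩
  · exact natDegree_sum_le_of_forall_le _ _ fun E _ => (natDegree_C_mul_le _ _).trans (hPdeg E)
  · rw [eval_finsetSum]
    exact sum_nonneg fun E _ => by rw [eval_mul, eval_C]; exact mul_nonneg (hΛ E) (hP0 E)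
  · intro a i i' hai hai'
    have hmaps : ∀ M ∈ (perfectMatchings S).filter (fun M => (M.filter fun e => cutCount U e = 1).card = a),
        (M.filter fun e => ∃ a ∈ A, a ∈ e) ∈ T :=
      fun M hM => mem_image_of_mem _ (mem_filter.1 hM).1
    rw [← sum_fiberwise_of_maps_to hmaps, eval_finsetSum, mul_sum]
    refine sum_congr rfl fun E hE => ?_
    -- on the fibre `M[A] = E`, `G = Λ E`, and the fibre is `{M ⊇ E}`
    obtain ⟨M₀, hM₀, hM₀E⟩ := mem_image.1 hE
    rw [mem_perfectMatchings] at hM₀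
    have hkey : ∀ M : Finset (Sym2 V), IsPMOn S M →
        ((M.filter fun e => ∃ a ∈ A, a ∈ e) = E ↔ E ⊆ M) := by
      intro M hM
      constructor
      · intro h; rw [← h]; exact filter_subset _ _
      · intro hEM
        ext e
        simp only [mem_filter]
        constructor
        · rintro ⟨heM, a, haA, hae⟩
          -- `a` lies on an edge of `E`
          obtain ⟨e₀, he₀, hae₀⟩ := hM₀.exists_mem (hA haA)
          have he₀E : e₀ ∈ E := by rw [← hM₀E]; exact mem_filter.2 ⟨he₀, a, haA, hae₀⟩
          have : e = e₀ := hM.unique heM (hEM he₀E) hae hae₀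
          rw [this]; exact he₀E
        · intro heE
          refine ⟨hEM heE, ?_⟩
          have := heE; rw [← hM₀E] at this; exact (mem_filter.1 this).2
    have hconst : ∀ M ∈ ((perfectMatchings S).filter fun M => (M.filter fun e => cutCount U e = 1).card = a).filter
        (fun M => (M.filter fun e => ∃ a ∈ A, a ∈ e) = E), G M = Λ E := by
      intro M hM
      simp only [mem_filter] at hM
      rw [hG M hM.1.1, hM.2]
    rw [sum_congr rfl hconst, sum_const, nsmul_eq_mul, filter_filter]
    have hset : ((perfectMatchings S).filter fun M =>
          (M.filter fun e => cutCount U e = 1).card = a ∧ (M.filter fun e => ∃ a ∈ A, a ∈ e) = E) =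
        (perfectMatchings S).filter fun M => E ⊆ M ∧ (M.filter fun e => cutCount U e = 1).card = a := by
      refine filter_congr fun M hM => ?_
      rw [mem_perfectMatchings] at hM
      rw [hkey M hM]; exact and_comm
    rw [hset, hPval E hE a i i' hai hai', eval_mul, eval_C]
    ring

end MatchingLaw

end Literature.Combinatorics.Optimization.ChebyshevTracialDesignJunta

/-! ## Section from `ChebyshevTracialDesignJuntaVirtualForm.lean` -/
/-!
# Junta virtual positivity, part H: the virtual quadratic form is Grigoriev's knapsack form

Support file for the crux `TracialDecayExp20` (stmt-PneNP-19878) of route `ChebyshevTracialDesign`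
(cell pnp-psdrank, low-degree sector of the virtual-positivity step, p1 ROUND-3 §2.14: "the virtual level is
Grigoriev's knapsack functional"). For a perfect matching `M` of `K_n` with `N = n/2` edges:

* `virtualForm_eq_knapsackForm` / `virtualForm_nonneg`: for coefficients `γ` on vertex sets `A'` with
  `|A'| ≤ k`, the quadratic form `Σ_{A',A''} γ(A') γ(A'') · knapsackMoment N r |M[A' ∪ A'']|` is Grigoriev's
  `knapsackForm N r h` for the push-forward `h` of `γ` along `A' ↦ M[A']` (edge sets indexed by `Fin N`),
  hence `≥ 0` under `Literature.Computability.Complexity.Grigoriev2001_knapsackFormNonneg` in the range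
  `2k ≤ N`, `k - 1 < r < N - k + 1` (named fact = Grigoriev 2001 Lemma 1.4, used as a HYPOTHESIS);
* `containment_comb_poly`: linear combinations of containment events `Σ_s β_s 1[D_s ⊆ U]` have level sums
  `T(N; c, i)·P(c)` with `deg P ≤ d` (`|M[D_s]| ≤ d`) and `P(0) = Σ_s β_s · knapsackMoment N (t/2) |M[D_s]|`
  (part G).

No definitions.
-/


namespace Literature.Combinatorics.Optimization.ChebyshevTracialDesignJunta

open Finset Literature.Barriers.PneNP Literature.Combinatorics.SimpleGraph.CycleSpace
open Polynomial Literature.Computability.Complexity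

variable {n : ℕ}

/-! ### Transport of edge sets of `M` to `Fin N` -/

/-- The index set in `Fin |M|` of a sub-edge-set `E ⊆ M` has `|E|` elements. [folklore] -/
private theorem card_filter_equivFin_symm_mem (M : Finset (Sym2 (Fin n))) {E : Finset (Sym2 (Fin n))} (hE : E ⊆ M) :
    ((univ : Finset (Fin M.card)).filter fun x => ((M.equivFin.symm x) : Sym2 (Fin n)) ∈ E).card = E.card := by
  refine card_bij' (fun x _ => ((M.equivFin.symm x) : Sym2 (Fin n))) (fun e he => M.equivFin ⟨e, hE he⟩)
    ?_ ?_ ?_ ?_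
  · intro x hx; exact (mem_filter.1 hx).2
  · intro e he
    refine mem_filter.2 ⟨mem_univ _, ?_⟩
    simp [he]
  · intro x _; simp
  · intro e _; simp

/-- Index sets of unions are unions of index sets. [folklore] -/
private theorem filter_equivFin_symm_mem_union (M : Finset (Sym2 (Fin n))) (E E' : Finset (Sym2 (Fin n))) :
    ((univ : Finset (Fin M.card)).filter fun x => ((M.equivFin.symm x) : Sym2 (Fin n)) ∈ E ∪ E') =
      ((univ : Finset (Fin M.card)).filter fun x => ((M.equivFin.symm x) : Sym2 (Fin n)) ∈ E) ∪
        (univ : Finset (Fin M.card)).filter fun x => ((M.equivFin.symm x) : Sym2 (Fin n)) ∈ E' := by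
  ext x; simp [mem_filter, mem_union]

/-- Window edge sets of unions are unions of window edge sets. [folklore] -/
private theorem filter_meets_union (M : Finset (Sym2 (Fin n))) (A A' : Finset (Fin n)) :
    (M.filter fun e => ∃ a ∈ A ∪ A', a ∈ e) =
      (M.filter fun e => ∃ a ∈ A, a ∈ e) ∪ M.filter fun e => ∃ a ∈ A', a ∈ e := by
  ext e
  simp only [mem_filter, mem_union]
  constructor
  · rintro ⟨he, a, ha, hae⟩
    rcases ha with ha | ha
    · exact Or.inl ⟨he, a, ha, hae⟩
    · exact Or.inr ⟨he, a, ha, hae⟩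
  · rintro (⟨he, a, ha, hae⟩ | ⟨he, a, ha, hae⟩)
    · exact ⟨he, a, Or.inl ha, hae⟩
    · exact ⟨he, a, Or.inr ha, hae⟩

/-! ### The virtual quadratic form as a knapsack form -/

/-- **The virtual quadratic form is a knapsack form**: `Σ_{A',A''} γ(A')γ(A'')·B_{|M[A'∪A'']|} =
knapsackForm N r h` with `h(I) = Σ_{A' : M[A'] ↦ I} γ(A')`. [cite: Grigoriev2001, §1 (PDF p. 8)] -/
theorem virtualForm_eq_knapsackForm (M : PMatch n) (r : ℝ) {k : ℕ}
    (γ : {A' : Finset (Fin n) // A'.card ≤ k} → ℝ) :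
    ∑ A' : {A' : Finset (Fin n) // A'.card ≤ k}, ∑ A'' : {A' : Finset (Fin n) // A'.card ≤ k},
        γ A' * γ A'' * knapsackMoment M.1.card r (M.1.filter fun e => ∃ a ∈ A'.1 ∪ A''.1, a ∈ e).card =
      knapsackForm M.1.card r (fun I => ∑ A' ∈ (univ : Finset {A' : Finset (Fin n) // A'.card ≤ k}).filter
          (fun A' => ((univ : Finset (Fin M.1.card)).filter fun x =>
            ((M.1.equivFin.symm x) : Sym2 (Fin n)) ∈ M.1.filter fun e => ∃ a ∈ A'.1, a ∈ e) = I), γ A') := by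
  classical
  -- abbreviation: the index set of the window edges of `A'`
  set φ : {A' : Finset (Fin n) // A'.card ≤ k} → Finset (Fin M.1.card) := fun A' =>
    (univ : Finset (Fin M.1.card)).filter fun x =>
      ((M.1.equivFin.symm x) : Sym2 (Fin n)) ∈ M.1.filter fun e => ∃ a ∈ A'.1, a ∈ e with hφ
  have hcard : ∀ A' A'' : {A' : Finset (Fin n) // A'.card ≤ k},
      (φ A' ∪ φ A'').card = (M.1.filter fun e => ∃ a ∈ A'.1 ∪ A''.1, a ∈ e).card := by
    intro A' A''
    rw [hφ]
    dsimp only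
    rw [← filter_equivFin_symm_mem_union, ← filter_meets_union,
      card_filter_equivFin_symm_mem M.1 (filter_subset _ _)]
  unfold knapsackForm
  -- regroup the double sum over `(A', A'')` by the fibres of `φ`
  symm
  calc ∑ I : Finset (Fin M.1.card), ∑ J : Finset (Fin M.1.card),
        (∑ A' ∈ univ.filter (fun A' => φ A' = I), γ A') * (∑ A'' ∈ univ.filter (fun A' => φ A' = J), γ A'') *
          knapsackMoment M.1.card r (I ∪ J).card
      = ∑ I : Finset (Fin M.1.card), ∑ J : Finset (Fin M.1.card),
          ∑ A' ∈ univ.filter (fun A' => φ A' = I), ∑ A'' ∈ univ.filter (fun A' => φ A' = J),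
            γ A' * γ A'' * knapsackMoment M.1.card r (φ A' ∪ φ A'').card := by
        refine sum_congr rfl fun I _ => sum_congr rfl fun J _ => ?_
        rw [sum_mul, sum_mul]
        refine sum_congr rfl fun A' hA' => ?_
        rw [mul_sum, sum_mul]
        refine sum_congr rfl fun A'' hA'' => ?_
        rw [(mem_filter.1 hA').2, (mem_filter.1 hA'').2]
    _ = ∑ I : Finset (Fin M.1.card), ∑ A' ∈ univ.filter (fun A' => φ A' = I),
          ∑ J : Finset (Fin M.1.card), ∑ A'' ∈ univ.filter (fun A' => φ A' = J),
            γ A' * γ A'' * knapsackMoment M.1.card r (φ A' ∪ φ A'').card :=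
        sum_congr rfl fun I _ => sum_comm
    _ = ∑ A' : {A' : Finset (Fin n) // A'.card ≤ k}, ∑ J : Finset (Fin M.1.card),
          ∑ A'' ∈ univ.filter (fun A' => φ A' = J),
            γ A' * γ A'' * knapsackMoment M.1.card r (φ A' ∪ φ A'').card := by
        rw [sum_fiberwise_of_maps_to (fun A' _ => mem_univ (φ A'))]
    _ = ∑ A' : {A' : Finset (Fin n) // A'.card ≤ k}, ∑ A'' : {A' : Finset (Fin n) // A'.card ≤ k},
          γ A' * γ A'' * knapsackMoment M.1.card r (φ A' ∪ φ A'').card := by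
        refine sum_congr rfl fun A' _ => ?_
        rw [sum_fiberwise_of_maps_to (fun A'' _ => mem_univ (φ A''))]
    _ = ∑ A' : {A' : Finset (Fin n) // A'.card ≤ k}, ∑ A'' : {A' : Finset (Fin n) // A'.card ≤ k},
          γ A' * γ A'' * knapsackMoment M.1.card r (M.1.filter fun e => ∃ a ∈ A'.1 ∪ A''.1, a ∈ e).card := by
        refine sum_congr rfl fun A' _ => sum_congr rfl fun A'' _ => ?_
        rw [hcard]

/-- **The virtual quadratic form is nonnegative under Grigoriev's Lemma 1.4** (the named fact
`Grigoriev2001_knapsackFormNonneg` as a hypothesis): for `2k ≤ N`, `k - 1 < r < N - k + 1` and coefficients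
`γ` on vertex sets of size `≤ k`, `0 ≤ Σ_{A',A''} γ(A')γ(A'')·B_{|M[A'∪A'']|}`.
[cite: Grigoriev2001, Lemma 1.4 (PDF p. 8)] -/
theorem virtualForm_nonneg (hG : Grigoriev2001_knapsackFormNonneg) (M : PMatch n) {r : ℝ} {k : ℕ}
    (hk : 2 * k ≤ M.1.card) (hr₁ : (k : ℝ) - 1 < r) (hr₂ : r < (M.1.card : ℝ) - k + 1)
    (γ : {A' : Finset (Fin n) // A'.card ≤ k} → ℝ) :
    0 ≤ ∑ A' : {A' : Finset (Fin n) // A'.card ≤ k}, ∑ A'' : {A' : Finset (Fin n) // A'.card ≤ k},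
        γ A' * γ A'' * knapsackMoment M.1.card r (M.1.filter fun e => ∃ a ∈ A'.1 ∪ A''.1, a ∈ e).card := by
  rw [virtualForm_eq_knapsackForm]
  refine hG M.1.card k r hk hr₁ hr₂ _ fun I hI => ?_
  -- coefficients vanish on `|I| > k`: every contributing `A'` has `|M[A']| ≤ |A'| ≤ k`
  refine sum_eq_zero fun A' hA' => ?_
  exfalso
  have hAI := (mem_filter.1 hA').2
  have h1 : I.card = (M.1.filter fun e => ∃ a ∈ A'.1, a ∈ e).card := by
    rw [← hAI, card_filter_equivFin_symm_mem M.1 (filter_subset _ _)]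
  -- (the general lemma's `DecidablePred` instance is normalised to the ambient one)
  have h2 : (M.1.filter fun e => ∃ a ∈ A'.1, a ∈ e).card ≤ A'.1.card := by
    convert card_filter_meets_le M.2 A'.1 using 3
  have h3 : A'.1.card ≤ k := A'.2
  omega

/-! ### Linear combinations of containment events -/

/-- **Level sums of linear combinations of containment events** (part G summed): for a perfect matching
`M` of `K_n`, finitely many events `D_s ⊆ U` with `|M[D_s]| ≤ d` and coefficients `β_s`, there is a real
polynomial `P` of degree `≤ d` with `P(0) = Σ_s β_s · knapsackMoment N (t/2) |M[D_s]|` and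
`Σ_{U : c crossing, i internal} Σ_s β_s 1[D_s ⊆ U] = T(N; c, i)·P(c)` for `c + 2i = t`. [folklore] -/
private theorem containment_comb_poly (M : PMatch n) (t d : ℕ) {σ : Type*} [Fintype σ] (β : σ → ℝ)
    (Dset : σ → Finset (Fin n)) (hD : ∀ s, (M.1.filter fun e => ∃ a ∈ Dset s, a ∈ e).card ≤ d) :
    ∃ P : Polynomial ℝ, P.natDegree ≤ d ∧
      P.eval 0 = ∑ s, β s * knapsackMoment M.1.card ((t : ℝ) / 2) (M.1.filter fun e => ∃ a ∈ Dset s, a ∈ e).card ∧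
      ∀ c i : ℕ, c + 2 * i = t →
        ∑ U ∈ (univ : Finset (Fin n)).powerset.filter (fun U =>
            (M.1.filter fun e => cutCount U e = 1).card = c ∧ (M.1.filter fun e => cutCount U e = 2).card = i),
          (∑ s, β s * (if Dset s ⊆ U then (1 : ℝ) else 0)) =
          ((M.1.card.choose (c + i) * (c + i).choose i * 2 ^ c : ℕ) : ℝ) * P.eval (c : ℝ) := by
  have hP : ∀ s : σ, ∃ P : Polynomial ℝ, P.natDegree ≤ (M.1.filter fun e => ∃ a ∈ Dset s, a ∈ e).card ∧
      P.eval 0 = knapsackMoment M.1.card ((t : ℝ) / 2) (M.1.filter fun e => ∃ a ∈ Dset s, a ∈ e).card ∧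
      ∀ c i : ℕ, c + 2 * i = t →
        ((((univ : Finset (Fin n)).powerset.filter fun U => (M.1.filter fun e => cutCount U e = 1).card = c ∧
            (M.1.filter fun e => cutCount U e = 2).card = i ∧ Dset s ⊆ U).card : ℕ) : ℝ) =
          ((M.1.card.choose (c + i) * (c + i).choose i * 2 ^ c : ℕ) : ℝ) * P.eval (c : ℝ) := by
    intro s
    -- (the general lemma's `DecidablePred` instances are converted to the ambient ones)
    obtain ⟨P, h1, h2, h3⟩ := subset_event_poly M.2 (subset_univ (Dset s)) t
    exact ⟨P, by convert h1 using 3, by convert h2 using 4, fun c i hci => by convert h3 c i hci using 5⟩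
  choose P hPdeg hP0 hPval using hP
  refine ⟨∑ s, C (β s) * P s, ?_, ?_, ?_⟩
  · exact natDegree_sum_le_of_forall_le _ _ fun s _ => (natDegree_C_mul_le _ _).trans ((hPdeg s).trans (hD s))
  · rw [eval_finsetSum]
    exact sum_congr rfl fun s _ => by rw [eval_mul, eval_C, hP0 s]
  · intro c i hci
    rw [sum_comm, eval_finsetSum, mul_sum]
    refine sum_congr rfl fun s _ => ?_
    rw [← mul_sum, ← sum_filter, sum_const, nsmul_eq_mul, mul_one, filter_filter, eval_mul, eval_C]
    have hset : ((univ : Finset (Fin n)).powerset.filter fun U =>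
          ((M.1.filter fun e => cutCount U e = 1).card = c ∧ (M.1.filter fun e => cutCount U e = 2).card = i) ∧
            Dset s ⊆ U) =
        (univ : Finset (Fin n)).powerset.filter fun U => (M.1.filter fun e => cutCount U e = 1).card = c ∧
          (M.1.filter fun e => cutCount U e = 2).card = i ∧ Dset s ⊆ U :=
      filter_congr fun U _ => and_assoc
    rw [hset, hPval s c i hci]
    ring

end Literature.Combinatorics.Optimization.ChebyshevTracialDesignJunta

/-! ## Section from `ChebyshevTracialDesignJuntaLowDegree.lean` -/
/-!
# Junta virtual positivity, part I: low-degree cut-side factors (the cell's §2.15) modulo Grigoriev's Lemma 1.4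

Support file for the crux `TracialDecayExp20` (stmt-PneNP-19878; also `TracialDecay20`, stmt-PneNP-19646)
of route `ChebyshevTracialDesign` — the LOW-DEGREE SECTOR of the virtual-positivity step (cell pnp-psdrank
ROUND-3 §2.14–2.15; the referee's pre-registered check: the SOS-duality step must be CARRIED, the PSD-ness
of the virtual level must come from Grigoriev's KNAPSACK lemma, not from the MOD-2 degree bound):

* `lowdeg_sum_law`: per perfect matching `M`, for factors `A_U` whose entries are combinations of the
  containment indicators `1[A' ⊆ U]`, `|A'| ≤ k`, and any psd `Y`, the level sums of `tr(A_U A_Uᵀ Y)` are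
  `T(N; c, i)·P(c)` with `deg P ≤ 2k` and `P(0) = Σ_{j,l} knapsackForm(…) ≥ 0` — the SOS step
  `tr(A Aᵀ Y) = Σ_{j,l} (Σ_a √Y_{la} A_{aj})²` is explicit (`exists_gram_of_posSemidef`), the positivity is
  `virtualForm_nonneg` (part H) under `Literature.Computability.Complexity.Grigoriev2001_knapsackFormNonneg`;
* `sum_levelWeight_trace_nonpos_of_lowDegree`: for an exact design of degree `D` on the `t`-cuts,
  `IsLowDegreeU n k A` with `2k ≤ D`, `4k ≤ t`, and ARBITRARY psd `Y`:
  `Σ_U Σ_M levelWeight·tr(A_U A_Uᵀ Y_M) ≤ 0` (conditional on the named fact);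
* `designValueNonposLowDegree_of_knapsack : Grigoriev2001_knapsackFormNonneg → DesignValueNonposLowDegree`
  — the tree's named statement `Literature.Combinatorics.Optimization.DesignValueNonposLowDegree`
  (TracialDesignsLowDegree.lean, p408849) with `c₀ = 1/4`, `n₀ = 0`; only the cut-side degree is used.

No definitions. CONDITIONAL on Grigoriev 2001 Lemma 1.4 (not proved in the tree).
-/


namespace Literature.Combinatorics.Optimization.ChebyshevTracialDesignJunta

open Finset Literature.Barriers.PneNP Literature.Combinatorics.SimpleGraph.CycleSpace
open Polynomial Literature.Computability.Complexity

variable {n : ℕ}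

/-! ### Part I: low-degree cut-side factors have nonpositive design value (modulo Grigoriev's Lemma 1.4) -/

section LowDegree

open Matrix Literature.Combinatorics.Optimization
open scoped MatrixOrder

/-- `tr(A Aᵀ Y) = Σ_{j,a,b} Y(b,a) A(a,j) A(b,j)`. [folklore] -/
private theorem trace_mul_transpose_mul_eq {r m : ℕ} (A : Matrix (Fin r) (Fin m) ℝ) (Y : Matrix (Fin r) (Fin r) ℝ) :
    (A * Aᵀ * Y).trace = ∑ j, ∑ a, ∑ b, Y b a * (A a j * A b j) := by
  calc (A * Aᵀ * Y).trace = ∑ a, ∑ b, ∑ j, Y b a * (A a j * A b j) := by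
        simp only [Matrix.trace, Matrix.diag_apply, Matrix.mul_apply, Matrix.transpose_apply, Finset.sum_mul]
        exact sum_congr rfl fun a _ => sum_congr rfl fun b _ => sum_congr rfl fun j _ => by ring
    _ = ∑ a, ∑ j, ∑ b, Y b a * (A a j * A b j) := sum_congr rfl fun a _ => Finset.sum_comm
    _ = ∑ j, ∑ a, ∑ b, Y b a * (A a j * A b j) := Finset.sum_comm

/-- A real psd matrix is a Gram matrix: `Y(b,a) = Σ_l S(l,a) S(l,b)` for `S = √Y`. [folklore] -/
private theorem exists_gram_of_posSemidef {r : ℕ} {Y : Matrix (Fin r) (Fin r) ℝ} (hY : Y.PosSemidef) :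
    ∃ S : Matrix (Fin r) (Fin r) ℝ, ∀ a b, Y b a = ∑ l, S l a * S l b := by
  set S : Matrix (Fin r) (Fin r) ℝ := CFC.sqrt Y with hS
  have hSpsd : S.PosSemidef := (CFC.sqrt_nonneg Y).posSemidef
  have hSS : S * S = Y := CFC.sqrt_mul_sqrt_self Y hY.nonneg
  have hSH : Sᴴ = S := hSpsd.1
  refine ⟨S, fun a b => ?_⟩
  rw [← hSS, Matrix.mul_apply]
  refine sum_congr rfl fun l _ => ?_
  have h1 : S b l = S l b := by
    have := congrFun (congrFun hSH l) b
    rw [conjTranspose_apply, star_trivial] at this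
    exact this
  rw [h1]; ring

/-- Product of two containment indicators. [folklore] -/
private theorem ite_subset_mul_ite_subset (A' A'' U : Finset (Fin n)) :
    (if A' ⊆ U then (1 : ℝ) else 0) * (if A'' ⊆ U then (1 : ℝ) else 0) = if A' ∪ A'' ⊆ U then 1 else 0 := by
  by_cases h1 : A' ⊆ U <;> by_cases h2 : A'' ⊆ U <;> simp [h1, h2, union_subset_iff]

/-- Reordering a fourfold sum. [folklore] -/
private theorem sum_comm_four {ι₁ ι₂ ι₃ ι₄ : Type*} [Fintype ι₁] [Fintype ι₂] [Fintype ι₃] [Fintype ι₄]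
    (F : ι₁ → ι₂ → ι₃ → ι₄ → ℝ) :
    ∑ a, ∑ b, ∑ c, ∑ d, F a b c d = ∑ c, ∑ d, ∑ a, ∑ b, F a b c d := by
  calc ∑ a, ∑ b, ∑ c, ∑ d, F a b c d = ∑ a, ∑ c, ∑ b, ∑ d, F a b c d :=
        sum_congr rfl fun a _ => Finset.sum_comm
    _ = ∑ a, ∑ c, ∑ d, ∑ b, F a b c d :=
        sum_congr rfl fun a _ => sum_congr rfl fun c _ => Finset.sum_comm
    _ = ∑ c, ∑ a, ∑ d, ∑ b, F a b c d := Finset.sum_comm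
    _ = ∑ c, ∑ d, ∑ a, ∑ b, F a b c d := sum_congr rfl fun c _ => Finset.sum_comm

/-- **Low-degree sum law per matching** (cell pnp-psdrank ROUND-3 §2.14–2.15, one-sided): for a perfect
matching `M` of `K_n` (`N` edges), a family `A_U` of `r × m` matrices whose entries are combinations
`A_U(a,j) = Σ_{|A'| ≤ k} α(a,j,A')·1[A' ⊆ U]` of containment indicators, and a psd `Y`, the level sums
`Σ_{U : c crossing, i internal} tr(A_U A_Uᵀ Y)` (`c + 2i = t`) equal `T(N; c, i)·P(c)` for a real
polynomial `P` of degree `≤ 2k` whose virtual value `P(0)` is a sum of Grigoriev knapsack forms, hence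
`≥ 0` under Grigoriev's Lemma 1.4 (`2k ≤ N`, `k - 1 < t/2 < N - k + 1`). [cite: Grigoriev2001, Lemma 1.4 (PDF p. 8)] -/
theorem lowdeg_sum_law (hG : Grigoriev2001_knapsackFormNonneg) (M : PMatch n) {t k r m : ℕ}
    (hk : 2 * k ≤ M.1.card) (hr₁ : (k : ℝ) - 1 < (t : ℝ) / 2) (hr₂ : (t : ℝ) / 2 < (M.1.card : ℝ) - k + 1)
    (α : Fin r → Fin m → {A' : Finset (Fin n) // A'.card ≤ k} → ℝ) (Y : Matrix (Fin r) (Fin r) ℝ)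
    (hY : Y.PosSemidef) :
    ∃ P : Polynomial ℝ, P.natDegree ≤ 2 * k ∧ 0 ≤ P.eval 0 ∧ ∀ c i : ℕ, c + 2 * i = t →
      ∑ U ∈ (univ : Finset (Fin n)).powerset.filter (fun U =>
          (M.1.filter fun e => cutCount U e = 1).card = c ∧ (M.1.filter fun e => cutCount U e = 2).card = i),
        ∑ j, ∑ a, ∑ b, Y b a *
          ((∑ A' : {A' : Finset (Fin n) // A'.card ≤ k}, α a j A' * (if A'.1 ⊆ U then (1 : ℝ) else 0)) *
           (∑ A'' : {A' : Finset (Fin n) // A'.card ≤ k}, α b j A'' * (if A''.1 ⊆ U then (1 : ℝ) else 0))) =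
        ((M.1.card.choose (c + i) * (c + i).choose i * 2 ^ c : ℕ) : ℝ) * P.eval (c : ℝ) := by
  -- the index set of the containment events: (j, a, b, A', A'')
  obtain ⟨P, hPdeg, hP0, hPval⟩ := containment_comb_poly M t (2 * k)
    (σ := Fin m × Fin r × Fin r × {A' : Finset (Fin n) // A'.card ≤ k} × {A' : Finset (Fin n) // A'.card ≤ k})
    (fun s => Y s.2.2.1 s.2.1 * (α s.2.1 s.1 s.2.2.2.1 * α s.2.2.1 s.1 s.2.2.2.2))
    (fun s => s.2.2.2.1.1 ∪ s.2.2.2.2.1)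
    (fun s => by
      have h1 : (M.1.filter fun e => ∃ a ∈ s.2.2.2.1.1 ∪ s.2.2.2.2.1, a ∈ e).card ≤
          (s.2.2.2.1.1 ∪ s.2.2.2.2.1).card := by
        convert card_filter_meets_le M.2 (s.2.2.2.1.1 ∪ s.2.2.2.2.1) using 3
      have h2 := card_union_le s.2.2.2.1.1 s.2.2.2.2.1
      have h3 := s.2.2.2.1.2
      have h4 := s.2.2.2.2.2
      omega)
  refine ⟨P, hPdeg, ?_, fun c i hci => ?_⟩
  · -- the virtual value is a sum of knapsack forms
    rw [hP0]
    obtain ⟨S, hS⟩ := exists_gram_of_posSemidef hY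
    simp only [Fintype.sum_prod_type]
    refine sum_nonneg fun j _ => ?_
    rw [sum_comm_four]
    have hre : ∀ (A' A'' : {A' : Finset (Fin n) // A'.card ≤ k}),
        ∑ a, ∑ b, Y b a * (α a j A' * α b j A'') *
            knapsackMoment M.1.card ((t : ℝ) / 2) (M.1.filter fun e => ∃ x ∈ A'.1 ∪ A''.1, x ∈ e).card =
          ∑ l, (∑ a, S l a * α a j A') * (∑ b, S l b * α b j A'') *
            knapsackMoment M.1.card ((t : ℝ) / 2) (M.1.filter fun e => ∃ x ∈ A'.1 ∪ A''.1, x ∈ e).card := by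
      intro A' A''
      calc ∑ a, ∑ b, Y b a * (α a j A' * α b j A'') *
              knapsackMoment M.1.card ((t : ℝ) / 2) (M.1.filter fun e => ∃ x ∈ A'.1 ∪ A''.1, x ∈ e).card
          = ∑ a, ∑ b, ∑ l, (S l a * α a j A') * (S l b * α b j A'') *
              knapsackMoment M.1.card ((t : ℝ) / 2) (M.1.filter fun e => ∃ x ∈ A'.1 ∪ A''.1, x ∈ e).card := by
            refine sum_congr rfl fun a _ => sum_congr rfl fun b _ => ?_
            rw [hS a b, sum_mul, sum_mul]
            exact sum_congr rfl fun l _ => by ring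
        _ = ∑ a, ∑ l, ∑ b, (S l a * α a j A') * (S l b * α b j A'') *
              knapsackMoment M.1.card ((t : ℝ) / 2) (M.1.filter fun e => ∃ x ∈ A'.1 ∪ A''.1, x ∈ e).card :=
            sum_congr rfl fun a _ => Finset.sum_comm
        _ = ∑ l, ∑ a, ∑ b, (S l a * α a j A') * (S l b * α b j A'') *
              knapsackMoment M.1.card ((t : ℝ) / 2) (M.1.filter fun e => ∃ x ∈ A'.1 ∪ A''.1, x ∈ e).card :=
            Finset.sum_comm
        _ = ∑ l, (∑ a, S l a * α a j A') * (∑ b, S l b * α b j A'') *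
              knapsackMoment M.1.card ((t : ℝ) / 2) (M.1.filter fun e => ∃ x ∈ A'.1 ∪ A''.1, x ∈ e).card := by
            refine sum_congr rfl fun l _ => ?_
            rw [Finset.sum_mul_sum, Finset.sum_mul]
            refine sum_congr rfl fun a _ => ?_
            rw [Finset.sum_mul]
    rw [sum_congr rfl fun A' _ => sum_congr rfl fun A'' _ => hre A' A'']
    -- pull `Σ_l` outside
    rw [sum_congr rfl fun A' _ => Finset.sum_comm, Finset.sum_comm]
    refine sum_nonneg fun l _ => ?_
    exact virtualForm_nonneg hG M hk hr₁ hr₂ (fun A' => ∑ a, S l a * α a j A')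
  · -- the level sums: expand the trace form into containment events
    rw [← hPval c i hci]
    refine sum_congr rfl fun U _ => ?_
    simp only [Fintype.sum_prod_type]
    refine sum_congr rfl fun j _ => sum_congr rfl fun a _ => sum_congr rfl fun b _ => ?_
    rw [Finset.sum_mul_sum, mul_sum]
    refine sum_congr rfl fun A' _ => ?_
    rw [mul_sum]
    refine sum_congr rfl fun A'' _ => ?_
    rw [← ite_subset_mul_ite_subset]
    ring

end LowDegree

section LowDegreeDesign

open Matrix Literature.Combinatorics.Optimization
open scoped MatrixOrder

/-- **Low-degree cut-side factors have nonpositive design value, modulo Grigoriev's Lemma 1.4** (cell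
pnp-psdrank ROUND-3 §2.15, one-sided; the virtual-level PSD step is the named fact
`Literature.Computability.Complexity.Grigoriev2001_knapsackFormNonneg`, carried as a hypothesis, and the
SOS step `tr(A Aᵀ Y) = Σ_{j,l} q_{jl}²` is carried explicitly): for an exact design of degree `D` on the
`t`-cuts, factors `A_U` (`r × m`) of Johnson degree `≤ k` with `2k ≤ D`, `4k ≤ t`, and ARBITRARY psd `Y`,
`Σ_U Σ_M levelWeight(U,M)·tr(A_U A_Uᵀ Y_M) ≤ 0`. [cite: Grigoriev2001, Lemma 1.4 (PDF p. 8)] -/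
theorem sum_levelWeight_trace_nonpos_of_lowDegree (hG : Grigoriev2001_knapsackFormNonneg)
    {t T D : ℕ} {Bv : ℝ} {C : Finset ℕ} {w : ℕ → ℝ} (hdes : IsExactDesign n t T D Bv C w)
    {r m k : ℕ} (h2k : 2 * k ≤ D) (h4k : 4 * k ≤ t)
    (A : OddSet n → Matrix (Fin r) (Fin m) ℝ) (hA : IsLowDegreeU n k A)
    (Y : PMatch n → Matrix (Fin r) (Fin r) ℝ) (hYpsd : ∀ M, (Y M).PosSemidef) :
    ∑ U, ∑ M, levelWeight n t C w U M * (A U * (A U)ᵀ * Y M).trace ≤ 0 := by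
  obtain ⟨htodd, htn, hTt, hC, -, hexact, -⟩ := hdes
  -- coefficients of the low-degree entries
  have hα' : ∀ a j, ∃ c : {A' : Finset (Fin n) // A'.card ≤ k} → ℝ,
      ∑ A', c A' • (fun U : OddSet n => if A'.1 ⊆ U.1 then (1 : ℝ) else 0) = fun U => A U a j :=
    fun a j => (Submodule.mem_span_range_iff_exists_fun ℝ).1 (hA a j)
  choose α hα using hα'
  have hAeval : ∀ (U : OddSet n) a j,
      A U a j = ∑ A' : {A' : Finset (Fin n) // A'.card ≤ k}, α a j A' * (if A'.1 ⊆ U.1 then (1 : ℝ) else 0) := by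
    intro U a j
    have := congrFun (hα a j) U
    rw [Finset.sum_apply] at this
    rw [← this]
    exact sum_congr rfl fun A' _ => by rw [Pi.smul_apply, smul_eq_mul]
  have hXpsd : ∀ U : OddSet n, (A U * (A U)ᵀ).PosSemidef := fun U => by
    simpa [Matrix.conjTranspose_eq_transpose_of_trivial] using Matrix.posSemidef_self_mul_conjTranspose (A U)
  have htr : ∀ (U : OddSet n) (M : PMatch n), 0 ≤ (A U * (A U)ᵀ * Y M).trace := fun U M =>
    (show HasPsdFactorization (fun U M => (A U * (A U)ᵀ * Y M).trace) r from
      ⟨fun U => A U * (A U)ᵀ, Y, hXpsd, hYpsd, fun _ _ => rfl⟩).nonneg U M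
  -- Step 1: the value as level sums
  have hval : ∑ U, ∑ M, levelWeight n t C w U M * (A U * (A U)ᵀ * Y M).trace =
      ∑ c ∈ C, w c / ((Qset n t c).card : ℝ) *
        ∑ M : PMatch n, ∑ U : OddSet n,
          (if U.1.card = t ∧ cc U M = c then (A U * (A U)ᵀ * Y M).trace else 0) := by
    calc ∑ U, ∑ M, levelWeight n t C w U M * (A U * (A U)ᵀ * Y M).trace
        = ∑ U, ∑ M, ∑ c ∈ C, (if (U, M) ∈ Qset n t c then
            w c / ((Qset n t c).card : ℝ) * (A U * (A U)ᵀ * Y M).trace else 0) := by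
          refine sum_congr rfl fun U _ => sum_congr rfl fun M _ => ?_
          rw [levelWeight, sum_mul]
          exact sum_congr rfl fun c _ => by split_ifs <;> simp
      _ = ∑ U, ∑ c ∈ C, ∑ M, (if (U, M) ∈ Qset n t c then
            w c / ((Qset n t c).card : ℝ) * (A U * (A U)ᵀ * Y M).trace else 0) := sum_congr rfl fun U _ => sum_comm
      _ = ∑ c ∈ C, ∑ U, ∑ M, (if (U, M) ∈ Qset n t c then
            w c / ((Qset n t c).card : ℝ) * (A U * (A U)ᵀ * Y M).trace else 0) := sum_comm
      _ = ∑ c ∈ C, w c / ((Qset n t c).card : ℝ) *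
            ∑ M : PMatch n, ∑ U : OddSet n,
              (if U.1.card = t ∧ cc U M = c then (A U * (A U)ᵀ * Y M).trace else 0) := by
          refine sum_congr rfl fun c _ => ?_
          rw [mul_sum, sum_comm]
          refine sum_congr rfl fun M _ => ?_
          rw [mul_sum]
          refine sum_congr rfl fun U _ => ?_
          simp only [mem_Qset_iff]
          split_ifs <;> simp
  -- Step 2: per matching, the polynomial from the low-degree sum law
  have hN : ∀ M : PMatch n, M.1.card = n / 2 := fun M => by have := two_mul_card_pmatch M; omega
  have hP : ∀ M : PMatch n, ∃ P : Polynomial ℝ, P.natDegree ≤ D ∧ 0 ≤ P.eval 0 ∧ ∀ c i : ℕ, c + 2 * i = t →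
      ∑ U : OddSet n, (if U.1.card = t ∧ cc U M = c then (A U * (A U)ᵀ * Y M).trace else 0) =
        (((n / 2).choose (c + i) * (c + i).choose i * 2 ^ c : ℕ) : ℝ) * P.eval (c : ℝ) := by
    intro M
    have hMt : t + 1 ≤ M.1.card := by have := two_mul_card_pmatch M; omega
    have hk : 2 * k ≤ M.1.card := by omega
    have hr₁ : (k : ℝ) - 1 < (t : ℝ) / 2 := by
      have : (4 : ℝ) * k ≤ t := by exact_mod_cast h4k
      linarith
    have hr₂ : (t : ℝ) / 2 < (M.1.card : ℝ) - k + 1 := by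
      have h1 : (4 : ℝ) * k ≤ t := by exact_mod_cast h4k
      have h2 : (t : ℝ) + 1 ≤ M.1.card := by exact_mod_cast hMt
      linarith
    obtain ⟨P, hPdeg, hP0, hPval⟩ := lowdeg_sum_law hG M hk hr₁ hr₂ α (Y M) (hYpsd M)
    refine ⟨P, hPdeg.trans h2k, hP0, fun c i hci => ?_⟩
    rw [sum_oddSet_level_eq M hci (fun U => A U * (A U)ᵀ) Y, ← hN M, ← hPval c i hci]
    refine sum_congr rfl fun U' hU' => ?_
    have hodd : Odd U'.card := by
      obtain ⟨-, hc, hi⟩ := mem_filter.1 hU'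
      have h := card_eq_cr_add_two_mul_in M.2 (subset_univ U')
      rw [hc, hi, hci] at h
      exact h ▸ htodd
    rw [dif_pos hodd, trace_mul_transpose_mul_eq]
    refine sum_congr rfl fun j _ => sum_congr rfl fun a _ => sum_congr rfl fun b _ => ?_
    rw [hAeval ⟨U', hodd⟩ a j, hAeval ⟨U', hodd⟩ b j]
  choose P hPdeg hP0 hPval using hP
  -- Step 3: |Q_c| = #PM · T(n/2; c, i)
  have hQ : ∀ c i : ℕ, c + 2 * i = t → ((Qset n t c).card : ℝ) =
      (Fintype.card (PMatch n) : ℝ) * (((n / 2).choose (c + i) * (c + i).choose i * 2 ^ c : ℕ) : ℝ) := by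
    intro c i hci
    have e1 : ((Qset n t c).card : ℝ) =
        ∑ M : PMatch n, ∑ U : OddSet n, (if U.1.card = t ∧ cc U M = c then (1 : ℝ) else 0) := by
      rw [Qset, Finset.card_filter, Nat.cast_sum, Fintype.sum_prod_type, sum_comm]
      refine sum_congr rfl fun M _ => sum_congr rfl fun U _ => ?_
      split_ifs <;> simp
    have e2 : ∀ M : PMatch n, ∑ U : OddSet n, (if U.1.card = t ∧ cc U M = c then (1 : ℝ) else 0) =
        (((n / 2).choose (c + i) * (c + i).choose i * 2 ^ c : ℕ) : ℝ) := by
      intro M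
      have key := sum_oddSet_level_eq M hci (r := 1) (fun _ => 1) (fun _ => 1)
      simp only [Matrix.mul_one, trace_one, Fintype.card_fin, Nat.cast_one, dite_eq_ite] at key
      rw [key]
      have hodd : ∀ U' ∈ (univ : Finset (Fin n)).powerset.filter (fun U' =>
          (M.1.filter fun e => cutCount U' e = 1).card = c ∧ (M.1.filter fun e => cutCount U' e = 2).card = i),
          (if Odd U'.card then (1 : ℝ) else 0) = 1 := by
        intro U' hU'
        rw [mem_filter] at hU'
        have hc := card_eq_cr_add_two_mul_in M.2 (subset_univ U')
        rw [hU'.2.1, hU'.2.2, hci] at hc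
        rw [if_pos (hc ▸ htodd)]
      rw [sum_congr rfl hodd, sum_const, nsmul_eq_mul, mul_one, card_filter_cr_in_eq M.2, hN M]
    rw [e1, Fintype.sum_congr _ _ e2, sum_const, card_univ, nsmul_eq_mul]
  -- Step 4: assemble
  rw [hval]
  have hterm : ∀ c ∈ C, w c / ((Qset n t c).card : ℝ) *
      ∑ M : PMatch n, ∑ U : OddSet n,
        (if U.1.card = t ∧ cc U M = c then (A U * (A U)ᵀ * Y M).trace else 0) =
      (Fintype.card (PMatch n) : ℝ)⁻¹ * ∑ M : PMatch n, w c * (P M).eval (c : ℝ) := by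
    intro c hc
    obtain ⟨hcodd, -, hcT, hne⟩ := hC c hc
    have hct : c ≤ t := hcT.trans hTt
    obtain ⟨i, hi⟩ : ∃ i, c + 2 * i = t := by
      obtain ⟨a, ha⟩ := hcodd; obtain ⟨b, hb⟩ := htodd; exact ⟨b - a, by omega⟩
    have hQc := hQ c i hi
    have hQ0 : ((Qset n t c).card : ℝ) ≠ 0 := by exact_mod_cast (card_pos.2 hne).ne'
    have hT0 : (((n / 2).choose (c + i) * (c + i).choose i * 2 ^ c : ℕ) : ℝ) ≠ 0 := by
      intro h0; rw [h0, mul_zero] at hQc; exact hQ0 hQc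
    rw [sum_congr rfl fun M _ => hPval M c i hi, ← mul_sum, hQc, mul_sum, mul_sum, mul_sum]
    refine sum_congr rfl fun M _ => ?_
    field_simp
  rw [sum_congr rfl hterm, ← mul_sum, sum_comm]
  have hinner : ∀ M : PMatch n, ∑ c ∈ C, w c * (P M).eval (c : ℝ) = -(P M).eval 0 :=
    fun M => hexact (P M) (hPdeg M)
  rw [Fintype.sum_congr _ _ hinner]
  exact mul_nonpos_of_nonneg_of_nonpos (inv_nonneg.2 (Nat.cast_nonneg _))
    (by rw [sum_neg_distrib, neg_nonpos]; exact sum_nonneg fun M _ => hP0 M)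

/-- **`DesignValueNonposLowDegree` from Grigoriev's knapsack Lemma 1.4** (the tree's named statement
`Literature.Combinatorics.Optimization.DesignValueNonposLowDegree`, cell pnp-psdrank ROUND-3 §2.15, with
`c₀ = 1/4`, `n₀ = 0`; only the cut-side factor needs to be low-degree): conditional on the named fact
`Literature.Computability.Complexity.Grigoriev2001_knapsackFormNonneg` (Grigoriev 2001, Lemma 1.4, not
proved in the tree). [cite: Grigoriev2001, Lemma 1.4 (PDF p. 8)] -/
theorem designValueNonposLowDegree_of_knapsack (hG : Grigoriev2001_knapsackFormNonneg) :
    DesignValueNonposLowDegree := by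
  refine ⟨1 / 4, by norm_num, 0, ?_⟩
  intro n t T D Bv C w hdes _ k k' r m hkk hc₀ A B hA _
  -- the cut-side degree bounds
  have h2k : 2 * k ≤ D := by omega
  have h4k : 4 * k ≤ t := by
    have h1 : ((k + k' : ℕ) : ℝ) ≤ 1 / 4 * t := hc₀
    have h2 : (4 : ℝ) * k ≤ t := by push_cast at h1; linarith
    exact_mod_cast h2
  have hYpsd : ∀ M : PMatch n, (B M * (B M)ᵀ).PosSemidef := fun M => by
    simpa [Matrix.conjTranspose_eq_transpose_of_trivial] using Matrix.posSemidef_self_mul_conjTranspose (B M)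
  have hval := sum_levelWeight_trace_nonpos_of_lowDegree hG hdes h2k h4k A hA (fun M => B M * (B M)ᵀ) hYpsd
  -- `Σ_c w_c levelProfile(c) = (1/r) Σ_U Σ_M levelWeight · tr`
  rcases Nat.eq_zero_or_pos r with hr0 | hrpos
  · subst hr0
    have h0 : ∀ c, levelProfile n t 0 (fun U => A U * (A U)ᵀ) (fun M => B M * (B M)ᵀ) c = 0 := by
      intro c; rw [levelProfile]; simp
    rw [sum_congr rfl (fun c _ => by rw [h0 c, mul_zero]), sum_const_zero]
  have hr : (0 : ℝ) < r := by exact_mod_cast hrpos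
  have hlp : ∀ c ∈ C, w c * levelProfile n t r (fun U => A U * (A U)ᵀ) (fun M => B M * (B M)ᵀ) c =
      (1 / r) * (w c / ((Qset n t c).card : ℝ) *
        ∑ p ∈ Qset n t c, (A p.1 * (A p.1)ᵀ * (B p.2 * (B p.2)ᵀ)).trace) := by
    intro c _
    rw [levelProfile]
    field_simp
  rw [sum_congr rfl hlp, ← mul_sum]
  refine mul_nonpos_of_nonneg_of_nonpos (by positivity) ?_
  -- the bracket is exactly `Σ_U Σ_M levelWeight · tr`
  have hval' : ∑ c ∈ C, w c / ((Qset n t c).card : ℝ) *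
      ∑ p ∈ Qset n t c, (A p.1 * (A p.1)ᵀ * (B p.2 * (B p.2)ᵀ)).trace =
      ∑ U, ∑ M, levelWeight n t C w U M * (A U * (A U)ᵀ * (B M * (B M)ᵀ)).trace := by
    calc ∑ c ∈ C, w c / ((Qset n t c).card : ℝ) *
          ∑ p ∈ Qset n t c, (A p.1 * (A p.1)ᵀ * (B p.2 * (B p.2)ᵀ)).trace
        = ∑ c ∈ C, ∑ U, ∑ M, (if (U, M) ∈ Qset n t c then
            w c / ((Qset n t c).card : ℝ) * (A U * (A U)ᵀ * (B M * (B M)ᵀ)).trace else 0) := by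
          refine sum_congr rfl fun c _ => ?_
          rw [← sum_sum_ite_mem (Qset n t c) fun U M => (A U * (A U)ᵀ * (B M * (B M)ᵀ)).trace, mul_sum]
          refine sum_congr rfl fun U _ => ?_
          rw [mul_sum]
          refine sum_congr rfl fun M _ => ?_
          split_ifs <;> simp
      _ = ∑ U, ∑ c ∈ C, ∑ M, (if (U, M) ∈ Qset n t c then
            w c / ((Qset n t c).card : ℝ) * (A U * (A U)ᵀ * (B M * (B M)ᵀ)).trace else 0) := sum_comm
      _ = ∑ U, ∑ M, ∑ c ∈ C, (if (U, M) ∈ Qset n t c then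
            w c / ((Qset n t c).card : ℝ) * (A U * (A U)ᵀ * (B M * (B M)ᵀ)).trace else 0) :=
          sum_congr rfl fun U _ => sum_comm
      _ = ∑ U, ∑ M, levelWeight n t C w U M * (A U * (A U)ᵀ * (B M * (B M)ᵀ)).trace := by
          refine sum_congr rfl fun U _ => sum_congr rfl fun M _ => ?_
          rw [levelWeight, sum_mul]
          exact sum_congr rfl fun c _ => by split_ifs <;> simp
  rw [hval']
  exact hval

end LowDegreeDesign

end Literature.Combinatorics.Optimization.ChebyshevTracialDesignJunta


/-! ## Section added in Literature (2026-08-28): the half-degree sharpening of the containment level law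

Cell `pnp-psdrank`, prover memo MEMO-20 §2(c)/§4(1): the level polynomial of a containment event
`1[A₀ ⊆ U]` against a perfect matching `M` has degree `⌊|A₀|/2⌋`, not `|M[A₀]|`.  With `a` window edges
inside `A₀` and `b` window edges meeting `A₀` in one point (`|A₀| = 2a + b`), summing the pattern law
over the traces `B ⊇ A₀` on the window gives
`P_{A₀}(c) = [N]_x⁻¹ · [(t−c)/2]_a · Σ_j C(b,j) 2^{-j} [c]_j [(t−c)/2 − a]_{b−j}`, and the HALF-DEGREE
IDENTITY (generating function `(1+z/2)^{2s}(1+z)^{T−s} = (1+z)^T (1 + z²/(4(1+z)))^s`, i.e.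
`(X+2)^{2s}(X+1)^{T−s} = Σ_l C(s,l) 4^{s−l} X^{2l} (X+1)^{T−l}`)
`Σ_j C(b,j) 2^{-j} [2s]_j [T−s]_{b−j} = Σ_{l ≤ b/2} b!/(l!(b−2l)!)·4^{-l}·[s]_l·[T−l]_{b−2l}`
(proved at natural `s ≤ T` by comparing coefficients, then extended to all real `s, T` because both
sides are polynomials) shows that the sum has degree `⌊b/2⌋` in `s = c/2`.  Consequences:
`subset_event_poly_sharp` (`deg ≤ |A₀|/2`), `lowdeg_sum_law_sharp` (`deg ≤ k` instead of `2k` for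
products of two containment indicators of sets of size `≤ k`) — representation-theoretically: odd
Johnson modes do not reach `L²` of the perfect-matching scheme, and layer `2κ` has a level polynomial
of degree `κ`.  Everything is proved; no definitions, no named facts.
-/

namespace Literature.Combinatorics.Optimization.ChebyshevTracialDesignJunta

open Finset Literature.Barriers.PneNP Literature.Combinatorics.SimpleGraph.CycleSpace
open Polynomial Literature.Computability.Complexity

section HalfDegreeAlgebra

/-- `∏_{r<k} (n - r) = n.descFactorial k` in `ℝ`. [folklore] -/
private theorem prod_range_sub_eq_descFactorial (n k : ℕ) :
    ∏ r ∈ range k, ((n : ℝ) - r) = (n.descFactorial k : ℝ) := by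
  rw [← descPochhammer_eval_eq_descFactorial ℝ n k, descPochhammer_eval_eq_prod_range]

/-- The generating-function identity `(X+2)^{2s}(X+1)^m = Σ_l C(s,l)4^{s-l}X^{2l}(X+1)^{m+s-l}`
(from `(X+2)² = X² + 4(X+1)` and the binomial theorem). [folklore] -/
private theorem genfun (s m : ℕ) :
    ((X + C (2:ℝ)) ^ (2 * s) * (X + C 1) ^ m : Polynomial ℝ) =
      ∑ l ∈ range (s + 1), C ((s.choose l : ℝ) * 4 ^ (s - l)) *
        (X ^ (2 * l) * (X + C 1) ^ (m + (s - l))) := by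
  have hsq : (X + C (2:ℝ)) ^ 2 = X ^ 2 + C 4 * (X + C 1) := by
    rw [show (C (2:ℝ) : Polynomial ℝ) = 2 from map_ofNat C 2,
      show (C (4:ℝ) : Polynomial ℝ) = 4 from map_ofNat C 4, C_1]
    ring
  rw [pow_mul, hsq, add_pow, Finset.sum_mul]
  refine Finset.sum_congr rfl fun l _ => ?_
  rw [C_mul, C_pow, C_eq_natCast, mul_pow, ← C_pow]
  ring

/-- Coefficient of `z^b` in `genfun`. [folklore] -/
private theorem coeff_id (s m b : ℕ) :
    ∑ j ∈ range (b + 1), ((2 * s).choose j : ℝ) * 2 ^ (2 * s - j) * (m.choose (b - j) : ℝ) =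
      ∑ l ∈ range (s + 1), (s.choose l : ℝ) * 4 ^ (s - l) *
        (if 2 * l ≤ b then (((m + (s - l)).choose (b - 2 * l) : ℕ) : ℝ) else 0) := by
  have h := congrArg (fun p : Polynomial ℝ => p.coeff b) (genfun s m)
  rw [coeff_mul, Finset.Nat.sum_antidiagonal_eq_sum_range_succ_mk, finsetSum_coeff] at h
  simp only [coeff_X_add_C_pow, one_pow, one_mul, coeff_C_mul, coeff_X_pow_mul'] at h
  rw [Nat.succ_eq_add_one] at h
  rw [← h]
  exact Finset.sum_congr rfl fun j _ => by ring

/-- The identity at natural arguments, in falling-factorial form: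
`Σ_j C(b,j) 2^{-j} [2s]_j [m]_{b-j} = Σ_{l ≤ b/2} b!/(l!(b-2l)!) 4^{-l} [s]_l [m+s-l]_{b-2l}`. [folklore] -/
private theorem nat_id (s m b : ℕ) :
    ∑ j ∈ range (b + 1), (b.choose j : ℝ) * (1 / 2) ^ j * ((2 * s).descFactorial j : ℝ) *
        (m.descFactorial (b - j) : ℝ) =
      ∑ l ∈ range (b / 2 + 1), ((b.factorial : ℝ) / (l.factorial * (b - 2 * l).factorial)) *
        (1 / 4) ^ l * (s.descFactorial l : ℝ) * ((m + (s - l)).descFactorial (b - 2 * l) : ℝ) := by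
  have h := coeff_id s m b
  -- multiply the coefficient identity by `b! / 4^s`
  have h4 : (0 : ℝ) < 4 ^ s := by positivity
  have key : ∀ j ∈ range (b + 1), (b.choose j : ℝ) * (1 / 2) ^ j * ((2 * s).descFactorial j : ℝ) *
      (m.descFactorial (b - j) : ℝ) =
      (b.factorial : ℝ) / 4 ^ s * (((2 * s).choose j : ℝ) * 2 ^ (2 * s - j) * (m.choose (b - j) : ℝ)) := by
    intro j hj
    have hjb : j ≤ b := Nat.lt_succ_iff.mp (mem_range.mp hj)
    rw [Nat.descFactorial_eq_factorial_mul_choose, Nat.descFactorial_eq_factorial_mul_choose]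
    push_cast
    have hb : (b.factorial : ℝ) = b.choose j * j.factorial * (b - j).factorial := by
      rw [← Nat.choose_mul_factorial_mul_factorial hjb]; push_cast; ring
    rw [hb, one_div_pow]
    by_cases hjs : j ≤ 2 * s
    · have : (2 : ℝ) ^ (2 * s - j) = 4 ^ s / 2 ^ j := by
        rw [pow_sub₀ _ (by norm_num) hjs, pow_mul, div_eq_mul_inv]; norm_num
      rw [this]
      field_simp
    · have : ((2 * s).choose j : ℝ) = 0 := by
        rw [Nat.choose_eq_zero_of_lt (by omega)]; simp
      rw [this]; simp
  have key2 : ∀ l ∈ range (b / 2 + 1),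
      ((b.factorial : ℝ) / (l.factorial * (b - 2 * l).factorial)) * (1 / 4) ^ l * (s.descFactorial l : ℝ) *
        ((m + (s - l)).descFactorial (b - 2 * l) : ℝ) =
      (b.factorial : ℝ) / 4 ^ s * ((s.choose l : ℝ) * 4 ^ (s - l) *
        (((m + (s - l)).choose (b - 2 * l) : ℕ) : ℝ)) := by
    intro l hl
    rw [Nat.descFactorial_eq_factorial_mul_choose, Nat.descFactorial_eq_factorial_mul_choose]
    push_cast
    rw [one_div_pow]
    by_cases hls : l ≤ s
    · have : (4 : ℝ) ^ (s - l) = 4 ^ s / 4 ^ l := by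
        rw [pow_sub₀ _ (by norm_num) hls, div_eq_mul_inv]
      rw [this]
      field_simp
    · have : (s.choose l : ℝ) = 0 := by
        rw [Nat.choose_eq_zero_of_lt (by omega)]; simp
      rw [this]; simp
  rw [Finset.sum_congr rfl key, Finset.sum_congr rfl key2, ← Finset.mul_sum, ← Finset.mul_sum, h]
  congr 1
  -- reconcile the index ranges: terms with `2l > b` or `l > s` vanish
  have hvan : ∀ l ∈ range (b / 2 + 1), ¬ l ≤ s →
      (s.choose l : ℝ) * 4 ^ (s - l) * (((m + (s - l)).choose (b - 2 * l) : ℕ) : ℝ) = 0 := by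
    intro l _ hls
    rw [Nat.choose_eq_zero_of_lt (by omega)]; simp
  simp_rw [mul_ite, mul_zero]
  rw [← Finset.sum_filter]
  have hset : (range (s + 1)).filter (fun l => 2 * l ≤ b) =
      (range (b / 2 + 1)).filter (fun l => l ≤ s) := by
    ext l; simp only [mem_filter, mem_range]; omega
  rw [hset, Finset.sum_filter_of_ne]
  intro l hl hne
  by_contra hls
  exact hne (hvan l hl hls)

/-- (★) at natural `s` and `T = m + s`, in the real-product form. [folklore] -/
private theorem real_id_nat (b s m : ℕ) :
    ∑ j ∈ range (b + 1), ((b.choose j : ℝ) * (1 / 2) ^ j * ∏ r ∈ range j, (2 * (s : ℝ) - r)) *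
        ∏ r ∈ range (b - j), (((m : ℝ) + s) - s - r) =
      ∑ l ∈ range (b / 2 + 1), ((b.factorial : ℝ) / (l.factorial * (b - 2 * l).factorial) *
        (1 / 4) ^ l * ∏ r ∈ range l, ((s : ℝ) - r)) * ∏ r ∈ range (b - 2 * l), (((m : ℝ) + s) - l - r) := by
  have hL : ∀ j ∈ range (b + 1),
      ((b.choose j : ℝ) * (1 / 2) ^ j * ∏ r ∈ range j, (2 * (s : ℝ) - r)) *
        ∏ r ∈ range (b - j), (((m : ℝ) + s) - s - r) =
      (b.choose j : ℝ) * (1 / 2) ^ j * ((2 * s).descFactorial j : ℝ) * (m.descFactorial (b - j) : ℝ) := by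
    intro j _
    rw [← prod_range_sub_eq_descFactorial, ← prod_range_sub_eq_descFactorial]
    push_cast
    congr 1
    exact Finset.prod_congr rfl fun r _ => by ring
  have hR : ∀ l ∈ range (b / 2 + 1),
      ((b.factorial : ℝ) / (l.factorial * (b - 2 * l).factorial) * (1 / 4) ^ l *
        ∏ r ∈ range l, ((s : ℝ) - r)) * ∏ r ∈ range (b - 2 * l), (((m : ℝ) + s) - l - r) =
      ((b.factorial : ℝ) / (l.factorial * (b - 2 * l).factorial)) * (1 / 4) ^ l *
        (s.descFactorial l : ℝ) * ((m + (s - l)).descFactorial (b - 2 * l) : ℝ) := by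
    intro l _
    by_cases hls : l ≤ s
    · rw [← prod_range_sub_eq_descFactorial, ← prod_range_sub_eq_descFactorial]
      push_cast [Nat.cast_sub hls]
      congr 1
      exact Finset.prod_congr rfl fun r _ => by ring
    · have h0 : ∏ r ∈ range l, ((s : ℝ) - r) = 0 :=
        Finset.prod_eq_zero (mem_range.mpr (not_le.mp hls)) (by simp)
      have h0' : (s.descFactorial l : ℝ) = 0 := by
        rw [Nat.descFactorial_eq_zero_iff_lt.mpr (not_le.mp hls)]; simp
      rw [h0, h0']; ring
  rw [Finset.sum_congr rfl hL, Finset.sum_congr rfl hR]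
  exact nat_id s m b

/-- (★) at natural `s`, for every real `T` (a polynomial in `T` with infinitely many roots). [folklore] -/
private theorem real_id_nat_s (b s : ℕ) (T : ℝ) :
    ∑ j ∈ range (b + 1), ((b.choose j : ℝ) * (1 / 2) ^ j * ∏ r ∈ range j, (2 * (s : ℝ) - r)) *
        ∏ r ∈ range (b - j), (T - s - r) =
      ∑ l ∈ range (b / 2 + 1), ((b.factorial : ℝ) / (l.factorial * (b - 2 * l).factorial) *
        (1 / 4) ^ l * ∏ r ∈ range l, ((s : ℝ) - r)) * ∏ r ∈ range (b - 2 * l), (T - l - r) := by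
  set p : Polynomial ℝ :=
    ∑ j ∈ range (b + 1), C ((b.choose j : ℝ) * (1 / 2) ^ j * ∏ r ∈ range j, (2 * (s : ℝ) - r)) *
        ∏ r ∈ range (b - j), (X - C (s : ℝ) - C (r : ℝ)) -
      ∑ l ∈ range (b / 2 + 1), C ((b.factorial : ℝ) / (l.factorial * (b - 2 * l).factorial) *
        (1 / 4) ^ l * ∏ r ∈ range l, ((s : ℝ) - r)) * ∏ r ∈ range (b - 2 * l), (X - C (l : ℝ) - C (r : ℝ))
    with hp
  have heval : ∀ x : ℝ, p.eval x =
      ∑ j ∈ range (b + 1), ((b.choose j : ℝ) * (1 / 2) ^ j * ∏ r ∈ range j, (2 * (s : ℝ) - r)) *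
          ∏ r ∈ range (b - j), (x - s - r) -
        ∑ l ∈ range (b / 2 + 1), ((b.factorial : ℝ) / (l.factorial * (b - 2 * l).factorial) *
          (1 / 4) ^ l * ∏ r ∈ range l, ((s : ℝ) - r)) * ∏ r ∈ range (b - 2 * l), (x - l - r) := by
    intro x
    simp only [hp, eval_sub, eval_finsetSum, eval_mul, eval_C, eval_prod, eval_X]
  have hroots : ∀ m : ℕ, p.IsRoot ((m : ℝ) + s) := by
    intro m
    rw [IsRoot.def, heval, sub_eq_zero]
    exact real_id_nat b s m
  have hp0 : p = 0 := by
    apply Polynomial.eq_zero_of_infinite_isRoot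
    refine Set.Infinite.mono ?_ (Set.infinite_range_of_injective (f := fun m : ℕ => (m : ℝ) + s) ?_)
    · rintro _ ⟨m, rfl⟩
      exact hroots m
    · intro a a' h
      have h' : (a : ℝ) = a' := add_right_cancel h
      exact_mod_cast h'
  have h := heval T
  rw [hp0, eval_zero] at h
  linarith

/-- **The half-degree identity** (★): for every natural `b` and all real `s, T`,
`Σ_j C(b,j) 2^{-j} [2s]_j [T-s]_{b-j} = Σ_{l ≤ b/2} b!/(l!(b-2l)!) 4^{-l} [s]_l [T-l]_{b-2l}`, where
`[y]_k = ∏_{r<k}(y-r)`; the right-hand side has degree `≤ ⌊b/2⌋` in `s`.  (Generating function: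
`Σ_b (…) z^b/b! = (1+z/2)^{2s}(1+z)^{T-s} = (1+z)^T (1 + z²/(4(1+z)))^s`.) [folklore] -/
private theorem half_degree_identity (b : ℕ) (s T : ℝ) :
    ∑ j ∈ range (b + 1), ((b.choose j : ℝ) * (1 / 2) ^ j * ∏ r ∈ range j, (2 * s - r)) *
        ∏ r ∈ range (b - j), (T - s - r) =
      ∑ l ∈ range (b / 2 + 1), ((b.factorial : ℝ) / (l.factorial * (b - 2 * l).factorial) *
        (1 / 4) ^ l * ∏ r ∈ range l, (s - r)) * ∏ r ∈ range (b - 2 * l), (T - l - r) := by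
  set q : Polynomial ℝ :=
    ∑ j ∈ range (b + 1), C ((b.choose j : ℝ) * (1 / 2) ^ j) * (∏ r ∈ range j, (C (2:ℝ) * X - C (r : ℝ))) *
        ∏ r ∈ range (b - j), (C T - X - C (r : ℝ)) -
      ∑ l ∈ range (b / 2 + 1), C ((b.factorial : ℝ) / (l.factorial * (b - 2 * l).factorial) *
        (1 / 4) ^ l) * (∏ r ∈ range l, (X - C (r : ℝ))) * C (∏ r ∈ range (b - 2 * l), (T - l - r))
    with hq
  have heval : ∀ x : ℝ, q.eval x =
      ∑ j ∈ range (b + 1), ((b.choose j : ℝ) * (1 / 2) ^ j * ∏ r ∈ range j, (2 * x - r)) *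
          ∏ r ∈ range (b - j), (T - x - r) -
        ∑ l ∈ range (b / 2 + 1), ((b.factorial : ℝ) / (l.factorial * (b - 2 * l).factorial) *
          (1 / 4) ^ l * ∏ r ∈ range l, (x - r)) * ∏ r ∈ range (b - 2 * l), (T - l - r) := by
    intro x
    simp only [hq, eval_sub, eval_finsetSum, eval_mul, eval_C, eval_prod, eval_X]
  have hroots : ∀ n : ℕ, q.IsRoot (n : ℝ) := by
    intro n
    rw [IsRoot.def, heval, sub_eq_zero]
    exact real_id_nat_s b n T
  have hq0 : q = 0 := by
    apply Polynomial.eq_zero_of_infinite_isRoot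
    refine Set.Infinite.mono ?_ (Set.infinite_range_of_injective Nat.cast_injective)
    rintro _ ⟨n, rfl⟩
    exact hroots n
  have h := heval s
  rw [hq0, eval_zero] at h
  linarith

/-- **The half-degree level polynomial.**  For a natural `b` and a real `T` there is a real polynomial
`Q` of degree `≤ ⌊b/2⌋` with `Q(0) = [T]_b` and
`Q(c) = Σ_j C(b,j) 2^{-j} [c]_j [T - c/2]_{b-j}` for every real `c`. [folklore] -/
private theorem exists_halfDegree_poly (b : ℕ) (T : ℝ) :
    ∃ Q : Polynomial ℝ, Q.natDegree ≤ b / 2 ∧ Q.eval 0 = ∏ r ∈ range b, (T - r) ∧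
      ∀ c : ℝ, Q.eval c = ∑ j ∈ range (b + 1), ((b.choose j : ℝ) * (1 / 2) ^ j *
        ∏ r ∈ range j, (c - r)) * ∏ r ∈ range (b - j), (T - c / 2 - r) := by
  refine ⟨∑ l ∈ range (b / 2 + 1), C ((b.factorial : ℝ) / (l.factorial * (b - 2 * l).factorial) *
      (1 / 4) ^ l * ∏ r ∈ range (b - 2 * l), (T - l - r)) * ∏ r ∈ range l, (C (1 / 2 : ℝ) * X - C (r : ℝ)),
    ?_, ?_, ?_⟩
  · -- degree
    refine natDegree_sum_le_of_forall_le _ _ fun l hl => ?_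
    have hlb : l ≤ b / 2 := Nat.lt_succ_iff.mp (mem_range.mp hl)
    have hdeg1 : ∀ r : ℕ, (C (1 / 2 : ℝ) * X - C (r : ℝ)).natDegree ≤ 1 := fun r =>
      calc (C (1 / 2 : ℝ) * X - C (r : ℝ)).natDegree
          ≤ max (C (1 / 2 : ℝ) * X).natDegree (C (r : ℝ)).natDegree := natDegree_sub_le _ _
        _ ≤ 1 := by
            rw [natDegree_C]
            exact max_le ((natDegree_C_mul_le _ _).trans natDegree_X_le) (Nat.zero_le _)
    calc (C ((b.factorial : ℝ) / (l.factorial * (b - 2 * l).factorial) *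
            (1 / 4) ^ l * ∏ r ∈ range (b - 2 * l), (T - l - r)) *
            ∏ r ∈ range l, (C (1 / 2 : ℝ) * X - C (r : ℝ))).natDegree
        ≤ (∏ r ∈ range l, (C (1 / 2 : ℝ) * X - C (r : ℝ))).natDegree := natDegree_C_mul_le _ _
      _ ≤ ∑ r ∈ range l, (C (1 / 2 : ℝ) * X - C (r : ℝ)).natDegree := natDegree_prod_le _ _
      _ ≤ ∑ r ∈ range l, 1 :=
          Finset.sum_le_sum (f := fun r => (C (1 / 2 : ℝ) * X - C (r : ℝ)).natDegree)
            (g := fun _ => 1) fun r _ => hdeg1 r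
      _ = l := by simp
      _ ≤ b / 2 := hlb
  · -- value at 0
    rw [eval_finsetSum, Finset.sum_eq_single 0]
    · rw [eval_mul, eval_C, Finset.range_zero, Finset.prod_empty, eval_one, mul_one]
      simp only [Nat.factorial_zero, Nat.cast_one, one_mul, Nat.mul_zero, Nat.sub_zero, pow_zero,
        mul_one, Nat.cast_zero, sub_zero]
      rw [div_self (Nat.cast_ne_zero.mpr (Nat.factorial_ne_zero b)), one_mul]
    · intro l hl hl0
      rw [eval_mul, eval_prod]
      have : ∏ r ∈ range l, eval 0 (C (1 / 2 : ℝ) * X - C (r : ℝ)) = 0 :=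
        Finset.prod_eq_zero (mem_range.mpr (Nat.pos_of_ne_zero hl0)) (by simp)
      rw [this, mul_zero]
    · intro h; exact absurd (mem_range.mpr (Nat.succ_pos _)) h
  · intro c
    have h := half_degree_identity b (c / 2) T
    have e : ∀ j, ∏ r ∈ range j, (2 * (c / 2) - (r : ℝ)) = ∏ r ∈ range j, (c - r) := fun j =>
      Finset.prod_congr rfl fun r _ => by ring
    simp_rw [e] at h
    rw [h, eval_finsetSum]
    refine Finset.sum_congr rfl fun l _ => ?_
    rw [eval_mul, eval_C, eval_prod]
    simp only [eval_sub, eval_mul, eval_C, eval_X]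
    have e2 : ∏ r ∈ range l, (1 / 2 * c - (r : ℝ)) = ∏ r ∈ range l, (c / 2 - r) :=
      Finset.prod_congr rfl fun r _ => by ring
    rw [e2]
    ring

end HalfDegreeAlgebra

section HalfDegreeEvent

variable {V : Type*} [DecidableEq V]

/-- A vertex of `e` inside `B` makes `cutCount B e ≥ 1`. [folklore] -/
private theorem one_le_cutCount_of_mem {B : Finset V} {e : Sym2 V} {a : V} (hae : a ∈ e) (haB : a ∈ B) :
    1 ≤ cutCount B e := by
  induction e using Sym2.ind with
  | h p q =>
    rw [cutCount_mk]
    rcases Sym2.mem_iff.mp hae with rfl | rfl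
    · rw [if_pos haB]; omega
    · rw [if_pos haB]; omega

/-- For `B ⊇ A₀` every window edge (edge of `M` meeting `A₀`) is crossing or internal for `B`:
`y_B + z_B = x`. [folklore] -/
private theorem card_cr_add_card_in_window {M : Finset (Sym2 V)} {A₀ B : Finset V} (hAB : A₀ ⊆ B) :
    ((M.filter fun e => ∃ a ∈ A₀, a ∈ e).filter fun e => cutCount B e = 1).card +
      ((M.filter fun e => ∃ a ∈ A₀, a ∈ e).filter fun e => cutCount B e = 2).card =
      (M.filter fun e => ∃ a ∈ A₀, a ∈ e).card := by
  rw [← card_union_of_disjoint (disjoint_filter.2 fun e _ h1 h2 => by omega), ← filter_or]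
  congr 1
  refine filter_true_of_mem fun e he => ?_
  obtain ⟨-, a, haA, hae⟩ := mem_filter.1 he
  have h1 := one_le_cutCount_of_mem hae (hAB haA)
  have h2 := cutCount_le_two B e
  omega

/-- **Containment events have knapsack-moment virtual value — half-degree form** (cell pnp-psdrank,
MEMO-20 §2(c)): for a perfect matching `M` of `S` with `N` edges, `A₀ ⊆ S` meeting `x` edges of `M`,
and `t`, there is a real polynomial `P` of degree `≤ ⌊|A₀|/2⌋` (not merely `≤ x`) with
`P(0) = knapsackMoment N (t/2) x` such that for all levels `c + 2i = t`,
`#{U ⊆ S : c crossing, i internal, A₀ ⊆ U} = T(N; c, i)·P(c)`.  (Sum of the pattern law over the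
traces `B ⊇ A₀` on the window, regrouped by `|B ∖ A₀|`, and the half-degree identity.)
[cite: Grigoriev2001, §1 (PDF p. 8)] -/
theorem subset_event_poly_sharp {S : Finset V} {M : Finset (Sym2 V)} (hM : IsPMOn S M) {A₀ : Finset V}
    (hA₀ : A₀ ⊆ S) (t : ℕ) :
    ∃ P : Polynomial ℝ, P.natDegree ≤ A₀.card / 2 ∧
      P.eval 0 = knapsackMoment M.card ((t : ℝ) / 2) (M.filter fun e => ∃ a ∈ A₀, a ∈ e).card ∧
      ∀ c i : ℕ, c + 2 * i = t →
        (((S.powerset.filter fun U => (M.filter fun e => cutCount U e = 1).card = c ∧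
            (M.filter fun e => cutCount U e = 2).card = i ∧ A₀ ⊆ U).card : ℕ) : ℝ) =
          ((M.card.choose (c + i) * (c + i).choose i * 2 ^ c : ℕ) : ℝ) * P.eval (c : ℝ) := by
  classical
  set E := M.filter (fun e => ∃ a ∈ A₀, a ∈ e) with hE
  set W := S.filter (fun v => ∃ e ∈ E, v ∈ e) with hW
  have hEM : E ⊆ M := filter_subset _ _
  have hxN : E.card ≤ M.card := card_le_card hEM
  have hWE : IsPMOn W E := isPMOn_verts hM hEM
  have hA₀W : A₀ ⊆ W := by
    intro a ha
    obtain ⟨e, he, hae⟩ := hM.exists_mem (hA₀ ha)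
    exact mem_filter.2 ⟨hA₀ ha, e, mem_filter.2 ⟨he, a, ha, hae⟩, hae⟩
  have hyz : ∀ B : Finset V, (E.filter fun e => cutCount B e = 1).card +
      (E.filter fun e => cutCount B e = 2).card ≤ E.card := by
    intro B
    rw [← card_union_of_disjoint (disjoint_filter.2 fun e _ h1 h2 => by omega)]
    exact card_le_card (union_subset (filter_subset _ _) (filter_subset _ _))
  -- window parameters: `a` window edges inside `A₀`, `b` meeting it once; `x = a + b`, `|A₀| = b + 2a`
  set a := (E.filter fun e => cutCount A₀ e = 2).card with ha
  set b := (E.filter fun e => cutCount A₀ e = 1).card with hb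
  have hab : b + a = E.card := card_cr_add_card_in_window (M := M) (Subset.refl A₀)
  have hA₀card : A₀.card = b + 2 * a := card_eq_cr_add_two_mul_in hWE hA₀W
  have hWcard : 2 * E.card = W.card := two_mul_card_eq hWE
  -- trace parameters depend only on `|B|`
  have htr : ∀ B, A₀ ⊆ B → B ⊆ W →
      (E.filter fun e => cutCount B e = 1).card = b - (B.card - A₀.card) ∧
      (E.filter fun e => cutCount B e = 2).card = a + (B.card - A₀.card) ∧
      B.card - A₀.card ≤ b := by
    intro B hAB hBW
    have h1 : (E.filter fun e => cutCount B e = 1).card + (E.filter fun e => cutCount B e = 2).card =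
        E.card := card_cr_add_card_in_window (M := M) hAB
    have h2 := card_eq_cr_add_two_mul_in hWE hBW
    have h3 := card_le_card hAB
    omega
  -- the half-degree polynomial and the answer
  obtain ⟨Q, hQdeg, hQ0, hQeval⟩ := exists_halfDegree_poly b ((t : ℝ) / 2 - a)
  have hNx : (0 : ℝ) < (M.card.descFactorial E.card : ℝ) := by
    have : M.card.descFactorial E.card ≠ 0 := fun h0 => by
      rw [Nat.descFactorial_eq_zero_iff_lt] at h0; omega
    positivity
  have hsplit : ∀ θ : ℝ, ∏ j ∈ range E.card, (θ - j) =
      (∏ j ∈ range a, (θ - j)) * ∏ r ∈ range b, (θ - a - r) := by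
    intro θ
    rw [← hab, add_comm, Finset.prod_range_add]
    push_cast
    exact congrArg _ (Finset.prod_congr rfl fun r _ => by ring)
  refine ⟨C ((M.card.descFactorial E.card : ℝ)⁻¹) *
      (∏ j ∈ range a, (C ((t : ℝ) / 2 - j) - C (1 / 2) * X)) * Q, ?_, ?_, ?_⟩
  · -- degree `≤ a + ⌊b/2⌋ = ⌊|A₀|/2⌋`
    have hdeg1 : ∀ j : ℕ, (C ((t : ℝ) / 2 - j) - C (1 / 2 : ℝ) * X).natDegree ≤ 1 := fun j =>
      calc (C ((t : ℝ) / 2 - j) - C (1 / 2 : ℝ) * X).natDegree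
          ≤ max (C ((t : ℝ) / 2 - j)).natDegree (C (1 / 2 : ℝ) * X).natDegree := natDegree_sub_le _ _
        _ ≤ 1 := by
            rw [natDegree_C]
            exact max_le (Nat.zero_le _) ((natDegree_C_mul_le _ _).trans natDegree_X_le)
    have hprod : (∏ j ∈ range a, (C ((t : ℝ) / 2 - j) - C (1 / 2 : ℝ) * X)).natDegree ≤ a :=
      calc (∏ j ∈ range a, (C ((t : ℝ) / 2 - j) - C (1 / 2 : ℝ) * X)).natDegree
          ≤ ∑ j ∈ range a, (C ((t : ℝ) / 2 - j) - C (1 / 2 : ℝ) * X).natDegree := natDegree_prod_le _ _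
        _ ≤ ∑ j ∈ range a, 1 :=
            Finset.sum_le_sum (f := fun j : ℕ => (C ((t : ℝ) / 2 - j) - C (1 / 2 : ℝ) * X).natDegree)
              (g := fun _ => 1) fun j _ => hdeg1 j
        _ = a := by simp
    calc (C ((M.card.descFactorial E.card : ℝ)⁻¹) *
          (∏ j ∈ range a, (C ((t : ℝ) / 2 - j) - C (1 / 2) * X)) * Q).natDegree
        ≤ (C ((M.card.descFactorial E.card : ℝ)⁻¹) *
            ∏ j ∈ range a, (C ((t : ℝ) / 2 - j) - C (1 / 2) * X)).natDegree + Q.natDegree :=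
          natDegree_mul_le
      _ ≤ a + b / 2 := add_le_add ((natDegree_C_mul_le _ _).trans hprod) hQdeg
      _ = A₀.card / 2 := by rw [hA₀card]; omega
  · -- value at the virtual level
    rw [eval_mul, eval_mul, eval_C, eval_prod, hQ0, knapsackMoment, prod_div_distrib,
      ← cast_descFactorial_eq_prod hxN, hsplit, eq_div_iff hNx.ne']
    simp only [eval_sub, eval_C, eval_mul, eval_X, mul_zero, sub_zero]
    field_simp
  · intro c i hci
    -- fibrewise over the trace on `W` (as in `subset_event_poly`)
    have hfib : ((S.powerset.filter fun U => (M.filter fun e => cutCount U e = 1).card = c ∧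
          (M.filter fun e => cutCount U e = 2).card = i ∧ A₀ ⊆ U).card : ℕ) =
        ∑ B ∈ W.powerset.filter (fun B => A₀ ⊆ B), (S.powerset.filter fun U =>
          (M.filter fun e => cutCount U e = 1).card = c ∧ (M.filter fun e => cutCount U e = 2).card = i ∧
            U ∩ W = B).card := by
      rw [card_eq_sum_card_fiberwise (f := fun U => U ∩ W) (t := W.powerset.filter fun B => A₀ ⊆ B)]
      · refine sum_congr rfl fun B hB => ?_
        obtain ⟨-, hA₀B⟩ := mem_filter.1 hB
        rw [filter_filter]
        congr 1
        refine filter_congr fun U _ => ?_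
        constructor
        · rintro ⟨⟨hc, hi, -⟩, hUW⟩; exact ⟨hc, hi, hUW⟩
        · rintro ⟨hc, hi, hUW⟩; exact ⟨⟨hc, hi, fun a ha => (mem_inter.1 (hUW.symm ▸ hA₀B ha)).1⟩, hUW⟩
      · intro U hU
        obtain ⟨-, -, -, hA₀U⟩ := mem_filter.1 hU
        exact mem_filter.2 ⟨mem_powerset.2 inter_subset_right, fun a ha => mem_inter.2 ⟨hA₀U ha, hA₀W ha⟩⟩
    -- the value of each fibre as a function of `d = |B| - |A₀|`
    set g : ℕ → ℝ := fun d =>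
      (((2 : ℝ) ^ (b - d) * (M.card.descFactorial E.card : ℝ))⁻¹ *
        (∏ j ∈ range (b - d), ((c : ℝ) - j))) *
        (∏ j ∈ range (a + d), ((t : ℝ) / 2 - j - 1 / 2 * c)) *
        ∏ j ∈ range (E.card - (b - d) - (a + d)), ((M.card : ℝ) - (t : ℝ) / 2 - j - 1 / 2 * c) with hg
    have hterm : ∀ B ∈ W.powerset.filter (fun B => A₀ ⊆ B),
        (((S.powerset.filter fun U =>
          (M.filter fun e => cutCount U e = 1).card = c ∧ (M.filter fun e => cutCount U e = 2).card = i ∧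
            U ∩ W = B).card : ℕ) : ℝ) =
          ((M.card.choose (c + i) * (c + i).choose i * 2 ^ c : ℕ) : ℝ) * g (B.card - A₀.card) := by
      intro B hB
      obtain ⟨hBW, hAB⟩ := mem_filter.1 hB
      rw [mem_powerset] at hBW
      obtain ⟨hy, hz, -⟩ := htr B hAB hBW
      rw [card_fiber_eq hM hEM hBW c i, (pattern_poly_explicit M.card t hxN (hyz B)).2.2 c i hci, hy, hz]
      congr 1
      simp only [hg, eval_mul, eval_C, eval_prod, eval_sub, eval_X]
    rw [hfib, Nat.cast_sum, sum_congr rfl hterm, ← mul_sum]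
    congr 1
    -- regroup the traces by `d = |B ∖ A₀|`
    have hWA : (W \ A₀).card = b := by
      rw [card_sdiff_of_subset hA₀W]; omega
    have hregroup : ∑ B ∈ W.powerset.filter (fun B => A₀ ⊆ B), g (B.card - A₀.card) =
        ∑ d ∈ range (b + 1), (b.choose d : ℝ) * g d := by
      calc ∑ B ∈ W.powerset.filter (fun B => A₀ ⊆ B), g (B.card - A₀.card)
          = ∑ D ∈ (W \ A₀).powerset, g D.card := by
            refine Finset.sum_nbij' (fun B => B \ A₀) (fun D => D ∪ A₀) ?_ ?_ ?_ ?_ ?_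
            · intro B hB
              exact mem_powerset.2 (sdiff_subset_sdiff (mem_powerset.1 (mem_filter.1 hB).1) Subset.rfl)
            · intro D hD
              exact mem_filter.2 ⟨mem_powerset.2 (union_subset ((mem_powerset.1 hD).trans sdiff_subset) hA₀W),
                subset_union_right⟩
            · intro B hB
              exact sdiff_union_of_subset (mem_filter.1 hB).2
            · intro D hD
              exact union_sdiff_cancel_right (disjoint_of_subset_left (mem_powerset.1 hD) sdiff_disjoint)
            · intro B hB
              rw [card_sdiff_of_subset (mem_filter.1 hB).2]
        _ = ∑ d ∈ range ((W \ A₀).card + 1), ((W \ A₀).card.choose d) • g d :=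
            Finset.sum_powerset_apply_card g
        _ = ∑ d ∈ range (b + 1), (b.choose d : ℝ) * g d := by
            rw [hWA]
            exact sum_congr rfl fun d _ => nsmul_eq_mul _ _
    rw [hregroup]
    -- the algebra: reflect `d ↦ b - d`, split the internal product, apply the half-degree identity
    rw [eval_mul, eval_mul, eval_C, eval_prod, hQeval]
    simp only [eval_sub, eval_C, eval_mul, eval_X]
    rw [← Finset.sum_range_reflect, Finset.mul_sum]
    refine sum_congr rfl fun j hj => ?_
    have hjb : j ≤ b := Nat.lt_succ_iff.mp (mem_range.mp hj)
    have e1 : b + 1 - 1 - j = b - j := by omega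
    rw [e1, Nat.choose_symm hjb, hg]
    simp only
    have e2 : b - (b - j) = j := Nat.sub_sub_self hjb
    have e3 : E.card - j - (a + (b - j)) = 0 := by omega
    rw [e2, e3, range_zero, prod_empty, mul_one, Finset.prod_range_add]
    push_cast
    have e4 : ∏ r ∈ range (b - j), ((t : ℝ) / 2 - ((a : ℝ) + r) - 1 / 2 * c) =
        ∏ r ∈ range (b - j), ((t : ℝ) / 2 - a - c / 2 - r) :=
      prod_congr rfl fun r _ => by ring
    rw [e4, mul_inv, ← inv_pow, show ((2 : ℝ)⁻¹) = 1 / 2 by norm_num]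
    ring

end HalfDegreeEvent

section HalfDegreeLaw

open Matrix Literature.Combinatorics.Optimization
open scoped MatrixOrder

variable {n : ℕ}

/-- **Level sums of linear combinations of containment events — half-degree form**: as
`containment_comb_poly`, with `deg P ≤ d` as soon as every `⌊|D_s|/2⌋ ≤ d`. [folklore] -/
private theorem containment_comb_poly_sharp (M : PMatch n) (t d : ℕ) {σ : Type*} [Fintype σ] (β : σ → ℝ)
    (Dset : σ → Finset (Fin n)) (hD : ∀ s, (Dset s).card / 2 ≤ d) :
    ∃ P : Polynomial ℝ, P.natDegree ≤ d ∧
      P.eval 0 = ∑ s, β s * knapsackMoment M.1.card ((t : ℝ) / 2) (M.1.filter fun e => ∃ a ∈ Dset s, a ∈ e).card ∧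
      ∀ c i : ℕ, c + 2 * i = t →
        ∑ U ∈ (univ : Finset (Fin n)).powerset.filter (fun U =>
            (M.1.filter fun e => cutCount U e = 1).card = c ∧ (M.1.filter fun e => cutCount U e = 2).card = i),
          (∑ s, β s * (if Dset s ⊆ U then (1 : ℝ) else 0)) =
          ((M.1.card.choose (c + i) * (c + i).choose i * 2 ^ c : ℕ) : ℝ) * P.eval (c : ℝ) := by
  have hP : ∀ s : σ, ∃ P : Polynomial ℝ, P.natDegree ≤ (Dset s).card / 2 ∧
      P.eval 0 = knapsackMoment M.1.card ((t : ℝ) / 2) (M.1.filter fun e => ∃ a ∈ Dset s, a ∈ e).card ∧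
      ∀ c i : ℕ, c + 2 * i = t →
        ((((univ : Finset (Fin n)).powerset.filter fun U => (M.1.filter fun e => cutCount U e = 1).card = c ∧
            (M.1.filter fun e => cutCount U e = 2).card = i ∧ Dset s ⊆ U).card : ℕ) : ℝ) =
          ((M.1.card.choose (c + i) * (c + i).choose i * 2 ^ c : ℕ) : ℝ) * P.eval (c : ℝ) := by
    intro s
    obtain ⟨P, h1, h2, h3⟩ := subset_event_poly_sharp M.2 (subset_univ (Dset s)) t
    exact ⟨P, h1, by convert h2 using 4, fun c i hci => by convert h3 c i hci using 5⟩
  choose P hPdeg hP0 hPval using hP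
  refine ⟨∑ s, C (β s) * P s, ?_, ?_, ?_⟩
  · exact natDegree_sum_le_of_forall_le _ _ fun s _ => (natDegree_C_mul_le _ _).trans ((hPdeg s).trans (hD s))
  · rw [eval_finsetSum]
    exact sum_congr rfl fun s _ => by rw [eval_mul, eval_C, hP0 s]
  · intro c i hci
    rw [sum_comm, eval_finsetSum, mul_sum]
    refine sum_congr rfl fun s _ => ?_
    rw [← mul_sum, ← sum_filter, sum_const, nsmul_eq_mul, mul_one, filter_filter, eval_mul, eval_C]
    have hset : ((univ : Finset (Fin n)).powerset.filter fun U =>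
          ((M.1.filter fun e => cutCount U e = 1).card = c ∧ (M.1.filter fun e => cutCount U e = 2).card = i) ∧
            Dset s ⊆ U) =
        (univ : Finset (Fin n)).powerset.filter fun U => (M.1.filter fun e => cutCount U e = 1).card = c ∧
          (M.1.filter fun e => cutCount U e = 2).card = i ∧ Dset s ⊆ U :=
      filter_congr fun U _ => and_assoc
    rw [hset, hPval s c i hci]
    ring

/-- **Low-degree sum law per matching — half-degree form** (cell pnp-psdrank MEMO-20 §2(c)): as
`lowdeg_sum_law`, for entries that are combinations of containment indicators `1[A' ⊆ U]` with
`|A'| ≤ k`, but with the level polynomial of degree `≤ k` (instead of `2k`): the product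
`1[A' ⊆ U]1[A'' ⊆ U] = 1[A' ∪ A'' ⊆ U]` has a level polynomial of degree `⌊|A' ∪ A''|/2⌋ ≤ k`
(`subset_event_poly_sharp`).  Same virtual value, hence `≥ 0` under Grigoriev's Lemma 1.4.
[cite: Grigoriev2001, Lemma 1.4 (PDF p. 8)] -/
theorem lowdeg_sum_law_sharp (hG : Grigoriev2001_knapsackFormNonneg) (M : PMatch n) {t k r m : ℕ}
    (hk : 2 * k ≤ M.1.card) (hr₁ : (k : ℝ) - 1 < (t : ℝ) / 2) (hr₂ : (t : ℝ) / 2 < (M.1.card : ℝ) - k + 1)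
    (α : Fin r → Fin m → {A' : Finset (Fin n) // A'.card ≤ k} → ℝ) (Y : Matrix (Fin r) (Fin r) ℝ)
    (hY : Y.PosSemidef) :
    ∃ P : Polynomial ℝ, P.natDegree ≤ k ∧ 0 ≤ P.eval 0 ∧ ∀ c i : ℕ, c + 2 * i = t →
      ∑ U ∈ (univ : Finset (Fin n)).powerset.filter (fun U =>
          (M.1.filter fun e => cutCount U e = 1).card = c ∧ (M.1.filter fun e => cutCount U e = 2).card = i),
        ∑ j, ∑ a, ∑ b, Y b a *
          ((∑ A' : {A' : Finset (Fin n) // A'.card ≤ k}, α a j A' * (if A'.1 ⊆ U then (1 : ℝ) else 0)) *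
           (∑ A'' : {A' : Finset (Fin n) // A'.card ≤ k}, α b j A'' * (if A''.1 ⊆ U then (1 : ℝ) else 0))) =
        ((M.1.card.choose (c + i) * (c + i).choose i * 2 ^ c : ℕ) : ℝ) * P.eval (c : ℝ) := by
  -- as in `lowdeg_sum_law`, with the sharp combination law supplying the degree
  obtain ⟨P, hPdeg, hP0, hPval⟩ := containment_comb_poly_sharp M t k
    (σ := Fin m × Fin r × Fin r × {A' : Finset (Fin n) // A'.card ≤ k} × {A' : Finset (Fin n) // A'.card ≤ k})
    (fun s => Y s.2.2.1 s.2.1 * (α s.2.1 s.1 s.2.2.2.1 * α s.2.2.1 s.1 s.2.2.2.2))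
    (fun s => s.2.2.2.1.1 ∪ s.2.2.2.2.1)
    (fun s => by
      have h2 := card_union_le s.2.2.2.1.1 s.2.2.2.2.1
      have h3 := s.2.2.2.1.2
      have h4 := s.2.2.2.2.2
      omega)
  -- the level sums of `P` coincide with those of `P₀`
  have hlevels : ∀ c i : ℕ, c + 2 * i = t →
      ∑ U ∈ (univ : Finset (Fin n)).powerset.filter (fun U =>
          (M.1.filter fun e => cutCount U e = 1).card = c ∧ (M.1.filter fun e => cutCount U e = 2).card = i),
        ∑ j, ∑ a, ∑ b, Y b a *
          ((∑ A' : {A' : Finset (Fin n) // A'.card ≤ k}, α a j A' * (if A'.1 ⊆ U then (1 : ℝ) else 0)) *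
           (∑ A'' : {A' : Finset (Fin n) // A'.card ≤ k}, α b j A'' * (if A''.1 ⊆ U then (1 : ℝ) else 0))) =
        ((M.1.card.choose (c + i) * (c + i).choose i * 2 ^ c : ℕ) : ℝ) * P.eval (c : ℝ) := by
    intro c i hci
    rw [← hPval c i hci]
    refine sum_congr rfl fun U _ => ?_
    simp only [Fintype.sum_prod_type]
    refine sum_congr rfl fun j _ => sum_congr rfl fun a _ => sum_congr rfl fun b _ => ?_
    rw [Finset.sum_mul_sum, mul_sum]
    refine sum_congr rfl fun A' _ => ?_
    rw [mul_sum]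
    refine sum_congr rfl fun A'' _ => ?_
    rw [← ite_subset_mul_ite_subset]
    ring
  refine ⟨P, hPdeg, ?_, hlevels⟩
  -- the virtual value is a sum of knapsack forms (verbatim from `lowdeg_sum_law`)
  rw [hP0]
  obtain ⟨S, hS⟩ := exists_gram_of_posSemidef hY
  simp only [Fintype.sum_prod_type]
  refine sum_nonneg fun j _ => ?_
  rw [sum_comm_four]
  have hre : ∀ (A' A'' : {A' : Finset (Fin n) // A'.card ≤ k}),
      ∑ a, ∑ b, Y b a * (α a j A' * α b j A'') *
          knapsackMoment M.1.card ((t : ℝ) / 2) (M.1.filter fun e => ∃ x ∈ A'.1 ∪ A''.1, x ∈ e).card =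
        ∑ l, (∑ a, S l a * α a j A') * (∑ b, S l b * α b j A'') *
          knapsackMoment M.1.card ((t : ℝ) / 2) (M.1.filter fun e => ∃ x ∈ A'.1 ∪ A''.1, x ∈ e).card := by
    intro A' A''
    calc ∑ a, ∑ b, Y b a * (α a j A' * α b j A'') *
            knapsackMoment M.1.card ((t : ℝ) / 2) (M.1.filter fun e => ∃ x ∈ A'.1 ∪ A''.1, x ∈ e).card
        = ∑ a, ∑ b, ∑ l, (S l a * α a j A') * (S l b * α b j A'') *
            knapsackMoment M.1.card ((t : ℝ) / 2) (M.1.filter fun e => ∃ x ∈ A'.1 ∪ A''.1, x ∈ e).card := by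
          refine sum_congr rfl fun a _ => sum_congr rfl fun b _ => ?_
          rw [hS a b, sum_mul, sum_mul]
          exact sum_congr rfl fun l _ => by ring
      _ = ∑ a, ∑ l, ∑ b, (S l a * α a j A') * (S l b * α b j A'') *
            knapsackMoment M.1.card ((t : ℝ) / 2) (M.1.filter fun e => ∃ x ∈ A'.1 ∪ A''.1, x ∈ e).card :=
          sum_congr rfl fun a _ => Finset.sum_comm
      _ = ∑ l, ∑ a, ∑ b, (S l a * α a j A') * (S l b * α b j A'') *
            knapsackMoment M.1.card ((t : ℝ) / 2) (M.1.filter fun e => ∃ x ∈ A'.1 ∪ A''.1, x ∈ e).card :=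
          Finset.sum_comm
      _ = ∑ l, (∑ a, S l a * α a j A') * (∑ b, S l b * α b j A'') *
            knapsackMoment M.1.card ((t : ℝ) / 2) (M.1.filter fun e => ∃ x ∈ A'.1 ∪ A''.1, x ∈ e).card := by
          refine sum_congr rfl fun l _ => ?_
          rw [Finset.sum_mul_sum, Finset.sum_mul]
          refine sum_congr rfl fun a _ => ?_
          rw [Finset.sum_mul]
  rw [sum_congr rfl fun A' _ => sum_congr rfl fun A'' _ => hre A' A'']
  rw [sum_congr rfl fun A' _ => Finset.sum_comm, Finset.sum_comm]
  refine sum_nonneg fun l _ => ?_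
  exact virtualForm_nonneg hG M hk hr₁ hr₂ (fun A' => ∑ a, S l a * α a j A')

/-- **Low-degree cut-side factors have nonpositive design value — half-degree form** (cell
pnp-psdrank MEMO-20 §2(c)): as `sum_levelWeight_trace_nonpos_of_lowDegree`, but the cut-side factors may
have Johnson degree `k` up to the FULL design degree (`k ≤ D` instead of `2k ≤ D`) and up to Grigoriev's
positivity range (`2k ≤ t + 1` instead of `4k ≤ t`), because the level polynomial of a product of two
degree-`k` containment indicators has degree `≤ k` (`lowdeg_sum_law_sharp`).
[cite: Grigoriev2001, Lemma 1.4 (PDF p. 8)] -/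
theorem sum_levelWeight_trace_nonpos_of_lowDegree_sharp (hG : Grigoriev2001_knapsackFormNonneg)
    {t T D : ℕ} {Bv : ℝ} {C : Finset ℕ} {w : ℕ → ℝ} (hdes : IsExactDesign n t T D Bv C w)
    {r m k : ℕ} (hkD : k ≤ D) (h2k1 : 2 * k ≤ t + 1)
    (A : OddSet n → Matrix (Fin r) (Fin m) ℝ) (hA : IsLowDegreeU n k A)
    (Y : PMatch n → Matrix (Fin r) (Fin r) ℝ) (hYpsd : ∀ M, (Y M).PosSemidef) :
    ∑ U, ∑ M, levelWeight n t C w U M * (A U * (A U)ᵀ * Y M).trace ≤ 0 := by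
  obtain ⟨htodd, htn, hTt, hC, -, hexact, -⟩ := hdes
  -- coefficients of the low-degree entries
  have hα' : ∀ a j, ∃ c : {A' : Finset (Fin n) // A'.card ≤ k} → ℝ,
      ∑ A', c A' • (fun U : OddSet n => if A'.1 ⊆ U.1 then (1 : ℝ) else 0) = fun U => A U a j :=
    fun a j => (Submodule.mem_span_range_iff_exists_fun ℝ).1 (hA a j)
  choose α hα using hα'
  have hAeval : ∀ (U : OddSet n) a j,
      A U a j = ∑ A' : {A' : Finset (Fin n) // A'.card ≤ k}, α a j A' * (if A'.1 ⊆ U.1 then (1 : ℝ) else 0) := by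
    intro U a j
    have := congrFun (hα a j) U
    rw [Finset.sum_apply] at this
    rw [← this]
    exact sum_congr rfl fun A' _ => by rw [Pi.smul_apply, smul_eq_mul]
  have hXpsd : ∀ U : OddSet n, (A U * (A U)ᵀ).PosSemidef := fun U => by
    simpa [Matrix.conjTranspose_eq_transpose_of_trivial] using Matrix.posSemidef_self_mul_conjTranspose (A U)
  have htr : ∀ (U : OddSet n) (M : PMatch n), 0 ≤ (A U * (A U)ᵀ * Y M).trace := fun U M =>
    (show HasPsdFactorization (fun U M => (A U * (A U)ᵀ * Y M).trace) r from
      ⟨fun U => A U * (A U)ᵀ, Y, hXpsd, hYpsd, fun _ _ => rfl⟩).nonneg U M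
  -- Step 1: the value as level sums
  have hval : ∑ U, ∑ M, levelWeight n t C w U M * (A U * (A U)ᵀ * Y M).trace =
      ∑ c ∈ C, w c / ((Qset n t c).card : ℝ) *
        ∑ M : PMatch n, ∑ U : OddSet n,
          (if U.1.card = t ∧ cc U M = c then (A U * (A U)ᵀ * Y M).trace else 0) := by
    calc ∑ U, ∑ M, levelWeight n t C w U M * (A U * (A U)ᵀ * Y M).trace
        = ∑ U, ∑ M, ∑ c ∈ C, (if (U, M) ∈ Qset n t c then
            w c / ((Qset n t c).card : ℝ) * (A U * (A U)ᵀ * Y M).trace else 0) := by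
          refine sum_congr rfl fun U _ => sum_congr rfl fun M _ => ?_
          rw [levelWeight, sum_mul]
          exact sum_congr rfl fun c _ => by split_ifs <;> simp
      _ = ∑ U, ∑ c ∈ C, ∑ M, (if (U, M) ∈ Qset n t c then
            w c / ((Qset n t c).card : ℝ) * (A U * (A U)ᵀ * Y M).trace else 0) := sum_congr rfl fun U _ => sum_comm
      _ = ∑ c ∈ C, ∑ U, ∑ M, (if (U, M) ∈ Qset n t c then
            w c / ((Qset n t c).card : ℝ) * (A U * (A U)ᵀ * Y M).trace else 0) := sum_comm
      _ = ∑ c ∈ C, w c / ((Qset n t c).card : ℝ) *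
            ∑ M : PMatch n, ∑ U : OddSet n,
              (if U.1.card = t ∧ cc U M = c then (A U * (A U)ᵀ * Y M).trace else 0) := by
          refine sum_congr rfl fun c _ => ?_
          rw [mul_sum, sum_comm]
          refine sum_congr rfl fun M _ => ?_
          rw [mul_sum]
          refine sum_congr rfl fun U _ => ?_
          simp only [mem_Qset_iff]
          split_ifs <;> simp
  -- Step 2: per matching, the polynomial from the low-degree sum law
  have hN : ∀ M : PMatch n, M.1.card = n / 2 := fun M => by have := two_mul_card_pmatch M; omega
  have hP : ∀ M : PMatch n, ∃ P : Polynomial ℝ, P.natDegree ≤ D ∧ 0 ≤ P.eval 0 ∧ ∀ c i : ℕ, c + 2 * i = t →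
      ∑ U : OddSet n, (if U.1.card = t ∧ cc U M = c then (A U * (A U)ᵀ * Y M).trace else 0) =
        (((n / 2).choose (c + i) * (c + i).choose i * 2 ^ c : ℕ) : ℝ) * P.eval (c : ℝ) := by
    intro M
    have hMt : t + 1 ≤ M.1.card := by have := two_mul_card_pmatch M; omega
    have hk : 2 * k ≤ M.1.card := by omega
    have hr₁ : (k : ℝ) - 1 < (t : ℝ) / 2 := by
      have : (2 : ℝ) * k ≤ t + 1 := by exact_mod_cast h2k1
      linarith
    have hr₂ : (t : ℝ) / 2 < (M.1.card : ℝ) - k + 1 := by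
      have h1 : (2 : ℝ) * k ≤ t + 1 := by exact_mod_cast h2k1
      have h2 : (t : ℝ) + 1 ≤ M.1.card := by exact_mod_cast hMt
      linarith
    obtain ⟨P, hPdeg, hP0, hPval⟩ := lowdeg_sum_law_sharp hG M hk hr₁ hr₂ α (Y M) (hYpsd M)
    refine ⟨P, hPdeg.trans hkD, hP0, fun c i hci => ?_⟩
    rw [sum_oddSet_level_eq M hci (fun U => A U * (A U)ᵀ) Y, ← hN M, ← hPval c i hci]
    refine sum_congr rfl fun U' hU' => ?_
    have hodd : Odd U'.card := by
      obtain ⟨-, hc, hi⟩ := mem_filter.1 hU'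
      have h := card_eq_cr_add_two_mul_in M.2 (subset_univ U')
      rw [hc, hi, hci] at h
      exact h ▸ htodd
    rw [dif_pos hodd, trace_mul_transpose_mul_eq]
    refine sum_congr rfl fun j _ => sum_congr rfl fun a _ => sum_congr rfl fun b _ => ?_
    rw [hAeval ⟨U', hodd⟩ a j, hAeval ⟨U', hodd⟩ b j]
  choose P hPdeg hP0 hPval using hP
  -- Step 3: |Q_c| = #PM · T(n/2; c, i)
  have hQ : ∀ c i : ℕ, c + 2 * i = t → ((Qset n t c).card : ℝ) =
      (Fintype.card (PMatch n) : ℝ) * (((n / 2).choose (c + i) * (c + i).choose i * 2 ^ c : ℕ) : ℝ) := by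
    intro c i hci
    have e1 : ((Qset n t c).card : ℝ) =
        ∑ M : PMatch n, ∑ U : OddSet n, (if U.1.card = t ∧ cc U M = c then (1 : ℝ) else 0) := by
      rw [Qset, Finset.card_filter, Nat.cast_sum, Fintype.sum_prod_type, sum_comm]
      refine sum_congr rfl fun M _ => sum_congr rfl fun U _ => ?_
      split_ifs <;> simp
    have e2 : ∀ M : PMatch n, ∑ U : OddSet n, (if U.1.card = t ∧ cc U M = c then (1 : ℝ) else 0) =
        (((n / 2).choose (c + i) * (c + i).choose i * 2 ^ c : ℕ) : ℝ) := by
      intro M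
      have key := sum_oddSet_level_eq M hci (r := 1) (fun _ => 1) (fun _ => 1)
      simp only [Matrix.mul_one, trace_one, Fintype.card_fin, Nat.cast_one, dite_eq_ite] at key
      rw [key]
      have hodd : ∀ U' ∈ (univ : Finset (Fin n)).powerset.filter (fun U' =>
          (M.1.filter fun e => cutCount U' e = 1).card = c ∧ (M.1.filter fun e => cutCount U' e = 2).card = i),
          (if Odd U'.card then (1 : ℝ) else 0) = 1 := by
        intro U' hU'
        rw [mem_filter] at hU'
        have hc := card_eq_cr_add_two_mul_in M.2 (subset_univ U')
        rw [hU'.2.1, hU'.2.2, hci] at hc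
        rw [if_pos (hc ▸ htodd)]
      rw [sum_congr rfl hodd, sum_const, nsmul_eq_mul, mul_one, card_filter_cr_in_eq M.2, hN M]
    rw [e1, Fintype.sum_congr _ _ e2, sum_const, card_univ, nsmul_eq_mul]
  -- Step 4: assemble
  rw [hval]
  have hterm : ∀ c ∈ C, w c / ((Qset n t c).card : ℝ) *
      ∑ M : PMatch n, ∑ U : OddSet n,
        (if U.1.card = t ∧ cc U M = c then (A U * (A U)ᵀ * Y M).trace else 0) =
      (Fintype.card (PMatch n) : ℝ)⁻¹ * ∑ M : PMatch n, w c * (P M).eval (c : ℝ) := by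
    intro c hc
    obtain ⟨hcodd, -, hcT, hne⟩ := hC c hc
    have hct : c ≤ t := hcT.trans hTt
    obtain ⟨i, hi⟩ : ∃ i, c + 2 * i = t := by
      obtain ⟨a, ha⟩ := hcodd; obtain ⟨b, hb⟩ := htodd; exact ⟨b - a, by omega⟩
    have hQc := hQ c i hi
    have hQ0 : ((Qset n t c).card : ℝ) ≠ 0 := by exact_mod_cast (card_pos.2 hne).ne'
    have hT0 : (((n / 2).choose (c + i) * (c + i).choose i * 2 ^ c : ℕ) : ℝ) ≠ 0 := by
      intro h0; rw [h0, mul_zero] at hQc; exact hQ0 hQc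
    rw [sum_congr rfl fun M _ => hPval M c i hi, ← mul_sum, hQc, mul_sum, mul_sum, mul_sum]
    refine sum_congr rfl fun M _ => ?_
    field_simp
  rw [sum_congr rfl hterm, ← mul_sum, sum_comm]
  have hinner : ∀ M : PMatch n, ∑ c ∈ C, w c * (P M).eval (c : ℝ) = -(P M).eval 0 :=
    fun M => hexact (P M) (hPdeg M)
  rw [Fintype.sum_congr _ _ hinner]
  exact mul_nonpos_of_nonneg_of_nonpos (inv_nonneg.2 (Nat.cast_nonneg _))
    (by rw [sum_neg_distrib, neg_nonpos]; exact sum_nonneg fun M _ => hP0 M)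

end HalfDegreeLaw

end Literature.Combinatorics.Optimization.ChebyshevTracialDesignJunta

/-! ## The discharge (from `ChebyshevTracialDesignLowDegreeHolds.lean`) -/

namespace Literature.Combinatorics.Optimization

/-- **`DesignValueNonposLowDegree` holds** (unconditionally): the conditional theorem
`ChebyshevTracialDesignJunta.designValueNonposLowDegree_of_knapsack` composed with the tree's discharge of Grigoriev 2001
Lemma 1.4 (`Literature.Computability.Complexity.Grigoriev2001_knapsackFormNonneg_holds`).
[cite: Grigoriev2001, Lemma 1.4 (PDF p. 8)] [cite: Grigoriev2001TCS, Cor. 2 (p. 622)] -/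
theorem DesignValueNonposLowDegree_holds : DesignValueNonposLowDegree :=
  ChebyshevTracialDesignJunta.designValueNonposLowDegree_of_knapsack
    Literature.Computability.Complexity.Grigoriev2001_knapsackFormNonneg_holds

end Literature.Combinatorics.Optimization
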